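import Literature.MathematicalPhysics.QuantumLattice.GaugeGroups
import Mathlib.Probability.Independence.Basic
import Mathlib.MeasureTheory.Integral.Prod
import Mathlib.MeasureTheory.Measure.Tilted
import Mathlib.Analysis.Calculus.ParametricIntegral
import Mathlib.Analysis.SpecialFunctions.ExpDeriv
import Mathlib.Analysis.Calculus.Deriv.Inv
import Literature.MathematicalPhysics.QuantumLattice.StaggeredGaugeExpectationZeroCoupling
import Literature.MathematicalPhysics.QuantumFieldTheory.HaarMomentsSUN
import Literature.Barriers.QuantumFields.ToronPlaneAnticorrelation
import HarnessLib

/-!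
# Griffiths II fails for `SU(N)` plaquette energies (one-site witness) — `ToronPlaneAnticorrelation` HOLDS (re-homed proofs, file 2 of 2)

**Griffiths II FAILS for `SU(N)` Wilson plaquette energies, every `N ≥ 2` — the barrier fact
`Literature.Barriers.QuantumFields.ToronPlaneAnticorrelation` (`Literature/Barriers/QuantumFields/ToronPlaneAnticorrelation.lean`) HOLDS**:
for every `N ≥ 2` there are a periodic torus `(ℤ/L)⁴` and a coupling `β > 0` at which the `SU(N)` Wilson plaquette energies `Re tr U_p` of the
two plaquettes through the origin in complementary planes are NEGATIVELY correlated.  Witness (W1) of the barrier file: the one-site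
(Eguchi–Kawai) torus `L = 1`, where `Cov_β(Re tr U_(0;01), Re tr U_(0;23))` vanishes at `β = 0` (`oneSiteCovAtZero_proof`: independence of
disjoint link pairs under product Haar measure) and has derivative `(4/N²)·κ_N` there (`oneSiteCovDerivative_proof`: the first
`β`-cumulant of the Gibbs-tilted product Haar measure; the two in-plane plaquettes contribute `0`, the four mixed planes `κ_N/N²` each after
the inner Schur integration `∫ Re tr(g h g⁻¹ h⁻¹) dh = |tr g|²/N`) with the exact two-matrix Haar moment
`κ_N = ∫∫(|tr X|²−1)(|tr Y|²−1) Re tr(XYX⁻¹Y⁻¹) dX dY = −1/(N(N²−1)) < 0` (`commutatorSkewMoment_proof`; degree-two and bidegree-(2,2)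
invariant integration on `SU(N)` done by hand: B. Collins, P. Śniady, CMP 264 (2006) Cor. 2.4 [CollinsSniady2006]); one line of real
analysis (`f(0) = 0`, `f′(0) < 0 ⇒ f(β) < 0` for some small `β > 0`) finishes.  Consequently (`ToronPlaneAnticorrelation.exists_not_forall_admits`,
proved in the barrier file) for every `N ≥ 2` NO product-closed local association criterion (FKG/Holley, Ginibre systems, monotone
couplings) admits all the `SU(N)` Wilson plaquette terms of that arena [Ginibre1970] [Wilson1974].  The in-tree proof lived on the Summits
side only (`Summits/QuantumFields/YangMills/Theorems/ToronPlaneAnticorrelation.lean`, route `ToronCumulantSign`, plus the Haar-moment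
modules of the YMGap venture).  RE-HOMED into `Literature/` by the Hodge foundations lane (`lit-hodgefound`, seat p20, generation 38) as
TWO theorem-only files: verbatim DECLARATION-LEVEL ports (the declarations needed, in dependency order; the sources' `local notation3`
shorthands EXPANDED in place, so no notation is declared) of `Summits/Ventures/YMGap/{RobustBall/HaarSecondMoments,
Thresholds/HaarFourthMoment{SUN,SUNCross,,SU2Entries,SUNTrace},Thresholds/HaarThirdMomentSU3}.lean` and
`Summits/QuantumFields/YangMills/Theorems/ToronCumulantSign{HaarTwist,HaarMoments22,InnerMoment,CommutatorSkewMoment,OneSiteMoments,OneSiteFubini,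
OneSiteExpectations,TiltDerivative,OneSiteCovDerivative,OneSiteCovAtZero}.lean`, namespaces `Summit.Ventures.YMGap.…` re-rooted as
`Literature.MathematicalPhysics.QuantumFieldTheory.HaarMoments.…` and `Summit.QuantumFields.YangMills.Theorems.ToronCumulantSign` as
`Literature.MathematicalPhysics.QuantumFieldTheory.ToronCumulant` (the three route crux statements of `Theses/ToronCumulantSign.lean` UNFOLDED
verbatim into the crux theorems; the route's deciding theorem `closes` inlined into the discharge).  Built on the tree's Literature layer
(`MathematicalPhysics/QuantumLattice/*`, `MathematicalPhysics/QuantumFieldTheory/*`, `Barriers/QuantumFields/ToronPlaneAnticorrelation`) and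
Mathlib only; no definition, no new named fact (D-0026), no Summits import.  HONEST LABEL: a BARRIER-LEDGER result (a certified
obstruction: positive association of non-abelian plaquette energies cannot be certified by any product-closed local criterion); it proves
nothing about the Yang–Mills mass gap or any lattice-to-continuum statement.
THIS FILE (2 of 2; imports `HaarMomentsSUN.lean`): the commutator skew moment `κ_N = −1/(N(N²−1))`, the one-site Wilson measure as a
Gibbs-tilted product Haar measure (moments, Fubini, expectations), the tilt derivative, the covariance derivative `(4/N²)κ_N` at `β = 0`,
the covariance `0` at `β = 0`, and the EXACT-name discharge `Literature.Barriers.QuantumFields.ToronPlaneAnticorrelation_holds`.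
-/

noncomputable section

/-!
## Part 1 — port of `Summits/QuantumFields/YangMills/Theorems/ToronCumulantSignCommutatorSkewMoment.lean` (4 declarations kept)

# Route `ToronCumulantSign` — the crux `CommutatorSkewMoment` (stmt-QuantumFields-27530), PROVED

★★ For every `N ≥ 2`, with `dX, dY` the Haar probability measures of `SU(N)`:

  `κ_N := ∫∫ (|tr X|² − 1)(|tr Y|² − 1) Re tr(X Y X⁻¹ Y⁻¹) dX dY = −1/(N(N² − 1))`

(`N = 2`: `−1/6`, matching the barrier's Haar Monte Carlo `−0.1664(17)`, kit j022105; `N = 3`: `−1/24`).  Proof (no Weingarten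
calculus, invariance only): the inner `Y`-integral is `(|tr X|² − 1)·(N² − |tr X|²)/(N(N²−1))` by helper III
(`integral_normSqTrace_sub_one_traceConj`: the `|tr|²`-weighted second moment `γ_N δδ + C_N δδ` from the `ζ₅` phase-twist support
lemmas of helper I and the position-free modulus moments of helper II, minus the Schur term `|tr X|²/N`), and the outer
`X`-integral uses `∫|tr X|² = 1`, `∫|tr X|⁴ = 2` (venture files `RobustBall.HaarSecondMoments`, `HaarFourthMomentSUNTrace`;
`N = 2` via `∫ (Re tr)⁴ = 2` and reality of the `SU(2)` trace): `(N²·1 − 2 − N² + 1)/(N(N²−1)) = −1/(N(N²−1))`.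

HONEST LABEL: this closes crux 2 of the barrier-ledger line `ToronCumulantSign` (Griffiths II fails for `SU(N)` plaquette
energies on the one-site torus); crux 3 `OneSiteCovDerivative` remains OPEN here, so the barrier fact `ToronPlaneAnticorrelation`
is NOT yet discharged; nothing about any LADDER-YM rung or the Yang–Mills mass gap.

References: B. Collins, P. Śniady, CMP 264 (2006) 773–795, Cor. 2.4 [CollinsSniady2006]; M. Creutz, *Quarks, gluons and
lattices* (1983) §8 [doi:10.1017/9781009290395].

(Verbatim declaration-level port — the declarations listed in the Part header count — of the Summits-side module; route
bookkeeping of the source docstring, if any, is historical; `local notation3` shorthands of the source are expanded in place.)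
-/

section Part1

open _root_.MeasureTheory _root_.Complex
open Literature.MathematicalPhysics.QuantumLattice Literature.MathematicalPhysics.QuantumFieldTheory

namespace Literature.MathematicalPhysics.QuantumFieldTheory.ToronCumulant

open Literature.MathematicalPhysics.QuantumFieldTheory.HaarMoments

/-- The commutator read in matrices: `↑(X Y X⁻¹ Y⁻¹) = X Y X† Y†`. [cite: Wilson1974, §III (one-site Wilson action: Gibbs-tilted product Haar measure; bookkeeping)] -/
theorem coe_commutator {n : ℕ} (X Y : (Matrix.specialUnitaryGroup (Fin (2 + n)) ℂ)) :
    ((X * Y * X⁻¹ * Y⁻¹ : (Matrix.specialUnitaryGroup (Fin (2 + n)) ℂ)) : Matrix (Fin (2 + n)) (Fin (2 + n)) ℂ) =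
      (X : Matrix (Fin (2 + n)) (Fin (2 + n)) ℂ) * (Y : Matrix (Fin (2 + n)) (Fin (2 + n)) ℂ) *
        (X : Matrix (Fin (2 + n)) (Fin (2 + n)) ℂ).conjTranspose * (Y : Matrix (Fin (2 + n)) (Fin (2 + n)) ℂ).conjTranspose := by
  rfl

/-- ★ **The inner integral in closed form**: for `X ∈ SU(N)`,
`∫ (|tr X|² − 1)(|tr Y|² − 1) Re tr(XYX⁻¹Y⁻¹) dY = (|tr X|² − 1)(N² − |tr X|²)/(N(N²−1))`. [cite: Wilson1974, §III (one-site Wilson action: Gibbs-tilted product Haar measure; bookkeeping)] -/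
theorem inner_integral_eq {n : ℕ} (X : (Matrix.specialUnitaryGroup (Fin (2 + n)) ℂ)) :
    ∫ Y, (Complex.normSq (X : Matrix (Fin (2 + n)) (Fin (2 + n)) ℂ).trace - 1) *
        (Complex.normSq (Y : Matrix (Fin (2 + n)) (Fin (2 + n)) ℂ).trace - 1) *
        ((X * Y * X⁻¹ * Y⁻¹ : (Matrix.specialUnitaryGroup (Fin (2 + n)) ℂ)) : Matrix (Fin (2 + n)) (Fin (2 + n)) ℂ).trace.re ∂haarProbability ((Matrix.specialUnitaryGroup (Fin (2 + n)) ℂ)) =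
      (Complex.normSq (X : Matrix (Fin (2 + n)) (Fin (2 + n)) ℂ).trace - 1) *
        (((2 + n : ℝ) ^ 2 - Complex.normSq (X : Matrix (Fin (2 + n)) (Fin (2 + n)) ℂ).trace) /
          ((2 + n : ℝ) * ((1 + n : ℝ) * (3 + n)))) := by
  set XM : Matrix (Fin (2 + n)) (Fin (2 + n)) ℂ := (X : Matrix (Fin (2 + n)) (Fin (2 + n)) ℂ) with hXM
  have hρ := TorusAreaLaw.isSpecialUnitaryModel_fundamentalRep (2 + n)
  have hXu : XM ∈ Matrix.unitaryGroup (Fin (2 + n)) ℂ := X.2.1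
  -- the complex integrand `F(Y) = (|tr Y|² − 1) tr(X Y X† Y†)` and its integral (helper III)
  have hF := integral_normSqTrace_sub_one_traceConj (fundamentalRep (Fin (2 + n))) hρ hXu
  simp only [fundamentalRep_apply] at hF
  have hcont : Continuous fun Y : (Matrix.specialUnitaryGroup (Fin (2 + n)) ℂ) => ((((Complex.normSq (Y : Matrix (Fin (2 + n)) (Fin (2 + n)) ℂ).trace : ℝ) : ℂ) - 1) *
      (XM * (Y : Matrix (Fin (2 + n)) (Fin (2 + n)) ℂ) * XM.conjTranspose *
        (Y : Matrix (Fin (2 + n)) (Fin (2 + n)) ℂ).conjTranspose).trace) := by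
    have h1 : Continuous fun Y : (Matrix.specialUnitaryGroup (Fin (2 + n)) ℂ) => (Y : Matrix (Fin (2 + n)) (Fin (2 + n)) ℂ) := continuous_subtype_val
    refine ((Complex.continuous_ofReal.comp (Complex.continuous_normSq.comp (continuous_id.matrix_trace.comp h1))).sub
      continuous_const).mul ?_
    exact continuous_id.matrix_trace.comp
      (((continuous_const.mul h1).mul continuous_const).mul (continuous_id.matrix_conjTranspose.comp h1))
  have hint : Integrable (fun Y : (Matrix.specialUnitaryGroup (Fin (2 + n)) ℂ) => ((((Complex.normSq (Y : Matrix (Fin (2 + n)) (Fin (2 + n)) ℂ).trace : ℝ) : ℂ) - 1) *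
      (XM * (Y : Matrix (Fin (2 + n)) (Fin (2 + n)) ℂ) * XM.conjTranspose *
        (Y : Matrix (Fin (2 + n)) (Fin (2 + n)) ℂ).conjTranspose).trace)) (haarProbability ((Matrix.specialUnitaryGroup (Fin (2 + n)) ℂ))) :=
    hcont.integrable_of_hasCompactSupport (HasCompactSupport.of_compactSpace _)
  -- the real integrand is `(|tr X|² − 1) · Re F(Y)`
  have hpt : ∀ Y : (Matrix.specialUnitaryGroup (Fin (2 + n)) ℂ), (Complex.normSq XM.trace - 1) *
      (Complex.normSq (Y : Matrix (Fin (2 + n)) (Fin (2 + n)) ℂ).trace - 1) *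
        ((X * Y * X⁻¹ * Y⁻¹ : (Matrix.specialUnitaryGroup (Fin (2 + n)) ℂ)) : Matrix (Fin (2 + n)) (Fin (2 + n)) ℂ).trace.re =
      (Complex.normSq XM.trace - 1) * ((((Complex.normSq (Y : Matrix (Fin (2 + n)) (Fin (2 + n)) ℂ).trace : ℝ) : ℂ) - 1) *
        (XM * (Y : Matrix (Fin (2 + n)) (Fin (2 + n)) ℂ) * XM.conjTranspose *
          (Y : Matrix (Fin (2 + n)) (Fin (2 + n)) ℂ).conjTranspose).trace).re := by
    intro Y
    rw [coe_commutator, ← Complex.ofReal_one, ← Complex.ofReal_sub, Complex.re_ofReal_mul, mul_assoc]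
  simp_rw [hpt]
  rw [integral_const_mul]
  congr 1
  have hre := integral_re hint
  simp only [RCLike.re_to_complex] at hre
  rw [hre, hF, Complex.ofReal_re]

/-- `∫_{SU(N)} |tr X|⁴ dX = 2` for every `N ≥ 2` (venture `integral_normSq_trace_sq_suN` for `N ≥ 3`; `N = 2` from
`∫ (Re tr)⁴ = 2` and the reality of the `SU(2)` trace). [cite: Wilson1974, §III (one-site Wilson action: Gibbs-tilted product Haar measure; bookkeeping)] -/
theorem integral_normSq_trace_sq_two_add (n : ℕ) :
    ∫ X, Complex.normSq (X : Matrix (Fin (2 + n)) (Fin (2 + n)) ℂ).trace ^ 2 ∂haarProbability ((Matrix.specialUnitaryGroup (Fin (2 + n)) ℂ)) = 2 := by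
  rcases Nat.eq_zero_or_pos n with hn | hn
  · subst hn
    have h := HaarFourthMoment.integral_reTr_pow_four_su2
    have hreal : ∀ X : (Matrix.specialUnitaryGroup (Fin (2 + 0)) ℂ), Complex.normSq (X : Matrix (Fin (2 + 0)) (Fin (2 + 0)) ℂ).trace ^ 2 =
        ((X : Matrix (Fin 2) (Fin 2) ℂ).trace.re) ^ 4 := by
      intro X
      have hc := RobustBall.HaarSecondMoments.conj_trace_eq_of_two (fundamentalRep (Fin 2))
        (TorusAreaLaw.isSpecialUnitaryModel_fundamentalRep 2) X
      simp only [fundamentalRep_apply] at hc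
      have him : ((X : Matrix (Fin 2) (Fin 2) ℂ).trace).im = 0 := Complex.conj_eq_iff_im.mp hc
      have : Complex.normSq (X : Matrix (Fin 2) (Fin 2) ℂ).trace = ((X : Matrix (Fin 2) (Fin 2) ℂ).trace.re) ^ 2 := by
        rw [Complex.normSq_apply, him]; ring
      change Complex.normSq (X : Matrix (Fin 2) (Fin 2) ℂ).trace ^ 2 = _
      rw [this]; ring
    simp_rw [hreal]
    exact h
  · exact HaarFourthMomentSUN.integral_normSq_trace_sq_suN (N := 2 + n) (by omega)

/-- ★★ **Crux `CommutatorSkewMoment` of route `ToronCumulantSign`** (stmt-QuantumFields-27530): `κ_N = −1/(N(N²−1))` for every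
`N ≥ 2`. [cite: Wilson1974, §III (one-site Wilson action: Gibbs-tilted product Haar measure; bookkeeping)] -/
theorem commutatorSkewMoment_proof :
    ∀ N : ℕ, 2 ≤ N → ∫ X, ∫ Y, (Complex.normSq (X : Matrix (Fin N) (Fin N) ℂ).trace - 1) * (Complex.normSq (Y : Matrix (Fin N) (Fin N) ℂ).trace - 1) * ((X * Y * X⁻¹ * Y⁻¹ : Matrix.specialUnitaryGroup (Fin N) ℂ) : Matrix (Fin N) (Fin N) ℂ).trace.re ∂Literature.MathematicalPhysics.QuantumFieldTheory.haarProbability (Matrix.specialUnitaryGroup (Fin N) ℂ) ∂Literature.MathematicalPhysics.QuantumFieldTheory.haarProbability (Matrix.specialUnitaryGroup (Fin N) ℂ) = -1 / ((N : ℝ) * ((N : ℝ) ^ 2 - 1)) := by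
  intro N hN
  obtain ⟨n, rfl⟩ := Nat.exists_eq_add_of_le hN
  simp_rw [inner_integral_eq]
  -- the outer integral: `∫ (a − 1)(N² − a)/D da` with `∫ a = 1`, `∫ a² = 2`
  set D : ℝ := (2 + n : ℝ) * ((1 + n : ℝ) * (3 + n)) with hD
  have hDpos : 0 < D := by rw [hD]; positivity
  have hc : Continuous fun X : (Matrix.specialUnitaryGroup (Fin (2 + n)) ℂ) => Complex.normSq (X : Matrix (Fin (2 + n)) (Fin (2 + n)) ℂ).trace :=
    Complex.continuous_normSq.comp (continuous_id.matrix_trace.comp continuous_subtype_val)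
  have hi1 : Integrable (fun X : (Matrix.specialUnitaryGroup (Fin (2 + n)) ℂ) => Complex.normSq (X : Matrix (Fin (2 + n)) (Fin (2 + n)) ℂ).trace)
      (haarProbability ((Matrix.specialUnitaryGroup (Fin (2 + n)) ℂ))) := hc.integrable_of_hasCompactSupport (HasCompactSupport.of_compactSpace _)
  have hi2 : Integrable (fun X : (Matrix.specialUnitaryGroup (Fin (2 + n)) ℂ) => Complex.normSq (X : Matrix (Fin (2 + n)) (Fin (2 + n)) ℂ).trace ^ 2)
      (haarProbability ((Matrix.specialUnitaryGroup (Fin (2 + n)) ℂ))) := (hc.pow 2).integrable_of_hasCompactSupport (HasCompactSupport.of_compactSpace _)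
  have hpt : ∀ X : (Matrix.specialUnitaryGroup (Fin (2 + n)) ℂ), (Complex.normSq (X : Matrix (Fin (2 + n)) (Fin (2 + n)) ℂ).trace - 1) *
      (((2 + n : ℝ) ^ 2 - Complex.normSq (X : Matrix (Fin (2 + n)) (Fin (2 + n)) ℂ).trace) / D) =
      D⁻¹ * ((((2 + n : ℝ) ^ 2 + 1) * Complex.normSq (X : Matrix (Fin (2 + n)) (Fin (2 + n)) ℂ).trace -
        Complex.normSq (X : Matrix (Fin (2 + n)) (Fin (2 + n)) ℂ).trace ^ 2) - (2 + n : ℝ) ^ 2) := by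
    intro X
    field_simp
    ring
  simp_rw [hpt]
  have hi3 : Integrable (fun X : (Matrix.specialUnitaryGroup (Fin (2 + n)) ℂ) => ((2 + n : ℝ) ^ 2 + 1) * Complex.normSq (X : Matrix (Fin (2 + n)) (Fin (2 + n)) ℂ).trace -
      Complex.normSq (X : Matrix (Fin (2 + n)) (Fin (2 + n)) ℂ).trace ^ 2) (haarProbability ((Matrix.specialUnitaryGroup (Fin (2 + n)) ℂ))) :=
    (hi1.const_mul _).sub hi2
  rw [integral_const_mul, integral_sub hi3 (integrable_const _), integral_sub (hi1.const_mul _) hi2,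
    integral_const_mul, integral_normSq_trace_sq_two_add n,
    RobustBall.HaarSecondMoments.integral_normSq_trace_suN (N := 2 + n) (by omega), integral_const]
  simp only [probReal_univ, smul_eq_mul, one_mul]
  rw [hD]
  push_cast
  have hden : (2 + (n : ℝ)) * ((2 + (n : ℝ)) ^ 2 - 1) = (2 + n) * ((1 + n) * (3 + n)) := by ring
  rw [hden]
  have hpos1 : (0 : ℝ) < (1 + n : ℝ) := by positivity
  have hpos2 : (0 : ℝ) < (2 + n : ℝ) := by positivity
  have hpos3 : (0 : ℝ) < (3 + n : ℝ) := by positivity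
  field_simp
  ring

end Literature.MathematicalPhysics.QuantumFieldTheory.ToronCumulant

end Part1

/-!
## Part 2 — port of `Summits/QuantumFields/YangMills/Theorems/ToronCumulantSignOneSiteMoments.lean` (18 declarations kept)

# Route `ToronCumulantSign`, crux `OneSiteCovDerivative` (stmt-QuantumFields-27531) — helper III:
# the commutator energy `R(X,Y) = Re tr(XYX⁻¹Y⁻¹)` on `SU(N)` and the iterated Haar integrals of the one-site cumulant

With `R(X,Y) = Re tr(X Y X⁻¹ Y⁻¹)` (the one-site plaquette energy, `plaquetteHolonomy_oneSite`) and `w(X) = |tr X|²` on `SU(N)`,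
`N = 2 + n ≥ 2`: `R(X,Y) = R(Y,X)`; the Schur integrals `∫ R(X,Y) dY = w(X)/N = ∫ R(Y,X) dY` (helper `integral_traceConj`);
and the purely formal reductions of the fourfold iterated integrals that occur in the first `β`-cumulant of the one-site
complementary-plane covariance: for "readers" `A, B : G → G → ℝ` with `∫ A(x,x') dx' = w(x)/N`, `∫ B(y,y') dy' = w(y)/N`,
  `∫∫∫∫ A(x,x') B(y,y') R(x,y) = N⁻² ∫∫ w(x) w(y) R(x,y)`,  `∫∫∫∫ A(x,x') R(x,y) = N⁻¹ ∫∫ w(x) R(x,y)`,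
  `∫∫∫∫ B(y,y') R(x,y) = N⁻¹ ∫∫ w(y) R(x,y)`,  `∫∫∫∫ R(x,y) = ∫∫ R(x,y)`, and the in-plane factorizations.
HONEST LABEL: bookkeeping toward the OPEN crux `OneSiteCovDerivative`; nothing about the Yang–Mills mass gap.

References: Yu. Makeenko, *Methods of contemporary gauge theory* §14.3 (the one-site / Eguchi–Kawai model); M. Creutz,
*Quarks, gluons and lattices* (1983) §8.

(Verbatim declaration-level port — the declarations listed in the Part header count — of the Summits-side module; route
bookkeeping of the source docstring, if any, is historical; `local notation3` shorthands of the source are expanded in place.)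
-/

section Part2

open _root_.MeasureTheory _root_.Complex
open Literature.MathematicalPhysics.QuantumLattice Literature.MathematicalPhysics.QuantumFieldTheory

namespace Literature.MathematicalPhysics.QuantumFieldTheory.ToronCumulant

open Literature.MathematicalPhysics.QuantumFieldTheory.HaarMoments

section OneSite

variable {n : ℕ}

/-- The commutator read in matrices. [cite: Wilson1974, §III (one-site Wilson action: Gibbs-tilted product Haar measure; bookkeeping)] -/
theorem coe_comm (X Y : (Matrix.specialUnitaryGroup (Fin (2 + n)) ℂ)) : ((X * Y * X⁻¹ * Y⁻¹ : (Matrix.specialUnitaryGroup (Fin (2 + n)) ℂ)) : Matrix (Fin (2 + n)) (Fin (2 + n)) ℂ) =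
    (((X : (Matrix.specialUnitaryGroup (Fin (2 + n)) ℂ)) : Matrix (Fin (2 + n)) (Fin (2 + n)) ℂ)) * (((Y : (Matrix.specialUnitaryGroup (Fin (2 + n)) ℂ)) : Matrix (Fin (2 + n)) (Fin (2 + n)) ℂ)) * ((((X : (Matrix.specialUnitaryGroup (Fin (2 + n)) ℂ)) : Matrix (Fin (2 + n)) (Fin (2 + n)) ℂ))).conjTranspose * ((((Y : (Matrix.specialUnitaryGroup (Fin (2 + n)) ℂ)) : Matrix (Fin (2 + n)) (Fin (2 + n)) ℂ))).conjTranspose := rfl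

/-- **Symmetry of the commutator energy**: `Re tr(XYX⁻¹Y⁻¹) = Re tr(YXY⁻¹X⁻¹)` (`[Y,X] = [X,Y]†`). [cite: Wilson1974, §III (one-site Wilson action: Gibbs-tilted product Haar measure; bookkeeping)] -/
theorem R_symm (X Y : (Matrix.specialUnitaryGroup (Fin (2 + n)) ℂ)) : ((((X * Y * X⁻¹ * Y⁻¹ : (Matrix.specialUnitaryGroup (Fin (2 + n)) ℂ)) : Matrix (Fin (2 + n)) (Fin (2 + n)) ℂ).trace.re : ℝ)) = ((((Y * X * Y⁻¹ * X⁻¹ : (Matrix.specialUnitaryGroup (Fin (2 + n)) ℂ)) : Matrix (Fin (2 + n)) (Fin (2 + n)) ℂ).trace.re : ℝ)) := by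
  rw [coe_comm, coe_comm]
  have h : ((((Y : (Matrix.specialUnitaryGroup (Fin (2 + n)) ℂ)) : Matrix (Fin (2 + n)) (Fin (2 + n)) ℂ)) * (((X : (Matrix.specialUnitaryGroup (Fin (2 + n)) ℂ)) : Matrix (Fin (2 + n)) (Fin (2 + n)) ℂ)) * ((((Y : (Matrix.specialUnitaryGroup (Fin (2 + n)) ℂ)) : Matrix (Fin (2 + n)) (Fin (2 + n)) ℂ))).conjTranspose * ((((X : (Matrix.specialUnitaryGroup (Fin (2 + n)) ℂ)) : Matrix (Fin (2 + n)) (Fin (2 + n)) ℂ))).conjTranspose) =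
      ((((X : (Matrix.specialUnitaryGroup (Fin (2 + n)) ℂ)) : Matrix (Fin (2 + n)) (Fin (2 + n)) ℂ)) * (((Y : (Matrix.specialUnitaryGroup (Fin (2 + n)) ℂ)) : Matrix (Fin (2 + n)) (Fin (2 + n)) ℂ)) * ((((X : (Matrix.specialUnitaryGroup (Fin (2 + n)) ℂ)) : Matrix (Fin (2 + n)) (Fin (2 + n)) ℂ))).conjTranspose * ((((Y : (Matrix.specialUnitaryGroup (Fin (2 + n)) ℂ)) : Matrix (Fin (2 + n)) (Fin (2 + n)) ℂ))).conjTranspose).conjTranspose := by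
    simp only [Matrix.conjTranspose_mul, Matrix.conjTranspose_conjTranspose, Matrix.mul_assoc]
  rw [h, Matrix.trace_conjTranspose, Complex.star_def, Complex.conj_re]

/-- Continuity of `(X, Y) ↦ R(X,Y)`. [cite: Wilson1974, §III (one-site Wilson action: Gibbs-tilted product Haar measure; bookkeeping)] -/
theorem continuous_R : Continuous fun z : (Matrix.specialUnitaryGroup (Fin (2 + n)) ℂ) × (Matrix.specialUnitaryGroup (Fin (2 + n)) ℂ) => ((((z.1 * z.2 * z.1⁻¹ * z.2⁻¹ : (Matrix.specialUnitaryGroup (Fin (2 + n)) ℂ)) : Matrix (Fin (2 + n)) (Fin (2 + n)) ℂ).trace.re : ℝ)) := by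
  have h : Continuous fun z : (Matrix.specialUnitaryGroup (Fin (2 + n)) ℂ) × (Matrix.specialUnitaryGroup (Fin (2 + n)) ℂ) => (z.1 * z.2 * z.1⁻¹ * z.2⁻¹ : (Matrix.specialUnitaryGroup (Fin (2 + n)) ℂ)) := by fun_prop
  exact Complex.continuous_re.comp (continuous_id.matrix_trace.comp (continuous_subtype_val.comp h))

/-- Continuity of `Y ↦ R(X,Y)` for fixed `X`. [cite: Wilson1974, §III (one-site Wilson action: Gibbs-tilted product Haar measure; bookkeeping)] -/
theorem continuous_R_right (X : (Matrix.specialUnitaryGroup (Fin (2 + n)) ℂ)) : Continuous fun Y : (Matrix.specialUnitaryGroup (Fin (2 + n)) ℂ) => ((((X * Y * X⁻¹ * Y⁻¹ : (Matrix.specialUnitaryGroup (Fin (2 + n)) ℂ)) : Matrix (Fin (2 + n)) (Fin (2 + n)) ℂ).trace.re : ℝ)) := by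
  have h : Continuous fun Y : (Matrix.specialUnitaryGroup (Fin (2 + n)) ℂ) => (X * Y * X⁻¹ * Y⁻¹ : (Matrix.specialUnitaryGroup (Fin (2 + n)) ℂ)) := by fun_prop
  exact Complex.continuous_re.comp (continuous_id.matrix_trace.comp (continuous_subtype_val.comp h))

/-- Continuity of `X ↦ w(X) = |tr X|²`. [cite: Wilson1974, §III (one-site Wilson action: Gibbs-tilted product Haar measure; bookkeeping)] -/
theorem continuous_w : Continuous fun X : (Matrix.specialUnitaryGroup (Fin (2 + n)) ℂ) => ((Complex.normSq (Matrix.trace ((((X : (Matrix.specialUnitaryGroup (Fin (2 + n)) ℂ)) : Matrix (Fin (2 + n)) (Fin (2 + n)) ℂ)))) : ℝ)) :=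
  Complex.continuous_normSq.comp (continuous_id.matrix_trace.comp continuous_subtype_val)

/-- ★ **Schur integral over the second argument**: `∫ R(X,Y) dY = |tr X|²/N`. [cite: Wilson1974, §III (one-site Wilson action: Gibbs-tilted product Haar measure; bookkeeping)] -/
theorem integral_R_right (X : (Matrix.specialUnitaryGroup (Fin (2 + n)) ℂ)) : ∫ Y, ((((X * Y * X⁻¹ * Y⁻¹ : (Matrix.specialUnitaryGroup (Fin (2 + n)) ℂ)) : Matrix (Fin (2 + n)) (Fin (2 + n)) ℂ).trace.re : ℝ)) ∂(haarProbability (Matrix.specialUnitaryGroup (Fin (2 + n)) ℂ)) = ((Complex.normSq (Matrix.trace ((((X : (Matrix.specialUnitaryGroup (Fin (2 + n)) ℂ)) : Matrix (Fin (2 + n)) (Fin (2 + n)) ℂ)))) : ℝ)) / (2 + n : ℝ) := by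
  have hρ := TorusAreaLaw.isSpecialUnitaryModel_fundamentalRep (2 + n)
  have h := integral_traceConj (fundamentalRep (Fin (2 + n))) hρ ((((X : (Matrix.specialUnitaryGroup (Fin (2 + n)) ℂ)) : Matrix (Fin (2 + n)) (Fin (2 + n)) ℂ)))
  simp only [fundamentalRep_apply] at h
  have hc : Continuous fun Y : (Matrix.specialUnitaryGroup (Fin (2 + n)) ℂ) => ((((X : (Matrix.specialUnitaryGroup (Fin (2 + n)) ℂ)) : Matrix (Fin (2 + n)) (Fin (2 + n)) ℂ)) * (((Y : (Matrix.specialUnitaryGroup (Fin (2 + n)) ℂ)) : Matrix (Fin (2 + n)) (Fin (2 + n)) ℂ)) * ((((X : (Matrix.specialUnitaryGroup (Fin (2 + n)) ℂ)) : Matrix (Fin (2 + n)) (Fin (2 + n)) ℂ))).conjTranspose * ((((Y : (Matrix.specialUnitaryGroup (Fin (2 + n)) ℂ)) : Matrix (Fin (2 + n)) (Fin (2 + n)) ℂ))).conjTranspose).trace :=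
    continuous_id.matrix_trace.comp (((continuous_const.mul continuous_subtype_val).mul continuous_const).mul
      (continuous_id.matrix_conjTranspose.comp continuous_subtype_val))
  have hint : Integrable (fun Y : (Matrix.specialUnitaryGroup (Fin (2 + n)) ℂ) => ((((X : (Matrix.specialUnitaryGroup (Fin (2 + n)) ℂ)) : Matrix (Fin (2 + n)) (Fin (2 + n)) ℂ)) * (((Y : (Matrix.specialUnitaryGroup (Fin (2 + n)) ℂ)) : Matrix (Fin (2 + n)) (Fin (2 + n)) ℂ)) * ((((X : (Matrix.specialUnitaryGroup (Fin (2 + n)) ℂ)) : Matrix (Fin (2 + n)) (Fin (2 + n)) ℂ))).conjTranspose * ((((Y : (Matrix.specialUnitaryGroup (Fin (2 + n)) ℂ)) : Matrix (Fin (2 + n)) (Fin (2 + n)) ℂ))).conjTranspose).trace) (haarProbability (Matrix.specialUnitaryGroup (Fin (2 + n)) ℂ)) :=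
    hc.integrable_of_hasCompactSupport (HasCompactSupport.of_compactSpace _)
  have hre := integral_re hint
  simp only [RCLike.re_to_complex] at hre
  simp_rw [coe_comm]
  rw [hre, h]
  have e : ((2 + n : ℕ) : ℂ)⁻¹ * ((((Complex.normSq (Matrix.trace ((((X : (Matrix.specialUnitaryGroup (Fin (2 + n)) ℂ)) : Matrix (Fin (2 + n)) (Fin (2 + n)) ℂ)))) : ℝ)) : ℝ) : ℂ) = (((((Complex.normSq (Matrix.trace ((((X : (Matrix.specialUnitaryGroup (Fin (2 + n)) ℂ)) : Matrix (Fin (2 + n)) (Fin (2 + n)) ℂ)))) : ℝ)) / (2 + n : ℝ)) : ℝ) : ℂ) := by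
    push_cast
    ring
  rw [e, Complex.ofReal_re]

/-- ★ **Schur integral over the first argument**: `∫ R(X,Y) dX = |tr Y|²/N`. [cite: Wilson1974, §III (one-site Wilson action: Gibbs-tilted product Haar measure; bookkeeping)] -/
theorem integral_R_left (Y : (Matrix.specialUnitaryGroup (Fin (2 + n)) ℂ)) : ∫ X, ((((X * Y * X⁻¹ * Y⁻¹ : (Matrix.specialUnitaryGroup (Fin (2 + n)) ℂ)) : Matrix (Fin (2 + n)) (Fin (2 + n)) ℂ).trace.re : ℝ)) ∂(haarProbability (Matrix.specialUnitaryGroup (Fin (2 + n)) ℂ)) = ((Complex.normSq (Matrix.trace ((((Y : (Matrix.specialUnitaryGroup (Fin (2 + n)) ℂ)) : Matrix (Fin (2 + n)) (Fin (2 + n)) ℂ)))) : ℝ)) / (2 + n : ℝ) := by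
  simp_rw [R_symm _ Y]
  exact integral_R_right Y

/-- `∫ |tr X|² dX = 1`. [cite: Wilson1974, §III (one-site Wilson action: Gibbs-tilted product Haar measure; bookkeeping)] -/
theorem integral_w : ∫ X, ((Complex.normSq (Matrix.trace ((((X : (Matrix.specialUnitaryGroup (Fin (2 + n)) ℂ)) : Matrix (Fin (2 + n)) (Fin (2 + n)) ℂ)))) : ℝ)) ∂(haarProbability (Matrix.specialUnitaryGroup (Fin (2 + n)) ℂ)) = 1 :=
  RobustBall.HaarSecondMoments.integral_normSq_trace_suN (N := 2 + n) (by omega)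

/-- Mixed plane, term `E[P Q P_p]`: `∫∫∫∫ A(x,x') B(y,y') R(x,y) = N⁻² ∫∫ w(x) w(y) R(x,y)`. [cite: Wilson1974, §III (one-site Wilson action: Gibbs-tilted product Haar measure; bookkeeping)] -/
theorem iter_mixed_PQR (A B : (Matrix.specialUnitaryGroup (Fin (2 + n)) ℂ) → (Matrix.specialUnitaryGroup (Fin (2 + n)) ℂ) → ℝ) (hA : ∀ x, ∫ x', A x x' ∂(haarProbability (Matrix.specialUnitaryGroup (Fin (2 + n)) ℂ)) = ((Complex.normSq (Matrix.trace ((((x : (Matrix.specialUnitaryGroup (Fin (2 + n)) ℂ)) : Matrix (Fin (2 + n)) (Fin (2 + n)) ℂ)))) : ℝ)) / (2 + n : ℝ))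
    (hB : ∀ y, ∫ y', B y y' ∂(haarProbability (Matrix.specialUnitaryGroup (Fin (2 + n)) ℂ)) = ((Complex.normSq (Matrix.trace ((((y : (Matrix.specialUnitaryGroup (Fin (2 + n)) ℂ)) : Matrix (Fin (2 + n)) (Fin (2 + n)) ℂ)))) : ℝ)) / (2 + n : ℝ)) :
    ∫ x, ∫ x', ∫ y, ∫ y', A x x' * B y y' * ((((x * y * x⁻¹ * y⁻¹ : (Matrix.specialUnitaryGroup (Fin (2 + n)) ℂ)) : Matrix (Fin (2 + n)) (Fin (2 + n)) ℂ).trace.re : ℝ)) ∂(haarProbability (Matrix.specialUnitaryGroup (Fin (2 + n)) ℂ)) ∂(haarProbability (Matrix.specialUnitaryGroup (Fin (2 + n)) ℂ)) ∂(haarProbability (Matrix.specialUnitaryGroup (Fin (2 + n)) ℂ)) ∂(haarProbability (Matrix.specialUnitaryGroup (Fin (2 + n)) ℂ)) =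
      (1 / (2 + n : ℝ)) ^ 2 * ∫ x, ∫ y, ((Complex.normSq (Matrix.trace ((((x : (Matrix.specialUnitaryGroup (Fin (2 + n)) ℂ)) : Matrix (Fin (2 + n)) (Fin (2 + n)) ℂ)))) : ℝ)) * ((Complex.normSq (Matrix.trace ((((y : (Matrix.specialUnitaryGroup (Fin (2 + n)) ℂ)) : Matrix (Fin (2 + n)) (Fin (2 + n)) ℂ)))) : ℝ)) * ((((x * y * x⁻¹ * y⁻¹ : (Matrix.specialUnitaryGroup (Fin (2 + n)) ℂ)) : Matrix (Fin (2 + n)) (Fin (2 + n)) ℂ).trace.re : ℝ)) ∂(haarProbability (Matrix.specialUnitaryGroup (Fin (2 + n)) ℂ)) ∂(haarProbability (Matrix.specialUnitaryGroup (Fin (2 + n)) ℂ)) := by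
  have h1 : ∀ x x' y, ∫ y', A x x' * B y y' * ((((x * y * x⁻¹ * y⁻¹ : (Matrix.specialUnitaryGroup (Fin (2 + n)) ℂ)) : Matrix (Fin (2 + n)) (Fin (2 + n)) ℂ).trace.re : ℝ)) ∂(haarProbability (Matrix.specialUnitaryGroup (Fin (2 + n)) ℂ)) = A x x' * (((((x * y * x⁻¹ * y⁻¹ : (Matrix.specialUnitaryGroup (Fin (2 + n)) ℂ)) : Matrix (Fin (2 + n)) (Fin (2 + n)) ℂ).trace.re : ℝ)) * (((Complex.normSq (Matrix.trace ((((y : (Matrix.specialUnitaryGroup (Fin (2 + n)) ℂ)) : Matrix (Fin (2 + n)) (Fin (2 + n)) ℂ)))) : ℝ)) / (2 + n : ℝ))) := by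
    intro x x' y
    rw [← hB y, ← integral_const_mul, ← integral_const_mul]
    refine integral_congr_ae (ae_of_all _ fun y' => ?_); beta_reduce; ring
  simp_rw [h1, integral_const_mul]
  have h2 : ∀ x, ∫ x', A x x' * ∫ y, ((((x * y * x⁻¹ * y⁻¹ : (Matrix.specialUnitaryGroup (Fin (2 + n)) ℂ)) : Matrix (Fin (2 + n)) (Fin (2 + n)) ℂ).trace.re : ℝ)) * (((Complex.normSq (Matrix.trace ((((y : (Matrix.specialUnitaryGroup (Fin (2 + n)) ℂ)) : Matrix (Fin (2 + n)) (Fin (2 + n)) ℂ)))) : ℝ)) / (2 + n : ℝ)) ∂(haarProbability (Matrix.specialUnitaryGroup (Fin (2 + n)) ℂ)) ∂(haarProbability (Matrix.specialUnitaryGroup (Fin (2 + n)) ℂ)) =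
      (((Complex.normSq (Matrix.trace ((((x : (Matrix.specialUnitaryGroup (Fin (2 + n)) ℂ)) : Matrix (Fin (2 + n)) (Fin (2 + n)) ℂ)))) : ℝ)) / (2 + n : ℝ)) * ∫ y, ((((x * y * x⁻¹ * y⁻¹ : (Matrix.specialUnitaryGroup (Fin (2 + n)) ℂ)) : Matrix (Fin (2 + n)) (Fin (2 + n)) ℂ).trace.re : ℝ)) * (((Complex.normSq (Matrix.trace ((((y : (Matrix.specialUnitaryGroup (Fin (2 + n)) ℂ)) : Matrix (Fin (2 + n)) (Fin (2 + n)) ℂ)))) : ℝ)) / (2 + n : ℝ)) ∂(haarProbability (Matrix.specialUnitaryGroup (Fin (2 + n)) ℂ)) := by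
    intro x
    rw [integral_mul_const, hA x]
  simp_rw [h2]
  simp only [← integral_const_mul]
  refine integral_congr_ae (ae_of_all _ fun x => ?_)
  beta_reduce
  refine integral_congr_ae (ae_of_all _ fun y => ?_)
  beta_reduce
  ring

/-- Mixed plane, term `E[P P_p]`: `∫∫∫∫ A(x,x') R(x,y) = N⁻¹ ∫∫ w(x) R(x,y)`. [cite: Wilson1974, §III (one-site Wilson action: Gibbs-tilted product Haar measure; bookkeeping)] -/
theorem iter_mixed_PR (A : (Matrix.specialUnitaryGroup (Fin (2 + n)) ℂ) → (Matrix.specialUnitaryGroup (Fin (2 + n)) ℂ) → ℝ) (hA : ∀ x, ∫ x', A x x' ∂(haarProbability (Matrix.specialUnitaryGroup (Fin (2 + n)) ℂ)) = ((Complex.normSq (Matrix.trace ((((x : (Matrix.specialUnitaryGroup (Fin (2 + n)) ℂ)) : Matrix (Fin (2 + n)) (Fin (2 + n)) ℂ)))) : ℝ)) / (2 + n : ℝ)) :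
    ∫ x, ∫ x', ∫ y, ∫ _y' : (Matrix.specialUnitaryGroup (Fin (2 + n)) ℂ), A x x' * ((((x * y * x⁻¹ * y⁻¹ : (Matrix.specialUnitaryGroup (Fin (2 + n)) ℂ)) : Matrix (Fin (2 + n)) (Fin (2 + n)) ℂ).trace.re : ℝ)) ∂(haarProbability (Matrix.specialUnitaryGroup (Fin (2 + n)) ℂ)) ∂(haarProbability (Matrix.specialUnitaryGroup (Fin (2 + n)) ℂ)) ∂(haarProbability (Matrix.specialUnitaryGroup (Fin (2 + n)) ℂ)) ∂(haarProbability (Matrix.specialUnitaryGroup (Fin (2 + n)) ℂ)) =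
      (1 / (2 + n : ℝ)) * ∫ x, ∫ y, ((Complex.normSq (Matrix.trace ((((x : (Matrix.specialUnitaryGroup (Fin (2 + n)) ℂ)) : Matrix (Fin (2 + n)) (Fin (2 + n)) ℂ)))) : ℝ)) * ((((x * y * x⁻¹ * y⁻¹ : (Matrix.specialUnitaryGroup (Fin (2 + n)) ℂ)) : Matrix (Fin (2 + n)) (Fin (2 + n)) ℂ).trace.re : ℝ)) ∂(haarProbability (Matrix.specialUnitaryGroup (Fin (2 + n)) ℂ)) ∂(haarProbability (Matrix.specialUnitaryGroup (Fin (2 + n)) ℂ)) := by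
  have h1 : ∀ x x' y, ∫ _y' : (Matrix.specialUnitaryGroup (Fin (2 + n)) ℂ), A x x' * ((((x * y * x⁻¹ * y⁻¹ : (Matrix.specialUnitaryGroup (Fin (2 + n)) ℂ)) : Matrix (Fin (2 + n)) (Fin (2 + n)) ℂ).trace.re : ℝ)) ∂(haarProbability (Matrix.specialUnitaryGroup (Fin (2 + n)) ℂ)) = A x x' * ((((x * y * x⁻¹ * y⁻¹ : (Matrix.specialUnitaryGroup (Fin (2 + n)) ℂ)) : Matrix (Fin (2 + n)) (Fin (2 + n)) ℂ).trace.re : ℝ)) := fun x x' y => by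
    simp only [integral_const, probReal_univ, one_smul]
  simp_rw [h1, integral_const_mul]
  have h2 : ∀ x, ∫ x', A x x' * ∫ y, ((((x * y * x⁻¹ * y⁻¹ : (Matrix.specialUnitaryGroup (Fin (2 + n)) ℂ)) : Matrix (Fin (2 + n)) (Fin (2 + n)) ℂ).trace.re : ℝ)) ∂(haarProbability (Matrix.specialUnitaryGroup (Fin (2 + n)) ℂ)) ∂(haarProbability (Matrix.specialUnitaryGroup (Fin (2 + n)) ℂ)) = (((Complex.normSq (Matrix.trace ((((x : (Matrix.specialUnitaryGroup (Fin (2 + n)) ℂ)) : Matrix (Fin (2 + n)) (Fin (2 + n)) ℂ)))) : ℝ)) / (2 + n : ℝ)) * ∫ y, ((((x * y * x⁻¹ * y⁻¹ : (Matrix.specialUnitaryGroup (Fin (2 + n)) ℂ)) : Matrix (Fin (2 + n)) (Fin (2 + n)) ℂ).trace.re : ℝ)) ∂(haarProbability (Matrix.specialUnitaryGroup (Fin (2 + n)) ℂ)) := by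
    intro x
    rw [integral_mul_const, hA x]
  simp_rw [h2]
  simp only [← integral_const_mul]
  refine integral_congr_ae (ae_of_all _ fun x => ?_)
  beta_reduce
  refine integral_congr_ae (ae_of_all _ fun y => ?_)
  beta_reduce
  ring

/-- Mixed plane, term `E[Q P_p]`: `∫∫∫∫ B(y,y') R(x,y) = N⁻¹ ∫∫ w(y) R(x,y)`. [cite: Wilson1974, §III (one-site Wilson action: Gibbs-tilted product Haar measure; bookkeeping)] -/
theorem iter_mixed_QR (B : (Matrix.specialUnitaryGroup (Fin (2 + n)) ℂ) → (Matrix.specialUnitaryGroup (Fin (2 + n)) ℂ) → ℝ) (hB : ∀ y, ∫ y', B y y' ∂(haarProbability (Matrix.specialUnitaryGroup (Fin (2 + n)) ℂ)) = ((Complex.normSq (Matrix.trace ((((y : (Matrix.specialUnitaryGroup (Fin (2 + n)) ℂ)) : Matrix (Fin (2 + n)) (Fin (2 + n)) ℂ)))) : ℝ)) / (2 + n : ℝ)) :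
    ∫ x, ∫ _x' : (Matrix.specialUnitaryGroup (Fin (2 + n)) ℂ), ∫ y, ∫ y', B y y' * ((((x * y * x⁻¹ * y⁻¹ : (Matrix.specialUnitaryGroup (Fin (2 + n)) ℂ)) : Matrix (Fin (2 + n)) (Fin (2 + n)) ℂ).trace.re : ℝ)) ∂(haarProbability (Matrix.specialUnitaryGroup (Fin (2 + n)) ℂ)) ∂(haarProbability (Matrix.specialUnitaryGroup (Fin (2 + n)) ℂ)) ∂(haarProbability (Matrix.specialUnitaryGroup (Fin (2 + n)) ℂ)) ∂(haarProbability (Matrix.specialUnitaryGroup (Fin (2 + n)) ℂ)) =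
      (1 / (2 + n : ℝ)) * ∫ x, ∫ y, ((Complex.normSq (Matrix.trace ((((y : (Matrix.specialUnitaryGroup (Fin (2 + n)) ℂ)) : Matrix (Fin (2 + n)) (Fin (2 + n)) ℂ)))) : ℝ)) * ((((x * y * x⁻¹ * y⁻¹ : (Matrix.specialUnitaryGroup (Fin (2 + n)) ℂ)) : Matrix (Fin (2 + n)) (Fin (2 + n)) ℂ).trace.re : ℝ)) ∂(haarProbability (Matrix.specialUnitaryGroup (Fin (2 + n)) ℂ)) ∂(haarProbability (Matrix.specialUnitaryGroup (Fin (2 + n)) ℂ)) := by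
  have h1 : ∀ x y, ∫ y', B y y' * ((((x * y * x⁻¹ * y⁻¹ : (Matrix.specialUnitaryGroup (Fin (2 + n)) ℂ)) : Matrix (Fin (2 + n)) (Fin (2 + n)) ℂ).trace.re : ℝ)) ∂(haarProbability (Matrix.specialUnitaryGroup (Fin (2 + n)) ℂ)) = ((((x * y * x⁻¹ * y⁻¹ : (Matrix.specialUnitaryGroup (Fin (2 + n)) ℂ)) : Matrix (Fin (2 + n)) (Fin (2 + n)) ℂ).trace.re : ℝ)) * (((Complex.normSq (Matrix.trace ((((y : (Matrix.specialUnitaryGroup (Fin (2 + n)) ℂ)) : Matrix (Fin (2 + n)) (Fin (2 + n)) ℂ)))) : ℝ)) / (2 + n : ℝ)) := by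
    intro x y
    rw [integral_mul_const, hB y]; ring
  simp_rw [h1]
  have h2 : ∀ x, ∫ _x' : (Matrix.specialUnitaryGroup (Fin (2 + n)) ℂ), ∫ y, ((((x * y * x⁻¹ * y⁻¹ : (Matrix.specialUnitaryGroup (Fin (2 + n)) ℂ)) : Matrix (Fin (2 + n)) (Fin (2 + n)) ℂ).trace.re : ℝ)) * (((Complex.normSq (Matrix.trace ((((y : (Matrix.specialUnitaryGroup (Fin (2 + n)) ℂ)) : Matrix (Fin (2 + n)) (Fin (2 + n)) ℂ)))) : ℝ)) / (2 + n : ℝ)) ∂(haarProbability (Matrix.specialUnitaryGroup (Fin (2 + n)) ℂ)) ∂(haarProbability (Matrix.specialUnitaryGroup (Fin (2 + n)) ℂ)) = ∫ y, ((((x * y * x⁻¹ * y⁻¹ : (Matrix.specialUnitaryGroup (Fin (2 + n)) ℂ)) : Matrix (Fin (2 + n)) (Fin (2 + n)) ℂ).trace.re : ℝ)) * (((Complex.normSq (Matrix.trace ((((y : (Matrix.specialUnitaryGroup (Fin (2 + n)) ℂ)) : Matrix (Fin (2 + n)) (Fin (2 + n)) ℂ)))) : ℝ)) / (2 + n : ℝ))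 ∂(haarProbability (Matrix.specialUnitaryGroup (Fin (2 + n)) ℂ)) :=
    fun x => by simp only [integral_const, probReal_univ, one_smul]
  simp_rw [h2]
  simp only [← integral_const_mul]
  refine integral_congr_ae (ae_of_all _ fun x => ?_)
  beta_reduce
  refine integral_congr_ae (ae_of_all _ fun y => ?_)
  beta_reduce
  ring

/-- Term `E[P Q]`: `∫∫∫∫ A(x,x') B(y,y') = N⁻²` (independence of the two planes). [cite: Wilson1974, §III (one-site Wilson action: Gibbs-tilted product Haar measure; bookkeeping)] -/
theorem iter_PQ (A B : (Matrix.specialUnitaryGroup (Fin (2 + n)) ℂ) → (Matrix.specialUnitaryGroup (Fin (2 + n)) ℂ) → ℝ) (hA : ∀ x, ∫ x', A x x' ∂(haarProbability (Matrix.specialUnitaryGroup (Fin (2 + n)) ℂ)) = ((Complex.normSq (Matrix.trace ((((x : (Matrix.specialUnitaryGroup (Fin (2 + n)) ℂ)) : Matrix (Fin (2 + n)) (Fin (2 + n)) ℂ)))) : ℝ)) / (2 + n : ℝ))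
    (hB : ∀ y, ∫ y', B y y' ∂(haarProbability (Matrix.specialUnitaryGroup (Fin (2 + n)) ℂ)) = ((Complex.normSq (Matrix.trace ((((y : (Matrix.specialUnitaryGroup (Fin (2 + n)) ℂ)) : Matrix (Fin (2 + n)) (Fin (2 + n)) ℂ)))) : ℝ)) / (2 + n : ℝ)) :
    ∫ x, ∫ x', ∫ y, ∫ y', A x x' * B y y' ∂(haarProbability (Matrix.specialUnitaryGroup (Fin (2 + n)) ℂ)) ∂(haarProbability (Matrix.specialUnitaryGroup (Fin (2 + n)) ℂ)) ∂(haarProbability (Matrix.specialUnitaryGroup (Fin (2 + n)) ℂ)) ∂(haarProbability (Matrix.specialUnitaryGroup (Fin (2 + n)) ℂ)) = (1 / (2 + n : ℝ)) ^ 2 := by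
  have h1 : ∀ x x' y, ∫ y', A x x' * B y y' ∂(haarProbability (Matrix.specialUnitaryGroup (Fin (2 + n)) ℂ)) = A x x' * (((Complex.normSq (Matrix.trace ((((y : (Matrix.specialUnitaryGroup (Fin (2 + n)) ℂ)) : Matrix (Fin (2 + n)) (Fin (2 + n)) ℂ)))) : ℝ)) / (2 + n : ℝ)) := by
    intro x x' y; rw [integral_const_mul, hB y]
  simp_rw [h1, integral_const_mul, integral_div, integral_w, integral_mul_const, hA, integral_div, integral_w]
  ring

/-- In-plane, term `E[P Q P]`: `∫∫∫∫ A(x,x') B(y,y') A(x,x') = N⁻¹ ∫∫ A²`. [cite: Wilson1974, §III (one-site Wilson action: Gibbs-tilted product Haar measure; bookkeeping)] -/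
theorem iter_PQP (A B : (Matrix.specialUnitaryGroup (Fin (2 + n)) ℂ) → (Matrix.specialUnitaryGroup (Fin (2 + n)) ℂ) → ℝ) (hB : ∀ y, ∫ y', B y y' ∂(haarProbability (Matrix.specialUnitaryGroup (Fin (2 + n)) ℂ)) = ((Complex.normSq (Matrix.trace ((((y : (Matrix.specialUnitaryGroup (Fin (2 + n)) ℂ)) : Matrix (Fin (2 + n)) (Fin (2 + n)) ℂ)))) : ℝ)) / (2 + n : ℝ)) :
    ∫ x, ∫ x', ∫ y, ∫ y', A x x' * B y y' * A x x' ∂(haarProbability (Matrix.specialUnitaryGroup (Fin (2 + n)) ℂ)) ∂(haarProbability (Matrix.specialUnitaryGroup (Fin (2 + n)) ℂ)) ∂(haarProbability (Matrix.specialUnitaryGroup (Fin (2 + n)) ℂ)) ∂(haarProbability (Matrix.specialUnitaryGroup (Fin (2 + n)) ℂ)) =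
      (1 / (2 + n : ℝ)) * ∫ x, ∫ x', A x x' * A x x' ∂(haarProbability (Matrix.specialUnitaryGroup (Fin (2 + n)) ℂ)) ∂(haarProbability (Matrix.specialUnitaryGroup (Fin (2 + n)) ℂ)) := by
  have h1 : ∀ x x' y, ∫ y', A x x' * B y y' * A x x' ∂(haarProbability (Matrix.specialUnitaryGroup (Fin (2 + n)) ℂ)) = A x x' * A x x' * (((Complex.normSq (Matrix.trace ((((y : (Matrix.specialUnitaryGroup (Fin (2 + n)) ℂ)) : Matrix (Fin (2 + n)) (Fin (2 + n)) ℂ)))) : ℝ)) / (2 + n : ℝ)) := by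
    intro x x' y
    rw [← hB y, ← integral_const_mul]
    refine integral_congr_ae (ae_of_all _ fun y' => ?_); beta_reduce; ring
  simp_rw [h1, integral_const_mul, integral_div, integral_w, integral_mul_const]
  ring

/-- In-plane, term `E[P Q Q]`: `∫∫∫∫ A(x,x') B(y,y') B(y,y') = N⁻¹ ∫∫ B²`. [cite: Wilson1974, §III (one-site Wilson action: Gibbs-tilted product Haar measure; bookkeeping)] -/
theorem iter_PQQ (A B : (Matrix.specialUnitaryGroup (Fin (2 + n)) ℂ) → (Matrix.specialUnitaryGroup (Fin (2 + n)) ℂ) → ℝ) (hA : ∀ x, ∫ x', A x x' ∂(haarProbability (Matrix.specialUnitaryGroup (Fin (2 + n)) ℂ)) = ((Complex.normSq (Matrix.trace ((((x : (Matrix.specialUnitaryGroup (Fin (2 + n)) ℂ)) : Matrix (Fin (2 + n)) (Fin (2 + n)) ℂ)))) : ℝ)) / (2 + n : ℝ)) :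
    ∫ x, ∫ x', ∫ y, ∫ y', A x x' * B y y' * B y y' ∂(haarProbability (Matrix.specialUnitaryGroup (Fin (2 + n)) ℂ)) ∂(haarProbability (Matrix.specialUnitaryGroup (Fin (2 + n)) ℂ)) ∂(haarProbability (Matrix.specialUnitaryGroup (Fin (2 + n)) ℂ)) ∂(haarProbability (Matrix.specialUnitaryGroup (Fin (2 + n)) ℂ)) =
      (1 / (2 + n : ℝ)) * ∫ y, ∫ y', B y y' * B y y' ∂(haarProbability (Matrix.specialUnitaryGroup (Fin (2 + n)) ℂ)) ∂(haarProbability (Matrix.specialUnitaryGroup (Fin (2 + n)) ℂ)) := by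
  have h1 : ∀ x x', ∫ y, ∫ y', A x x' * B y y' * B y y' ∂(haarProbability (Matrix.specialUnitaryGroup (Fin (2 + n)) ℂ)) ∂(haarProbability (Matrix.specialUnitaryGroup (Fin (2 + n)) ℂ)) = A x x' * ∫ y, ∫ y', B y y' * B y y' ∂(haarProbability (Matrix.specialUnitaryGroup (Fin (2 + n)) ℂ)) ∂(haarProbability (Matrix.specialUnitaryGroup (Fin (2 + n)) ℂ)) := by
    intro x x'
    simp only [← integral_const_mul]
    refine integral_congr_ae (ae_of_all _ fun y => ?_)
    beta_reduce
    refine integral_congr_ae (ae_of_all _ fun y' => ?_); beta_reduce; ring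
  simp_rw [h1, integral_mul_const, hA, integral_div, integral_w]

/-- Integrability of continuous functions on `SU(N)`. [cite: Wilson1974, §III (one-site Wilson action: Gibbs-tilted product Haar measure; bookkeeping)] -/
theorem integrable_of_continuous_su {f : (Matrix.specialUnitaryGroup (Fin (2 + n)) ℂ) → ℝ} (hf : Continuous f) : Integrable f (haarProbability (Matrix.specialUnitaryGroup (Fin (2 + n)) ℂ)) :=
  hf.integrable_of_hasCompactSupport (HasCompactSupport.of_compactSpace _)

/-- `SU(N)` is second countable (a closed subset of a matrix space; restated locally, no instance declared). [cite: Wilson1974, §III (one-site Wilson action: Gibbs-tilted product Haar measure; bookkeeping)] -/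
theorem secondCountableTopology_su' : SecondCountableTopology (Matrix.specialUnitaryGroup (Fin (2 + n)) ℂ) :=
  haveI : SecondCountableTopology (Matrix (Fin (2 + n)) (Fin (2 + n)) ℂ) :=
    inferInstanceAs (SecondCountableTopology (Fin (2 + n) → Fin (2 + n) → ℂ))
  Topology.IsEmbedding.subtypeVal.secondCountableTopology

/-- Integrability in the first variable of a parametric Haar integral of a continuous function of two variables. [cite: Wilson1974, §III (one-site Wilson action: Gibbs-tilted product Haar measure; bookkeeping)] -/
theorem integrable_parametric {f : (Matrix.specialUnitaryGroup (Fin (2 + n)) ℂ) → (Matrix.specialUnitaryGroup (Fin (2 + n)) ℂ) → ℝ} (hf : Continuous (Function.uncurry f)) :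
    Integrable (fun x : (Matrix.specialUnitaryGroup (Fin (2 + n)) ℂ) => ∫ y, f x y ∂(haarProbability (Matrix.specialUnitaryGroup (Fin (2 + n)) ℂ))) (haarProbability (Matrix.specialUnitaryGroup (Fin (2 + n)) ℂ)) := by
  haveI := secondCountableTopology_su' (n := n)
  exact (hf.integrable_of_hasCompactSupport (μ := ((haarProbability (Matrix.specialUnitaryGroup (Fin (2 + n)) ℂ))).prod (haarProbability (Matrix.specialUnitaryGroup (Fin (2 + n)) ℂ))) (HasCompactSupport.of_compactSpace _)).integral_prod_left

/-- ★ **Expansion of the crux integral**: `∫∫ (w(x) − 1)(w(y) − 1) R(x,y) = ∫∫ w w R − ∫∫ w(x) R − ∫∫ w(y) R + ∫∫ R`. [cite: Wilson1974, §III (one-site Wilson action: Gibbs-tilted product Haar measure; bookkeeping)] -/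
theorem kappa_expand :
    ∫ x, ∫ y, (((Complex.normSq (Matrix.trace ((((x : (Matrix.specialUnitaryGroup (Fin (2 + n)) ℂ)) : Matrix (Fin (2 + n)) (Fin (2 + n)) ℂ)))) : ℝ)) - 1) * (((Complex.normSq (Matrix.trace ((((y : (Matrix.specialUnitaryGroup (Fin (2 + n)) ℂ)) : Matrix (Fin (2 + n)) (Fin (2 + n)) ℂ)))) : ℝ)) - 1) * ((((x * y * x⁻¹ * y⁻¹ : (Matrix.specialUnitaryGroup (Fin (2 + n)) ℂ)) : Matrix (Fin (2 + n)) (Fin (2 + n)) ℂ).trace.re : ℝ)) ∂(haarProbability (Matrix.specialUnitaryGroup (Fin (2 + n)) ℂ)) ∂(haarProbability (Matrix.specialUnitaryGroup (Fin (2 + n)) ℂ)) =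
      (∫ x, ∫ y, ((Complex.normSq (Matrix.trace ((((x : (Matrix.specialUnitaryGroup (Fin (2 + n)) ℂ)) : Matrix (Fin (2 + n)) (Fin (2 + n)) ℂ)))) : ℝ)) * ((Complex.normSq (Matrix.trace ((((y : (Matrix.specialUnitaryGroup (Fin (2 + n)) ℂ)) : Matrix (Fin (2 + n)) (Fin (2 + n)) ℂ)))) : ℝ)) * ((((x * y * x⁻¹ * y⁻¹ : (Matrix.specialUnitaryGroup (Fin (2 + n)) ℂ)) : Matrix (Fin (2 + n)) (Fin (2 + n)) ℂ).trace.re : ℝ)) ∂(haarProbability (Matrix.specialUnitaryGroup (Fin (2 + n)) ℂ)) ∂(haarProbability (Matrix.specialUnitaryGroup (Fin (2 + n)) ℂ))) - (∫ x, ∫ y, ((Complex.normSq (Matrix.trace ((((x : (Matrix.specialUnitaryGroup (Fin (2 + n)) ℂ)) : Matrix (Fin (2 + n)) (Fin (2 + n)) ℂ)))) : ℝ)) * ((((x * y * x⁻¹ * y⁻¹ : (Matrix.specialUnitaryGroup (Fin (2 + n)) ℂ)) : Matrix (Fin (2 + n)) (Fin (2 + n)) ℂ).trace.re : ℝ)) ∂(haarProbability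 (Matrix.specialUnitaryGroup (Fin (2 + n)) ℂ)) ∂(haarProbability (Matrix.specialUnitaryGroup (Fin (2 + n)) ℂ))) -
        (∫ x, ∫ y, ((Complex.normSq (Matrix.trace ((((y : (Matrix.specialUnitaryGroup (Fin (2 + n)) ℂ)) : Matrix (Fin (2 + n)) (Fin (2 + n)) ℂ)))) : ℝ)) * ((((x * y * x⁻¹ * y⁻¹ : (Matrix.specialUnitaryGroup (Fin (2 + n)) ℂ)) : Matrix (Fin (2 + n)) (Fin (2 + n)) ℂ).trace.re : ℝ)) ∂(haarProbability (Matrix.specialUnitaryGroup (Fin (2 + n)) ℂ)) ∂(haarProbability (Matrix.specialUnitaryGroup (Fin (2 + n)) ℂ))) + ∫ x, ∫ y, ((((x * y * x⁻¹ * y⁻¹ : (Matrix.specialUnitaryGroup (Fin (2 + n)) ℂ)) : Matrix (Fin (2 + n)) (Fin (2 + n)) ℂ).trace.re : ℝ)) ∂(haarProbability (Matrix.specialUnitaryGroup (Fin (2 + n)) ℂ)) ∂(haarProbability (Matrix.specialUnitaryGroup (Fin (2 + n)) ℂ)) := by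
  have hRc : ∀ x : (Matrix.specialUnitaryGroup (Fin (2 + n)) ℂ), Continuous fun y : (Matrix.specialUnitaryGroup (Fin (2 + n)) ℂ) => ((((x * y * x⁻¹ * y⁻¹ : (Matrix.specialUnitaryGroup (Fin (2 + n)) ℂ)) : Matrix (Fin (2 + n)) (Fin (2 + n)) ℂ).trace.re : ℝ)) := continuous_R_right
  have hwc : Continuous fun X : (Matrix.specialUnitaryGroup (Fin (2 + n)) ℂ) => ((Complex.normSq (Matrix.trace ((((X : (Matrix.specialUnitaryGroup (Fin (2 + n)) ℂ)) : Matrix (Fin (2 + n)) (Fin (2 + n)) ℂ)))) : ℝ)) := continuous_w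
  -- inner expansion
  have hin : ∀ x, ∫ y, (((Complex.normSq (Matrix.trace ((((x : (Matrix.specialUnitaryGroup (Fin (2 + n)) ℂ)) : Matrix (Fin (2 + n)) (Fin (2 + n)) ℂ)))) : ℝ)) - 1) * (((Complex.normSq (Matrix.trace ((((y : (Matrix.specialUnitaryGroup (Fin (2 + n)) ℂ)) : Matrix (Fin (2 + n)) (Fin (2 + n)) ℂ)))) : ℝ)) - 1) * ((((x * y * x⁻¹ * y⁻¹ : (Matrix.specialUnitaryGroup (Fin (2 + n)) ℂ)) : Matrix (Fin (2 + n)) (Fin (2 + n)) ℂ).trace.re : ℝ)) ∂(haarProbability (Matrix.specialUnitaryGroup (Fin (2 + n)) ℂ)) =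
      (∫ y, ((Complex.normSq (Matrix.trace ((((x : (Matrix.specialUnitaryGroup (Fin (2 + n)) ℂ)) : Matrix (Fin (2 + n)) (Fin (2 + n)) ℂ)))) : ℝ)) * ((Complex.normSq (Matrix.trace ((((y : (Matrix.specialUnitaryGroup (Fin (2 + n)) ℂ)) : Matrix (Fin (2 + n)) (Fin (2 + n)) ℂ)))) : ℝ)) * ((((x * y * x⁻¹ * y⁻¹ : (Matrix.specialUnitaryGroup (Fin (2 + n)) ℂ)) : Matrix (Fin (2 + n)) (Fin (2 + n)) ℂ).trace.re : ℝ)) ∂(haarProbability (Matrix.specialUnitaryGroup (Fin (2 + n)) ℂ))) - (∫ y, ((Complex.normSq (Matrix.trace ((((x : (Matrix.specialUnitaryGroup (Fin (2 + n)) ℂ)) : Matrix (Fin (2 + n)) (Fin (2 + n)) ℂ)))) : ℝ)) * ((((x * y * x⁻¹ * y⁻¹ : (Matrix.specialUnitaryGroup (Fin (2 + n)) ℂ)) : Matrix (Fin (2 + n)) (Fin (2 + n)) ℂ).trace.re : ℝ)) ∂(haarProbability (Matrix.specialUnitaryGroup (Fin (2 + n)) ℂ))) - (∫ y, ((Complex.normSq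 (Matrix.trace ((((y : (Matrix.specialUnitaryGroup (Fin (2 + n)) ℂ)) : Matrix (Fin (2 + n)) (Fin (2 + n)) ℂ)))) : ℝ)) * ((((x * y * x⁻¹ * y⁻¹ : (Matrix.specialUnitaryGroup (Fin (2 + n)) ℂ)) : Matrix (Fin (2 + n)) (Fin (2 + n)) ℂ).trace.re : ℝ)) ∂(haarProbability (Matrix.specialUnitaryGroup (Fin (2 + n)) ℂ))) + ∫ y, ((((x * y * x⁻¹ * y⁻¹ : (Matrix.specialUnitaryGroup (Fin (2 + n)) ℂ)) : Matrix (Fin (2 + n)) (Fin (2 + n)) ℂ).trace.re : ℝ)) ∂(haarProbability (Matrix.specialUnitaryGroup (Fin (2 + n)) ℂ)) := by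
    intro x
    have i1 : Integrable (fun y => ((Complex.normSq (Matrix.trace ((((x : (Matrix.specialUnitaryGroup (Fin (2 + n)) ℂ)) : Matrix (Fin (2 + n)) (Fin (2 + n)) ℂ)))) : ℝ)) * ((Complex.normSq (Matrix.trace ((((y : (Matrix.specialUnitaryGroup (Fin (2 + n)) ℂ)) : Matrix (Fin (2 + n)) (Fin (2 + n)) ℂ)))) : ℝ)) * ((((x * y * x⁻¹ * y⁻¹ : (Matrix.specialUnitaryGroup (Fin (2 + n)) ℂ)) : Matrix (Fin (2 + n)) (Fin (2 + n)) ℂ).trace.re : ℝ))) (haarProbability (Matrix.specialUnitaryGroup (Fin (2 + n)) ℂ)) :=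
      integrable_of_continuous_su ((continuous_const.mul hwc).mul (hRc x))
    have i2 : Integrable (fun y => ((Complex.normSq (Matrix.trace ((((x : (Matrix.specialUnitaryGroup (Fin (2 + n)) ℂ)) : Matrix (Fin (2 + n)) (Fin (2 + n)) ℂ)))) : ℝ)) * ((((x * y * x⁻¹ * y⁻¹ : (Matrix.specialUnitaryGroup (Fin (2 + n)) ℂ)) : Matrix (Fin (2 + n)) (Fin (2 + n)) ℂ).trace.re : ℝ))) (haarProbability (Matrix.specialUnitaryGroup (Fin (2 + n)) ℂ)) := integrable_of_continuous_su (continuous_const.mul (hRc x))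
    have i3 : Integrable (fun y => ((Complex.normSq (Matrix.trace ((((y : (Matrix.specialUnitaryGroup (Fin (2 + n)) ℂ)) : Matrix (Fin (2 + n)) (Fin (2 + n)) ℂ)))) : ℝ)) * ((((x * y * x⁻¹ * y⁻¹ : (Matrix.specialUnitaryGroup (Fin (2 + n)) ℂ)) : Matrix (Fin (2 + n)) (Fin (2 + n)) ℂ).trace.re : ℝ))) (haarProbability (Matrix.specialUnitaryGroup (Fin (2 + n)) ℂ)) := integrable_of_continuous_su (hwc.mul (hRc x))
    have i4 : Integrable (fun y => ((((x * y * x⁻¹ * y⁻¹ : (Matrix.specialUnitaryGroup (Fin (2 + n)) ℂ)) : Matrix (Fin (2 + n)) (Fin (2 + n)) ℂ).trace.re : ℝ))) (haarProbability (Matrix.specialUnitaryGroup (Fin (2 + n)) ℂ)) := integrable_of_continuous_su (hRc x)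
    have hpt : ∀ y, (((Complex.normSq (Matrix.trace ((((x : (Matrix.specialUnitaryGroup (Fin (2 + n)) ℂ)) : Matrix (Fin (2 + n)) (Fin (2 + n)) ℂ)))) : ℝ)) - 1) * (((Complex.normSq (Matrix.trace ((((y : (Matrix.specialUnitaryGroup (Fin (2 + n)) ℂ)) : Matrix (Fin (2 + n)) (Fin (2 + n)) ℂ)))) : ℝ)) - 1) * ((((x * y * x⁻¹ * y⁻¹ : (Matrix.specialUnitaryGroup (Fin (2 + n)) ℂ)) : Matrix (Fin (2 + n)) (Fin (2 + n)) ℂ).trace.re : ℝ)) =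
        ((Complex.normSq (Matrix.trace ((((x : (Matrix.specialUnitaryGroup (Fin (2 + n)) ℂ)) : Matrix (Fin (2 + n)) (Fin (2 + n)) ℂ)))) : ℝ)) * ((Complex.normSq (Matrix.trace ((((y : (Matrix.specialUnitaryGroup (Fin (2 + n)) ℂ)) : Matrix (Fin (2 + n)) (Fin (2 + n)) ℂ)))) : ℝ)) * ((((x * y * x⁻¹ * y⁻¹ : (Matrix.specialUnitaryGroup (Fin (2 + n)) ℂ)) : Matrix (Fin (2 + n)) (Fin (2 + n)) ℂ).trace.re : ℝ)) - ((Complex.normSq (Matrix.trace ((((x : (Matrix.specialUnitaryGroup (Fin (2 + n)) ℂ)) : Matrix (Fin (2 + n)) (Fin (2 + n)) ℂ)))) : ℝ)) * ((((x * y * x⁻¹ * y⁻¹ : (Matrix.specialUnitaryGroup (Fin (2 + n)) ℂ)) : Matrix (Fin (2 + n)) (Fin (2 + n)) ℂ).trace.re : ℝ)) - ((Complex.normSq (Matrix.trace ((((y : (Matrix.specialUnitaryGroup (Fin (2 + n)) ℂ)) : Matrix (Fin (2 + n)) (Fin (2 + n)) ℂ)))) : ℝ)) * ((((x * y * x⁻¹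 * y⁻¹ : (Matrix.specialUnitaryGroup (Fin (2 + n)) ℂ)) : Matrix (Fin (2 + n)) (Fin (2 + n)) ℂ).trace.re : ℝ)) + ((((x * y * x⁻¹ * y⁻¹ : (Matrix.specialUnitaryGroup (Fin (2 + n)) ℂ)) : Matrix (Fin (2 + n)) (Fin (2 + n)) ℂ).trace.re : ℝ)) := fun y => by ring
    have i12 : Integrable (fun y => ((Complex.normSq (Matrix.trace ((((x : (Matrix.specialUnitaryGroup (Fin (2 + n)) ℂ)) : Matrix (Fin (2 + n)) (Fin (2 + n)) ℂ)))) : ℝ)) * ((Complex.normSq (Matrix.trace ((((y : (Matrix.specialUnitaryGroup (Fin (2 + n)) ℂ)) : Matrix (Fin (2 + n)) (Fin (2 + n)) ℂ)))) : ℝ)) * ((((x * y * x⁻¹ * y⁻¹ : (Matrix.specialUnitaryGroup (Fin (2 + n)) ℂ)) : Matrix (Fin (2 + n)) (Fin (2 + n)) ℂ).trace.re : ℝ)) - ((Complex.normSq (Matrix.trace ((((x : (Matrix.specialUnitaryGroup (Fin (2 + n)) ℂ)) : Matrix (Fin (2 + n)) (Fin (2 + n)) ℂ)))) : ℝ)) *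 ((((x * y * x⁻¹ * y⁻¹ : (Matrix.specialUnitaryGroup (Fin (2 + n)) ℂ)) : Matrix (Fin (2 + n)) (Fin (2 + n)) ℂ).trace.re : ℝ))) (haarProbability (Matrix.specialUnitaryGroup (Fin (2 + n)) ℂ)) := i1.sub i2
    have i123 : Integrable (fun y => ((Complex.normSq (Matrix.trace ((((x : (Matrix.specialUnitaryGroup (Fin (2 + n)) ℂ)) : Matrix (Fin (2 + n)) (Fin (2 + n)) ℂ)))) : ℝ)) * ((Complex.normSq (Matrix.trace ((((y : (Matrix.specialUnitaryGroup (Fin (2 + n)) ℂ)) : Matrix (Fin (2 + n)) (Fin (2 + n)) ℂ)))) : ℝ)) * ((((x * y * x⁻¹ * y⁻¹ : (Matrix.specialUnitaryGroup (Fin (2 + n)) ℂ)) : Matrix (Fin (2 + n)) (Fin (2 + n)) ℂ).trace.re : ℝ)) - ((Complex.normSq (Matrix.trace ((((x : (Matrix.specialUnitaryGroup (Fin (2 + n)) ℂ)) : Matrix (Fin (2 + n)) (Fin (2 + n)) ℂ)))) : ℝ)) * ((((x * y * x⁻¹ * y⁻¹ : (Matrix.specialUnitaryGroup (Fin (2 +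 n)) ℂ)) : Matrix (Fin (2 + n)) (Fin (2 + n)) ℂ).trace.re : ℝ)) - ((Complex.normSq (Matrix.trace ((((y : (Matrix.specialUnitaryGroup (Fin (2 + n)) ℂ)) : Matrix (Fin (2 + n)) (Fin (2 + n)) ℂ)))) : ℝ)) * ((((x * y * x⁻¹ * y⁻¹ : (Matrix.specialUnitaryGroup (Fin (2 + n)) ℂ)) : Matrix (Fin (2 + n)) (Fin (2 + n)) ℂ).trace.re : ℝ))) (haarProbability (Matrix.specialUnitaryGroup (Fin (2 + n)) ℂ)) := i12.sub i3
    simp_rw [hpt]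
    rw [integral_add i123 i4, integral_sub i12 i3, integral_sub i1 i2]
  simp_rw [hin]
  -- outer expansion
  have hR2 : Continuous (Function.uncurry fun x y : (Matrix.specialUnitaryGroup (Fin (2 + n)) ℂ) => ((((x * y * x⁻¹ * y⁻¹ : (Matrix.specialUnitaryGroup (Fin (2 + n)) ℂ)) : Matrix (Fin (2 + n)) (Fin (2 + n)) ℂ).trace.re : ℝ))) := continuous_R
  have hw1 : Continuous (Function.uncurry fun x _y : (Matrix.specialUnitaryGroup (Fin (2 + n)) ℂ) => ((Complex.normSq (Matrix.trace ((((x : (Matrix.specialUnitaryGroup (Fin (2 + n)) ℂ)) : Matrix (Fin (2 + n)) (Fin (2 + n)) ℂ)))) : ℝ))) := hwc.comp continuous_fst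
  have hw2 : Continuous (Function.uncurry fun _x y : (Matrix.specialUnitaryGroup (Fin (2 + n)) ℂ) => ((Complex.normSq (Matrix.trace ((((y : (Matrix.specialUnitaryGroup (Fin (2 + n)) ℂ)) : Matrix (Fin (2 + n)) (Fin (2 + n)) ℂ)))) : ℝ))) := hwc.comp continuous_snd
  have j1 : Integrable (fun x => ∫ y, ((Complex.normSq (Matrix.trace ((((x : (Matrix.specialUnitaryGroup (Fin (2 + n)) ℂ)) : Matrix (Fin (2 + n)) (Fin (2 + n)) ℂ)))) : ℝ)) * ((Complex.normSq (Matrix.trace ((((y : (Matrix.specialUnitaryGroup (Fin (2 + n)) ℂ)) : Matrix (Fin (2 + n)) (Fin (2 + n)) ℂ)))) : ℝ)) * ((((x * y * x⁻¹ * y⁻¹ : (Matrix.specialUnitaryGroup (Fin (2 + n)) ℂ)) : Matrix (Fin (2 + n)) (Fin (2 + n)) ℂ).trace.re : ℝ)) ∂(haarProbability (Matrix.specialUnitaryGroup (Fin (2 + n)) ℂ))) (haarProbability (Matrix.specialUnitaryGroup (Fin (2 + n)) ℂ)) :=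
    integrable_parametric (f := fun x y => ((Complex.normSq (Matrix.trace ((((x : (Matrix.specialUnitaryGroup (Fin (2 + n)) ℂ)) : Matrix (Fin (2 + n)) (Fin (2 + n)) ℂ)))) : ℝ)) * ((Complex.normSq (Matrix.trace ((((y : (Matrix.specialUnitaryGroup (Fin (2 + n)) ℂ)) : Matrix (Fin (2 + n)) (Fin (2 + n)) ℂ)))) : ℝ)) * ((((x * y * x⁻¹ * y⁻¹ : (Matrix.specialUnitaryGroup (Fin (2 + n)) ℂ)) : Matrix (Fin (2 + n)) (Fin (2 + n)) ℂ).trace.re : ℝ))) ((hw1.mul hw2).mul hR2)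
  have j2 : Integrable (fun x => ∫ y, ((Complex.normSq (Matrix.trace ((((x : (Matrix.specialUnitaryGroup (Fin (2 + n)) ℂ)) : Matrix (Fin (2 + n)) (Fin (2 + n)) ℂ)))) : ℝ)) * ((((x * y * x⁻¹ * y⁻¹ : (Matrix.specialUnitaryGroup (Fin (2 + n)) ℂ)) : Matrix (Fin (2 + n)) (Fin (2 + n)) ℂ).trace.re : ℝ)) ∂(haarProbability (Matrix.specialUnitaryGroup (Fin (2 + n)) ℂ))) (haarProbability (Matrix.specialUnitaryGroup (Fin (2 + n)) ℂ)) :=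
    integrable_parametric (f := fun x y => ((Complex.normSq (Matrix.trace ((((x : (Matrix.specialUnitaryGroup (Fin (2 + n)) ℂ)) : Matrix (Fin (2 + n)) (Fin (2 + n)) ℂ)))) : ℝ)) * ((((x * y * x⁻¹ * y⁻¹ : (Matrix.specialUnitaryGroup (Fin (2 + n)) ℂ)) : Matrix (Fin (2 + n)) (Fin (2 + n)) ℂ).trace.re : ℝ))) (hw1.mul hR2)
  have j3 : Integrable (fun x => ∫ y, ((Complex.normSq (Matrix.trace ((((y : (Matrix.specialUnitaryGroup (Fin (2 + n)) ℂ)) : Matrix (Fin (2 + n)) (Fin (2 + n)) ℂ)))) : ℝ)) * ((((x * y * x⁻¹ * y⁻¹ : (Matrix.specialUnitaryGroup (Fin (2 + n)) ℂ)) : Matrix (Fin (2 + n)) (Fin (2 + n)) ℂ).trace.re : ℝ)) ∂(haarProbability (Matrix.specialUnitaryGroup (Fin (2 + n)) ℂ))) (haarProbability (Matrix.specialUnitaryGroup (Fin (2 + n)) ℂ)) :=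
    integrable_parametric (f := fun x y => ((Complex.normSq (Matrix.trace ((((y : (Matrix.specialUnitaryGroup (Fin (2 + n)) ℂ)) : Matrix (Fin (2 + n)) (Fin (2 + n)) ℂ)))) : ℝ)) * ((((x * y * x⁻¹ * y⁻¹ : (Matrix.specialUnitaryGroup (Fin (2 + n)) ℂ)) : Matrix (Fin (2 + n)) (Fin (2 + n)) ℂ).trace.re : ℝ))) (hw2.mul hR2)
  have j4 : Integrable (fun x => ∫ y, ((((x * y * x⁻¹ * y⁻¹ : (Matrix.specialUnitaryGroup (Fin (2 + n)) ℂ)) : Matrix (Fin (2 + n)) (Fin (2 + n)) ℂ).trace.re : ℝ)) ∂(haarProbability (Matrix.specialUnitaryGroup (Fin (2 + n)) ℂ))) (haarProbability (Matrix.specialUnitaryGroup (Fin (2 + n)) ℂ)) := integrable_parametric (f := fun x y => ((((x * y * x⁻¹ * y⁻¹ : (Matrix.specialUnitaryGroup (Fin (2 + n)) ℂ)) : Matrix (Fin (2 + n)) (Fin (2 + n)) ℂ).trace.re : ℝ))) hR2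
  have j12 : Integrable (fun x => (∫ y, ((Complex.normSq (Matrix.trace ((((x : (Matrix.specialUnitaryGroup (Fin (2 + n)) ℂ)) : Matrix (Fin (2 + n)) (Fin (2 + n)) ℂ)))) : ℝ)) * ((Complex.normSq (Matrix.trace ((((y : (Matrix.specialUnitaryGroup (Fin (2 + n)) ℂ)) : Matrix (Fin (2 + n)) (Fin (2 + n)) ℂ)))) : ℝ)) * ((((x * y * x⁻¹ * y⁻¹ : (Matrix.specialUnitaryGroup (Fin (2 + n)) ℂ)) : Matrix (Fin (2 + n)) (Fin (2 + n)) ℂ).trace.re : ℝ)) ∂(haarProbability (Matrix.specialUnitaryGroup (Fin (2 + n)) ℂ))) - ∫ y, ((Complex.normSq (Matrix.trace ((((x : (Matrix.specialUnitaryGroup (Fin (2 + n)) ℂ)) : Matrix (Fin (2 + n)) (Fin (2 + n)) ℂ)))) : ℝ)) * ((((x * y * x⁻¹ * y⁻¹ : (Matrix.specialUnitaryGroup (Fin (2 + n)) ℂ)) : Matrix (Fin (2 + n)) (Fin (2 + n)) ℂ).trace.re : ℝ)) ∂(haarProbability (Matrix.specialUnitaryGroup (Fin (2 + n)) ℂ)))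 (haarProbability (Matrix.specialUnitaryGroup (Fin (2 + n)) ℂ)) := j1.sub j2
  have j123 : Integrable (fun x => (∫ y, ((Complex.normSq (Matrix.trace ((((x : (Matrix.specialUnitaryGroup (Fin (2 + n)) ℂ)) : Matrix (Fin (2 + n)) (Fin (2 + n)) ℂ)))) : ℝ)) * ((Complex.normSq (Matrix.trace ((((y : (Matrix.specialUnitaryGroup (Fin (2 + n)) ℂ)) : Matrix (Fin (2 + n)) (Fin (2 + n)) ℂ)))) : ℝ)) * ((((x * y * x⁻¹ * y⁻¹ : (Matrix.specialUnitaryGroup (Fin (2 + n)) ℂ)) : Matrix (Fin (2 + n)) (Fin (2 + n)) ℂ).trace.re : ℝ)) ∂(haarProbability (Matrix.specialUnitaryGroup (Fin (2 + n)) ℂ))) - (∫ y, ((Complex.normSq (Matrix.trace ((((x : (Matrix.specialUnitaryGroup (Fin (2 + n)) ℂ)) : Matrix (Fin (2 + n)) (Fin (2 + n)) ℂ)))) : ℝ)) * ((((x * y * x⁻¹ * y⁻¹ : (Matrix.specialUnitaryGroup (Fin (2 + n)) ℂ)) : Matrix (Fin (2 + n)) (Fin (2 + n)) ℂ).trace.re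 : ℝ)) ∂(haarProbability (Matrix.specialUnitaryGroup (Fin (2 + n)) ℂ))) - ∫ y, ((Complex.normSq (Matrix.trace ((((y : (Matrix.specialUnitaryGroup (Fin (2 + n)) ℂ)) : Matrix (Fin (2 + n)) (Fin (2 + n)) ℂ)))) : ℝ)) * ((((x * y * x⁻¹ * y⁻¹ : (Matrix.specialUnitaryGroup (Fin (2 + n)) ℂ)) : Matrix (Fin (2 + n)) (Fin (2 + n)) ℂ).trace.re : ℝ)) ∂(haarProbability (Matrix.specialUnitaryGroup (Fin (2 + n)) ℂ))) (haarProbability (Matrix.specialUnitaryGroup (Fin (2 + n)) ℂ)) :=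
    j12.sub j3
  rw [integral_add j123 j4, integral_sub j12 j3, integral_sub j1 j2]

end OneSite

end Literature.MathematicalPhysics.QuantumFieldTheory.ToronCumulant

end Part2

/-!
## Part 3 — port of `Summits/QuantumFields/YangMills/Theorems/ToronCumulantSignOneSiteFubini.lean` (6 declarations kept)

# Route `ToronCumulantSign`, crux `OneSiteCovDerivative` (stmt-QuantumFields-27531) — helper II:
# product-Haar bookkeeping — integrals of functions of two or four independent links are iterated Haar integrals

For a compact second-countable group `G` with its Haar probability measure `dg` and a finite index set `ι` of links, under the
product measure `π = ⊗_{e ∈ ι} dg` the links are independent and Haar distributed (Mathlib `iIndepFun_pi`,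
`measurePreserving_eval`), so for distinct links `a ≠ b` the pair `(U_a, U_b)` has law `dg ⊗ dg` (`map_eval_pair`) and for four
distinct links the pair of pairs `((U_a,U_b),(U_c,U_d))` has law `(dg ⊗ dg) ⊗ (dg ⊗ dg)` (`map_eval_quad`); consequently a
continuous function of two (resp. four) links integrates to the corresponding ITERATED Haar integral (`integral_eval_pair`,
`integral_eval_quad`).  This is the Fubini bookkeeping for the one-site (`L = 1`, Eguchi–Kawai) torus, whose four links carry
product Haar measure at `β = 0`.  HONEST LABEL: elementary measure theory; helper toward the OPEN crux `OneSiteCovDerivative`;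
nothing about the Yang–Mills mass gap.

References: S. Chatterjee, arXiv:1803.01950 §2 (the lattice set-up); Mathlib `ProbabilityTheory.iIndepFun_pi`.

(Verbatim declaration-level port — the declarations listed in the Part header count — of the Summits-side module; route
bookkeeping of the source docstring, if any, is historical; `local notation3` shorthands of the source are expanded in place.)
-/

section Part3

open _root_.MeasureTheory _root_.ProbabilityTheory
open Literature.MathematicalPhysics.QuantumFieldTheory

namespace Literature.MathematicalPhysics.QuantumFieldTheory.ToronCumulant

section Fubini

variable {ι : Type*} [Fintype ι] {G : Type*} [Group G] [TopologicalSpace G] [IsTopologicalGroup G]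
  [CompactSpace G] [MeasurableSpace G] [BorelSpace G] [SecondCountableTopology G]

omit [SecondCountableTopology G] in
/-- The links are independent under product Haar measure. [cite: Wilson1974, §III (one-site Wilson action: Gibbs-tilted product Haar measure; bookkeeping)] -/
theorem iIndepFun_eval : iIndepFun (fun (e : ι) (U : ι → G) => U e) (Measure.pi (fun _ : ι => haarProbability G)) :=
  iIndepFun_pi (X := fun (_ : ι) (g : G) => g) (fun _ => aemeasurable_id)

omit [SecondCountableTopology G] in
/-- Each link is Haar distributed under product Haar measure. [cite: Wilson1974, §III (one-site Wilson action: Gibbs-tilted product Haar measure; bookkeeping)] -/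
theorem map_eval (a : ι) : ((Measure.pi (fun _ : ι => haarProbability G))).map (fun U : ι → G => U a) = haarProbability G :=
  (measurePreserving_eval (fun _ : ι => haarProbability G) a).map_eq

omit [SecondCountableTopology G] in
/-- **Two distinct links are independent Haar**: the law of `(U_a, U_b)` is `dg ⊗ dg`. [cite: Wilson1974, §III (one-site Wilson action: Gibbs-tilted product Haar measure; bookkeeping)] -/
theorem map_eval_pair {a b : ι} (hab : a ≠ b) :
    ((Measure.pi (fun _ : ι => haarProbability G))).map (fun U : ι → G => (U a, U b)) = (haarProbability G).prod (haarProbability G) := by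
  have hind := (iIndepFun_eval (ι := ι) (G := G)).indepFun hab
  rw [(indepFun_iff_map_prod_eq_prod_map_map (measurable_pi_apply a).aemeasurable
    (measurable_pi_apply b).aemeasurable).mp hind, map_eval, map_eval]

omit [SecondCountableTopology G] in
/-- **Four distinct links**: the law of `((U_a, U_b), (U_c, U_d))` is `(dg ⊗ dg) ⊗ (dg ⊗ dg)`. [cite: Wilson1974, §III (one-site Wilson action: Gibbs-tilted product Haar measure; bookkeeping)] -/
theorem map_eval_quad {a b c d : ι} (hab : a ≠ b) (hcd : c ≠ d) (hac : a ≠ c) (had : a ≠ d) (hbc : b ≠ c) (hbd : b ≠ d) :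
    ((Measure.pi (fun _ : ι => haarProbability G))).map (fun U : ι → G => ((U a, U b), (U c, U d))) =
      ((haarProbability G).prod (haarProbability G)).prod ((haarProbability G).prod (haarProbability G)) := by
  have hind := (iIndepFun_eval (ι := ι) (G := G)).indepFun_prodMk_prodMk (fun e => measurable_pi_apply e)
    a b c d hac had hbc hbd
  have hm1 : AEMeasurable (fun U : ι → G => (U a, U b)) (Measure.pi (fun _ : ι => haarProbability G)) :=
    ((measurable_pi_apply a).prodMk (measurable_pi_apply b)).aemeasurable
  have hm2 : AEMeasurable (fun U : ι → G => (U c, U d)) (Measure.pi (fun _ : ι => haarProbability G)) :=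
    ((measurable_pi_apply c).prodMk (measurable_pi_apply d)).aemeasurable
  rw [(indepFun_iff_map_prod_eq_prod_map_map hm1 hm2).mp hind, map_eval_pair hab, map_eval_pair hcd]

/-- ★ **Integral of a continuous function of two distinct links** = the iterated Haar integral. [cite: Wilson1974, §III (one-site Wilson action: Gibbs-tilted product Haar measure; bookkeeping)] -/
theorem integral_eval_pair {a b : ι} (hab : a ≠ b) (F : G × G → ℝ) (hF : Continuous F) :
    ∫ U, F (U a, U b) ∂(Measure.pi (fun _ : ι => haarProbability G)) = ∫ x, ∫ y, F (x, y) ∂haarProbability G ∂haarProbability G := by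
  have hm : AEMeasurable (fun U : ι → G => (U a, U b)) (Measure.pi (fun _ : ι => haarProbability G)) :=
    ((measurable_pi_apply a).prodMk (measurable_pi_apply b)).aemeasurable
  have h1 : ∫ U, F (U a, U b) ∂(Measure.pi (fun _ : ι => haarProbability G)) = ∫ z, F z ∂(((Measure.pi (fun _ : ι => haarProbability G))).map (fun U : ι → G => (U a, U b))) :=
    (integral_map hm hF.aestronglyMeasurable).symm
  rw [h1, map_eval_pair hab, integral_prod]
  exact hF.integrable_of_hasCompactSupport (HasCompactSupport.of_compactSpace _)

/-- ★ **Integral of a continuous function of four distinct links** = the fourfold iterated Haar integral. [cite: Wilson1974, §III (one-site Wilson action: Gibbs-tilted product Haar measure; bookkeeping)] -/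
theorem integral_eval_quad {a b c d : ι} (hab : a ≠ b) (hcd : c ≠ d) (hac : a ≠ c) (had : a ≠ d) (hbc : b ≠ c)
    (hbd : b ≠ d) (F : (G × G) × (G × G) → ℝ) (hF : Continuous F) :
    ∫ U, F ((U a, U b), (U c, U d)) ∂(Measure.pi (fun _ : ι => haarProbability G)) =
      ∫ x, ∫ x', ∫ y, ∫ y', F ((x, x'), (y, y')) ∂haarProbability G ∂haarProbability G ∂haarProbability G
        ∂haarProbability G := by
  have hm : AEMeasurable (fun U : ι → G => ((U a, U b), (U c, U d))) (Measure.pi (fun _ : ι => haarProbability G)) :=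
    (((measurable_pi_apply a).prodMk (measurable_pi_apply b)).prodMk
      ((measurable_pi_apply c).prodMk (measurable_pi_apply d))).aemeasurable
  have h1 : ∫ U, F ((U a, U b), (U c, U d)) ∂(Measure.pi (fun _ : ι => haarProbability G)) = ∫ z, F z ∂(((Measure.pi (fun _ : ι => haarProbability G))).map (fun U : ι → G => ((U a, U b), (U c, U d)))) :=
    (integral_map hm hF.aestronglyMeasurable).symm
  have hFi : Integrable F (((haarProbability G).prod (haarProbability G)).prod
      ((haarProbability G).prod (haarProbability G))) :=
    hF.integrable_of_hasCompactSupport (HasCompactSupport.of_compactSpace _)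
  rw [h1, map_eval_quad hab hcd hac had hbc hbd, integral_prod _ hFi]
  -- split the outer pair
  have hinner : ∀ p : G × G, Continuous fun q : G × G => F (p, q) := fun p => hF.comp (Continuous.prodMk_right p)
  rw [integral_prod _ hFi.integral_prod_left]
  refine integral_congr_ae (ae_of_all _ fun x => integral_congr_ae (ae_of_all _ fun x' => ?_))
  simp only
  rw [integral_prod _ ((hinner (x, x')).integrable_of_hasCompactSupport (HasCompactSupport.of_compactSpace _))]

end Fubini

end Literature.MathematicalPhysics.QuantumFieldTheory.ToronCumulant

end Part3

/-!
## Part 4 — port of `Summits/QuantumFields/YangMills/Theorems/ToronCumulantSignOneSiteExpectations.lean` (13 declarations kept)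

# Route `ToronCumulantSign`, crux `OneSiteCovDerivative` (stmt-QuantumFields-27531) — helper IV:
# the product-Haar expectations of the one-site plaquette energies in literal iterated form

Under product Haar measure `π` on the links (index type `ι`, values in `SU(N)`, `N = 2 + n`), with the commutator energy
`R(X,Y) = Re tr(XYX⁻¹Y⁻¹)`, `w = |tr|²`, and "readers" `A, B ∈ {R, Rᵀ}` (abstractly: continuous, with `∫ A(x,x') dx' = w(x)/N`):
for four distinct links `a, b, c, d`,
* `E[A(U_a,U_b) B(U_c,U_d) R(U_a,U_c)] = N⁻² ∫∫ w(x) w(y) R(x,y)`   (`integral_reader_PQR`),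
* `E[A(U_a,U_b) R(U_a,U_c)] = N⁻¹ ∫∫ w(x) R(x,y)`, `E[B(U_c,U_d) R(U_a,U_c)] = N⁻¹ ∫∫ w(y) R(x,y)`, `E[R(U_a,U_c)] = ∫∫ R`,
* `E[A(U_a,U_b) B(U_c,U_d)] = N⁻²`, `E[A(U_a,U_b)] = N⁻¹`, and the in-plane third moments factor,
all as LITERAL iterated Haar integrals (helpers II, III).  HONEST LABEL: bookkeeping toward the OPEN crux `OneSiteCovDerivative`;
nothing about the Yang–Mills mass gap.

(Verbatim declaration-level port — the declarations listed in the Part header count — of the Summits-side module; route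
bookkeeping of the source docstring, if any, is historical; `local notation3` shorthands of the source are expanded in place.)
-/

section Part4

open _root_.MeasureTheory
open Literature.MathematicalPhysics.QuantumLattice Literature.MathematicalPhysics.QuantumFieldTheory

namespace Literature.MathematicalPhysics.QuantumFieldTheory.ToronCumulant

section Expect

variable {n : ℕ} {ι : Type*} [Fintype ι]

omit [Fintype ι] in
/-- Continuity of `z ↦ R(f z, g z)`. [cite: Wilson1974, §III (one-site Wilson action: Gibbs-tilted product Haar measure; bookkeeping)] -/
theorem continuous_R_comp {Z : Type*} [TopologicalSpace Z] {f g : Z → (Matrix.specialUnitaryGroup (Fin (2 + n)) ℂ)} (hf : Continuous f) (hg : Continuous g) :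
    Continuous fun z => (((((f z) * (g z) * (f z)⁻¹ * (g z)⁻¹ : (Matrix.specialUnitaryGroup (Fin (2 + n)) ℂ)) : Matrix (Fin (2 + n)) (Fin (2 + n)) ℂ).trace.re : ℝ)) := by
  have h : Continuous fun z => (f z * g z * (f z)⁻¹ * (g z)⁻¹ : (Matrix.specialUnitaryGroup (Fin (2 + n)) ℂ)) := by fun_prop
  exact Complex.continuous_re.comp (continuous_id.matrix_trace.comp (continuous_subtype_val.comp h))

omit [Fintype ι] in
/-- Continuity of a reader composed with two continuous maps. [cite: Wilson1974, §III (one-site Wilson action: Gibbs-tilted product Haar measure; bookkeeping)] -/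
theorem continuous_reader_comp {Z : Type*} [TopologicalSpace Z] {A : (Matrix.specialUnitaryGroup (Fin (2 + n)) ℂ) → (Matrix.specialUnitaryGroup (Fin (2 + n)) ℂ) → ℝ} (hA : Continuous (Function.uncurry A))
    {f g : Z → (Matrix.specialUnitaryGroup (Fin (2 + n)) ℂ)} (hf : Continuous f) (hg : Continuous g) : Continuous fun z => A (f z) (g z) :=
  hA.comp (hf.prodMk hg)

omit [Fintype ι] in
/-- The reader `R` is continuous. [cite: Wilson1974, §III (one-site Wilson action: Gibbs-tilted product Haar measure; bookkeeping)] -/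
theorem continuous_uncurry_R : Continuous (Function.uncurry fun X Y : (Matrix.specialUnitaryGroup (Fin (2 + n)) ℂ) => ((((X * Y * X⁻¹ * Y⁻¹ : (Matrix.specialUnitaryGroup (Fin (2 + n)) ℂ)) : Matrix (Fin (2 + n)) (Fin (2 + n)) ℂ).trace.re : ℝ))) :=
  continuous_R_comp continuous_fst continuous_snd

omit [Fintype ι] in
/-- The transposed reader `Rᵀ(x,x') = R(x',x)` is continuous. [cite: Wilson1974, §III (one-site Wilson action: Gibbs-tilted product Haar measure; bookkeeping)] -/
theorem continuous_uncurry_Rt : Continuous (Function.uncurry fun X Y : (Matrix.specialUnitaryGroup (Fin (2 + n)) ℂ) => ((((Y * X * Y⁻¹ * X⁻¹ : (Matrix.specialUnitaryGroup (Fin (2 + n)) ℂ)) : Matrix (Fin (2 + n)) (Fin (2 + n)) ℂ).trace.re : ℝ))) :=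
  continuous_R_comp continuous_snd continuous_fst

/-- ★ `E[R(U_a, U_b)] = ∫∫ R = 1/N` for distinct links. [cite: Wilson1974, §III (one-site Wilson action: Gibbs-tilted product Haar measure; bookkeeping)] -/
theorem integral_link_R {a b : ι} (hab : a ≠ b) :
    ∫ U, (((((U a) * (U b) * (U a)⁻¹ * (U b)⁻¹ : (Matrix.specialUnitaryGroup (Fin (2 + n)) ℂ)) : Matrix (Fin (2 + n)) (Fin (2 + n)) ℂ).trace.re : ℝ)) ∂(Measure.pi (fun _ : ι => haarProbability (Matrix.specialUnitaryGroup (Fin (2 + n)) ℂ))) = ∫ x, ∫ y, ((((x * y * x⁻¹ * y⁻¹ : (Matrix.specialUnitaryGroup (Fin (2 + n)) ℂ)) : Matrix (Fin (2 + n)) (Fin (2 + n)) ℂ).trace.re : ℝ)) ∂(haarProbability (Matrix.specialUnitaryGroup (Fin (2 + n)) ℂ)) ∂(haarProbability (Matrix.specialUnitaryGroup (Fin (2 + n)) ℂ)) := by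
  haveI := secondCountableTopology_su' (n := n)
  exact integral_eval_pair hab (fun z : (Matrix.specialUnitaryGroup (Fin (2 + n)) ℂ) × (Matrix.specialUnitaryGroup (Fin (2 + n)) ℂ) => ((((z.1 * z.2 * z.1⁻¹ * z.2⁻¹ : (Matrix.specialUnitaryGroup (Fin (2 + n)) ℂ)) : Matrix (Fin (2 + n)) (Fin (2 + n)) ℂ).trace.re : ℝ))) (continuous_R_comp continuous_fst continuous_snd)

/-- ★ Mixed plane: `E[A(U_a,U_b) B(U_c,U_d) R(U_a,U_c)] = N⁻² ∫∫ w w R`. [cite: Wilson1974, §III (one-site Wilson action: Gibbs-tilted product Haar measure; bookkeeping)] -/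
theorem integral_link_PQR {A B : (Matrix.specialUnitaryGroup (Fin (2 + n)) ℂ) → (Matrix.specialUnitaryGroup (Fin (2 + n)) ℂ) → ℝ} (hAc : Continuous (Function.uncurry A))
    (hBc : Continuous (Function.uncurry B)) (hA : ∀ x, ∫ x', A x x' ∂(haarProbability (Matrix.specialUnitaryGroup (Fin (2 + n)) ℂ)) = ((Complex.normSq (Matrix.trace ((x : (Matrix.specialUnitaryGroup (Fin (2 + n)) ℂ)) : Matrix (Fin (2 + n)) (Fin (2 + n)) ℂ)) : ℝ)) / (2 + n : ℝ))
    (hB : ∀ y, ∫ y', B y y' ∂(haarProbability (Matrix.specialUnitaryGroup (Fin (2 + n)) ℂ)) = ((Complex.normSq (Matrix.trace ((y : (Matrix.specialUnitaryGroup (Fin (2 + n)) ℂ)) : Matrix (Fin (2 + n)) (Fin (2 + n)) ℂ)) : ℝ)) / (2 + n : ℝ)) {a b c d : ι} (hab : a ≠ b) (hcd : c ≠ d) (hac : a ≠ c)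
    (had : a ≠ d) (hbc : b ≠ c) (hbd : b ≠ d) :
    ∫ U, A (U a) (U b) * B (U c) (U d) * (((((U a) * (U c) * (U a)⁻¹ * (U c)⁻¹ : (Matrix.specialUnitaryGroup (Fin (2 + n)) ℂ)) : Matrix (Fin (2 + n)) (Fin (2 + n)) ℂ).trace.re : ℝ)) ∂(Measure.pi (fun _ : ι => haarProbability (Matrix.specialUnitaryGroup (Fin (2 + n)) ℂ))) =
      (1 / (2 + n : ℝ)) ^ 2 * ∫ x, ∫ y, ((Complex.normSq (Matrix.trace ((x : (Matrix.specialUnitaryGroup (Fin (2 + n)) ℂ)) : Matrix (Fin (2 + n)) (Fin (2 + n)) ℂ)) : ℝ)) * ((Complex.normSq (Matrix.trace ((y : (Matrix.specialUnitaryGroup (Fin (2 + n)) ℂ)) : Matrix (Fin (2 + n)) (Fin (2 + n)) ℂ)) : ℝ)) * ((((x * y * x⁻¹ * y⁻¹ : (Matrix.specialUnitaryGroup (Fin (2 + n)) ℂ)) : Matrix (Fin (2 + n)) (Fin (2 + n)) ℂ).trace.re : ℝ)) ∂(haarProbability (Matrix.specialUnitaryGroup (Fin (2 + n)) ℂ))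 ∂(haarProbability (Matrix.specialUnitaryGroup (Fin (2 + n)) ℂ)) := by
  haveI := secondCountableTopology_su' (n := n)
  have hF : Continuous fun z : ((Matrix.specialUnitaryGroup (Fin (2 + n)) ℂ) × (Matrix.specialUnitaryGroup (Fin (2 + n)) ℂ)) × ((Matrix.specialUnitaryGroup (Fin (2 + n)) ℂ) × (Matrix.specialUnitaryGroup (Fin (2 + n)) ℂ)) => A z.1.1 z.1.2 * B z.2.1 z.2.2 * ((((z.1.1 * z.2.1 * z.1.1⁻¹ * z.2.1⁻¹ : (Matrix.specialUnitaryGroup (Fin (2 + n)) ℂ)) : Matrix (Fin (2 + n)) (Fin (2 + n)) ℂ).trace.re : ℝ)) :=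
    ((continuous_reader_comp hAc (continuous_fst.comp continuous_fst) (continuous_snd.comp continuous_fst)).mul
      (continuous_reader_comp hBc (continuous_fst.comp continuous_snd) (continuous_snd.comp continuous_snd))).mul
      (continuous_R_comp (continuous_fst.comp continuous_fst) (continuous_fst.comp continuous_snd))
  have h := integral_eval_quad hab hcd hac had hbc hbd _ hF
  simp only at h
  rw [h]
  exact iter_mixed_PQR A B hA hB

/-- ★ Mixed plane: `E[A(U_a,U_b) R(U_a,U_c)] = N⁻¹ ∫∫ w(x) R(x,y)`. [cite: Wilson1974, §III (one-site Wilson action: Gibbs-tilted product Haar measure; bookkeeping)] -/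
theorem integral_link_PR {A : (Matrix.specialUnitaryGroup (Fin (2 + n)) ℂ) → (Matrix.specialUnitaryGroup (Fin (2 + n)) ℂ) → ℝ} (hAc : Continuous (Function.uncurry A))
    (hA : ∀ x, ∫ x', A x x' ∂(haarProbability (Matrix.specialUnitaryGroup (Fin (2 + n)) ℂ)) = ((Complex.normSq (Matrix.trace ((x : (Matrix.specialUnitaryGroup (Fin (2 + n)) ℂ)) : Matrix (Fin (2 + n)) (Fin (2 + n)) ℂ)) : ℝ)) / (2 + n : ℝ)) {a b c d : ι} (hab : a ≠ b) (hcd : c ≠ d) (hac : a ≠ c)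
    (had : a ≠ d) (hbc : b ≠ c) (hbd : b ≠ d) :
    ∫ U, A (U a) (U b) * (((((U a) * (U c) * (U a)⁻¹ * (U c)⁻¹ : (Matrix.specialUnitaryGroup (Fin (2 + n)) ℂ)) : Matrix (Fin (2 + n)) (Fin (2 + n)) ℂ).trace.re : ℝ)) ∂(Measure.pi (fun _ : ι => haarProbability (Matrix.specialUnitaryGroup (Fin (2 + n)) ℂ))) = (1 / (2 + n : ℝ)) * ∫ x, ∫ y, ((Complex.normSq (Matrix.trace ((x : (Matrix.specialUnitaryGroup (Fin (2 + n)) ℂ)) : Matrix (Fin (2 + n)) (Fin (2 + n)) ℂ)) : ℝ)) * ((((x * y * x⁻¹ * y⁻¹ : (Matrix.specialUnitaryGroup (Fin (2 + n)) ℂ)) : Matrix (Fin (2 + n)) (Fin (2 + n)) ℂ).trace.re : ℝ)) ∂(haarProbability (Matrix.specialUnitaryGroup (Fin (2 + n)) ℂ)) ∂(haarProbability (Matrix.specialUnitaryGroup (Fin (2 + n)) ℂ)) := by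
  haveI := secondCountableTopology_su' (n := n)
  have hF : Continuous fun z : ((Matrix.specialUnitaryGroup (Fin (2 + n)) ℂ) × (Matrix.specialUnitaryGroup (Fin (2 + n)) ℂ)) × ((Matrix.specialUnitaryGroup (Fin (2 + n)) ℂ) × (Matrix.specialUnitaryGroup (Fin (2 + n)) ℂ)) => A z.1.1 z.1.2 * ((((z.1.1 * z.2.1 * z.1.1⁻¹ * z.2.1⁻¹ : (Matrix.specialUnitaryGroup (Fin (2 + n)) ℂ)) : Matrix (Fin (2 + n)) (Fin (2 + n)) ℂ).trace.re : ℝ)) :=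
    (continuous_reader_comp hAc (continuous_fst.comp continuous_fst) (continuous_snd.comp continuous_fst)).mul
      (continuous_R_comp (continuous_fst.comp continuous_fst) (continuous_fst.comp continuous_snd))
  have h := integral_eval_quad hab hcd hac had hbc hbd _ hF
  simp only at h
  rw [h]
  exact iter_mixed_PR A hA

/-- ★ Mixed plane: `E[B(U_c,U_d) R(U_a,U_c)] = N⁻¹ ∫∫ w(y) R(x,y)`. [cite: Wilson1974, §III (one-site Wilson action: Gibbs-tilted product Haar measure; bookkeeping)] -/
theorem integral_link_QR {B : (Matrix.specialUnitaryGroup (Fin (2 + n)) ℂ) → (Matrix.specialUnitaryGroup (Fin (2 + n)) ℂ) → ℝ} (hBc : Continuous (Function.uncurry B))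
    (hB : ∀ y, ∫ y', B y y' ∂(haarProbability (Matrix.specialUnitaryGroup (Fin (2 + n)) ℂ)) = ((Complex.normSq (Matrix.trace ((y : (Matrix.specialUnitaryGroup (Fin (2 + n)) ℂ)) : Matrix (Fin (2 + n)) (Fin (2 + n)) ℂ)) : ℝ)) / (2 + n : ℝ)) {a b c d : ι} (hab : a ≠ b) (hcd : c ≠ d) (hac : a ≠ c)
    (had : a ≠ d) (hbc : b ≠ c) (hbd : b ≠ d) :
    ∫ U, B (U c) (U d) * (((((U a) * (U c) * (U a)⁻¹ * (U c)⁻¹ : (Matrix.specialUnitaryGroup (Fin (2 + n)) ℂ)) : Matrix (Fin (2 + n)) (Fin (2 + n)) ℂ).trace.re : ℝ)) ∂(Measure.pi (fun _ : ι => haarProbability (Matrix.specialUnitaryGroup (Fin (2 + n)) ℂ))) = (1 / (2 + n : ℝ)) * ∫ x, ∫ y, ((Complex.normSq (Matrix.trace ((y : (Matrix.specialUnitaryGroup (Fin (2 + n)) ℂ)) : Matrix (Fin (2 + n)) (Fin (2 + n)) ℂ)) : ℝ)) * ((((x * y * x⁻¹ * y⁻¹ : (Matrix.specialUnitaryGroup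 (Fin (2 + n)) ℂ)) : Matrix (Fin (2 + n)) (Fin (2 + n)) ℂ).trace.re : ℝ)) ∂(haarProbability (Matrix.specialUnitaryGroup (Fin (2 + n)) ℂ)) ∂(haarProbability (Matrix.specialUnitaryGroup (Fin (2 + n)) ℂ)) := by
  haveI := secondCountableTopology_su' (n := n)
  have hF : Continuous fun z : ((Matrix.specialUnitaryGroup (Fin (2 + n)) ℂ) × (Matrix.specialUnitaryGroup (Fin (2 + n)) ℂ)) × ((Matrix.specialUnitaryGroup (Fin (2 + n)) ℂ) × (Matrix.specialUnitaryGroup (Fin (2 + n)) ℂ)) => B z.2.1 z.2.2 * ((((z.1.1 * z.2.1 * z.1.1⁻¹ * z.2.1⁻¹ : (Matrix.specialUnitaryGroup (Fin (2 + n)) ℂ)) : Matrix (Fin (2 + n)) (Fin (2 + n)) ℂ).trace.re : ℝ)) :=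
    (continuous_reader_comp hBc (continuous_fst.comp continuous_snd) (continuous_snd.comp continuous_snd)).mul
      (continuous_R_comp (continuous_fst.comp continuous_fst) (continuous_fst.comp continuous_snd))
  have h := integral_eval_quad hab hcd hac had hbc hbd _ hF
  simp only at h
  rw [h]
  exact iter_mixed_QR B hB

/-- ★ `E[A(U_a,U_b) B(U_c,U_d)] = N⁻²` (independent planes). [cite: Wilson1974, §III (one-site Wilson action: Gibbs-tilted product Haar measure; bookkeeping)] -/
theorem integral_link_PQ {A B : (Matrix.specialUnitaryGroup (Fin (2 + n)) ℂ) → (Matrix.specialUnitaryGroup (Fin (2 + n)) ℂ) → ℝ} (hAc : Continuous (Function.uncurry A))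
    (hBc : Continuous (Function.uncurry B)) (hA : ∀ x, ∫ x', A x x' ∂(haarProbability (Matrix.specialUnitaryGroup (Fin (2 + n)) ℂ)) = ((Complex.normSq (Matrix.trace ((x : (Matrix.specialUnitaryGroup (Fin (2 + n)) ℂ)) : Matrix (Fin (2 + n)) (Fin (2 + n)) ℂ)) : ℝ)) / (2 + n : ℝ))
    (hB : ∀ y, ∫ y', B y y' ∂(haarProbability (Matrix.specialUnitaryGroup (Fin (2 + n)) ℂ)) = ((Complex.normSq (Matrix.trace ((y : (Matrix.specialUnitaryGroup (Fin (2 + n)) ℂ)) : Matrix (Fin (2 + n)) (Fin (2 + n)) ℂ)) : ℝ)) / (2 + n : ℝ)) {a b c d : ι} (hab : a ≠ b) (hcd : c ≠ d) (hac : a ≠ c)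
    (had : a ≠ d) (hbc : b ≠ c) (hbd : b ≠ d) :
    ∫ U, A (U a) (U b) * B (U c) (U d) ∂(Measure.pi (fun _ : ι => haarProbability (Matrix.specialUnitaryGroup (Fin (2 + n)) ℂ))) = (1 / (2 + n : ℝ)) ^ 2 := by
  haveI := secondCountableTopology_su' (n := n)
  have hF : Continuous fun z : ((Matrix.specialUnitaryGroup (Fin (2 + n)) ℂ) × (Matrix.specialUnitaryGroup (Fin (2 + n)) ℂ)) × ((Matrix.specialUnitaryGroup (Fin (2 + n)) ℂ) × (Matrix.specialUnitaryGroup (Fin (2 + n)) ℂ)) => A z.1.1 z.1.2 * B z.2.1 z.2.2 :=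
    (continuous_reader_comp hAc (continuous_fst.comp continuous_fst) (continuous_snd.comp continuous_fst)).mul
      (continuous_reader_comp hBc (continuous_fst.comp continuous_snd) (continuous_snd.comp continuous_snd))
  have h := integral_eval_quad hab hcd hac had hbc hbd _ hF
  simp only at h
  rw [h]
  exact iter_PQ A B hA hB

/-- ★ `E[A(U_a,U_b)] = N⁻¹`. [cite: Wilson1974, §III (one-site Wilson action: Gibbs-tilted product Haar measure; bookkeeping)] -/
theorem integral_link_P {A : (Matrix.specialUnitaryGroup (Fin (2 + n)) ℂ) → (Matrix.specialUnitaryGroup (Fin (2 + n)) ℂ) → ℝ} (hAc : Continuous (Function.uncurry A))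
    (hA : ∀ x, ∫ x', A x x' ∂(haarProbability (Matrix.specialUnitaryGroup (Fin (2 + n)) ℂ)) = ((Complex.normSq (Matrix.trace ((x : (Matrix.specialUnitaryGroup (Fin (2 + n)) ℂ)) : Matrix (Fin (2 + n)) (Fin (2 + n)) ℂ)) : ℝ)) / (2 + n : ℝ)) {a b : ι} (hab : a ≠ b) :
    ∫ U, A (U a) (U b) ∂(Measure.pi (fun _ : ι => haarProbability (Matrix.specialUnitaryGroup (Fin (2 + n)) ℂ))) = 1 / (2 + n : ℝ) := by
  haveI := secondCountableTopology_su' (n := n)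
  have h := integral_eval_pair hab _ hAc
  simp only [Function.uncurry_apply_pair] at h
  rw [h]
  simp_rw [hA, integral_div, integral_w]

/-- In-plane: `E[A(U_a,U_b) B(U_c,U_d) A(U_a,U_b)] = N⁻¹ ∫∫ A²`. [cite: Wilson1974, §III (one-site Wilson action: Gibbs-tilted product Haar measure; bookkeeping)] -/
theorem integral_link_PQP {A B : (Matrix.specialUnitaryGroup (Fin (2 + n)) ℂ) → (Matrix.specialUnitaryGroup (Fin (2 + n)) ℂ) → ℝ} (hAc : Continuous (Function.uncurry A))
    (hBc : Continuous (Function.uncurry B)) (hB : ∀ y, ∫ y', B y y' ∂(haarProbability (Matrix.specialUnitaryGroup (Fin (2 + n)) ℂ)) = ((Complex.normSq (Matrix.trace ((y : (Matrix.specialUnitaryGroup (Fin (2 + n)) ℂ)) : Matrix (Fin (2 + n)) (Fin (2 + n)) ℂ)) : ℝ)) / (2 + n : ℝ)) {a b c d : ι} (hab : a ≠ b)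
    (hcd : c ≠ d) (hac : a ≠ c) (had : a ≠ d) (hbc : b ≠ c) (hbd : b ≠ d) :
    ∫ U, A (U a) (U b) * B (U c) (U d) * A (U a) (U b) ∂(Measure.pi (fun _ : ι => haarProbability (Matrix.specialUnitaryGroup (Fin (2 + n)) ℂ))) =
      (1 / (2 + n : ℝ)) * ∫ x, ∫ x', A x x' * A x x' ∂(haarProbability (Matrix.specialUnitaryGroup (Fin (2 + n)) ℂ)) ∂(haarProbability (Matrix.specialUnitaryGroup (Fin (2 + n)) ℂ)) := by
  haveI := secondCountableTopology_su' (n := n)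
  have hF : Continuous fun z : ((Matrix.specialUnitaryGroup (Fin (2 + n)) ℂ) × (Matrix.specialUnitaryGroup (Fin (2 + n)) ℂ)) × ((Matrix.specialUnitaryGroup (Fin (2 + n)) ℂ) × (Matrix.specialUnitaryGroup (Fin (2 + n)) ℂ)) => A z.1.1 z.1.2 * B z.2.1 z.2.2 * A z.1.1 z.1.2 :=
    ((continuous_reader_comp hAc (continuous_fst.comp continuous_fst) (continuous_snd.comp continuous_fst)).mul
      (continuous_reader_comp hBc (continuous_fst.comp continuous_snd) (continuous_snd.comp continuous_snd))).mul
      (continuous_reader_comp hAc (continuous_fst.comp continuous_fst) (continuous_snd.comp continuous_fst))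
  have h := integral_eval_quad hab hcd hac had hbc hbd _ hF
  simp only at h
  rw [h]
  exact iter_PQP A B hB

/-- In-plane: `E[A(U_a,U_b) A(U_a,U_b)] = ∫∫ A²`. [cite: Wilson1974, §III (one-site Wilson action: Gibbs-tilted product Haar measure; bookkeeping)] -/
theorem integral_link_PP {A : (Matrix.specialUnitaryGroup (Fin (2 + n)) ℂ) → (Matrix.specialUnitaryGroup (Fin (2 + n)) ℂ) → ℝ} (hAc : Continuous (Function.uncurry A)) {a b : ι} (hab : a ≠ b) :
    ∫ U, A (U a) (U b) * A (U a) (U b) ∂(Measure.pi (fun _ : ι => haarProbability (Matrix.specialUnitaryGroup (Fin (2 + n)) ℂ))) = ∫ x, ∫ x', A x x' * A x x' ∂(haarProbability (Matrix.specialUnitaryGroup (Fin (2 + n)) ℂ)) ∂(haarProbability (Matrix.specialUnitaryGroup (Fin (2 + n)) ℂ)) := by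
  haveI := secondCountableTopology_su' (n := n)
  have hF : Continuous fun z : (Matrix.specialUnitaryGroup (Fin (2 + n)) ℂ) × (Matrix.specialUnitaryGroup (Fin (2 + n)) ℂ) => A z.1 z.2 * A z.1 z.2 :=
    (continuous_reader_comp hAc continuous_fst continuous_snd).mul (continuous_reader_comp hAc continuous_fst continuous_snd)
  have h := integral_eval_pair hab _ hF
  simp only at h
  exact h

/-- In-plane: `E[A(U_a,U_b) B(U_c,U_d) B(U_c,U_d)] = N⁻¹ ∫∫ B²`. [cite: Wilson1974, §III (one-site Wilson action: Gibbs-tilted product Haar measure; bookkeeping)] -/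
theorem integral_link_PQQ {A B : (Matrix.specialUnitaryGroup (Fin (2 + n)) ℂ) → (Matrix.specialUnitaryGroup (Fin (2 + n)) ℂ) → ℝ} (hAc : Continuous (Function.uncurry A))
    (hBc : Continuous (Function.uncurry B)) (hA : ∀ x, ∫ x', A x x' ∂(haarProbability (Matrix.specialUnitaryGroup (Fin (2 + n)) ℂ)) = ((Complex.normSq (Matrix.trace ((x : (Matrix.specialUnitaryGroup (Fin (2 + n)) ℂ)) : Matrix (Fin (2 + n)) (Fin (2 + n)) ℂ)) : ℝ)) / (2 + n : ℝ)) {a b c d : ι} (hab : a ≠ b)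
    (hcd : c ≠ d) (hac : a ≠ c) (had : a ≠ d) (hbc : b ≠ c) (hbd : b ≠ d) :
    ∫ U, A (U a) (U b) * B (U c) (U d) * B (U c) (U d) ∂(Measure.pi (fun _ : ι => haarProbability (Matrix.specialUnitaryGroup (Fin (2 + n)) ℂ))) =
      (1 / (2 + n : ℝ)) * ∫ y, ∫ y', B y y' * B y y' ∂(haarProbability (Matrix.specialUnitaryGroup (Fin (2 + n)) ℂ)) ∂(haarProbability (Matrix.specialUnitaryGroup (Fin (2 + n)) ℂ)) := by
  haveI := secondCountableTopology_su' (n := n)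
  have hF : Continuous fun z : ((Matrix.specialUnitaryGroup (Fin (2 + n)) ℂ) × (Matrix.specialUnitaryGroup (Fin (2 + n)) ℂ)) × ((Matrix.specialUnitaryGroup (Fin (2 + n)) ℂ) × (Matrix.specialUnitaryGroup (Fin (2 + n)) ℂ)) => A z.1.1 z.1.2 * B z.2.1 z.2.2 * B z.2.1 z.2.2 :=
    ((continuous_reader_comp hAc (continuous_fst.comp continuous_fst) (continuous_snd.comp continuous_fst)).mul
      (continuous_reader_comp hBc (continuous_fst.comp continuous_snd) (continuous_snd.comp continuous_snd))).mul
      (continuous_reader_comp hBc (continuous_fst.comp continuous_snd) (continuous_snd.comp continuous_snd))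
  have h := integral_eval_quad hab hcd hac had hbc hbd _ hF
  simp only at h
  rw [h]
  exact iter_PQQ A B hA

end Expect

end Literature.MathematicalPhysics.QuantumFieldTheory.ToronCumulant

end Part4

/-!
## Part 5 — port of `Summits/QuantumFields/YangMills/Theorems/ToronCumulantSignTiltDerivative.lean` (3 declarations kept)

# Route `ToronCumulantSign`, crux `OneSiteCovDerivative` (stmt-QuantumFields-27531) — helper I:
# the first cumulant of a Gibbs tilt: `d/dt|₀ ∫ H d(π tilted by tX) = E[HX] − E[H]E[X]`

For a probability measure `π`, a bounded measurable "action" `X` and a bounded measurable observable `H`, the tilted mean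
`t ↦ ∫ H d(π.tilted (t·X)) = (∫ H e^{tX} dπ)/(∫ e^{tX} dπ)` is differentiable at `t = 0` with derivative the covariance
`∫ H X dπ − (∫ H dπ)(∫ X dπ)` (dominated differentiation under the integral sign + the quotient rule).  This is the measure-
theoretic packaging of "differentiate a tilted product-Haar expectation at `β = 0`" asked for by the route text; the lattice
bookkeeping is in the sibling files.  HONEST LABEL: an elementary calculus lemma; helper toward the OPEN crux `OneSiteCovDerivative`;
nothing about the Yang–Mills mass gap.

References: S. Friedli, Y. Velenik, *Statistical Mechanics of Lattice Systems* (2017) §3.2 (derivatives of the pressure /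
cumulants); Mathlib `MeasureTheory.integral_tilted`, `hasDerivAt_integral_of_dominated_loc_of_deriv_le`.

(Verbatim declaration-level port — the declarations listed in the Part header count — of the Summits-side module; route
bookkeeping of the source docstring, if any, is historical; `local notation3` shorthands of the source are expanded in place.)
-/

section Part5

open _root_.MeasureTheory _root_.Filter _root_.Set

namespace Literature.MathematicalPhysics.QuantumFieldTheory.ToronCumulant

section Tilt

variable {Ω : Type*} [MeasurableSpace Ω] {μ : Measure Ω} [IsProbabilityMeasure μ] {X H : Ω → ℝ} {CX CH : ℝ}

/-- **Differentiation under the integral sign**: `t ↦ ∫ e^{tX} H dπ` has derivative `∫ X H dπ` at `t = 0` for bounded measurable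
`X, H`. [cite: Wilson1974, §III (one-site Wilson action: Gibbs-tilted product Haar measure; bookkeeping)] -/
theorem hasDerivAt_integral_exp_mul_mul (hX : Measurable X) (hH : Measurable H) (hXb : ∀ ω, |X ω| ≤ CX)
    (hHb : ∀ ω, |H ω| ≤ CH) :
    HasDerivAt (fun t : ℝ => ∫ ω, Real.exp (t * X ω) * H ω ∂μ) (∫ ω, X ω * H ω ∂μ) 0 := by
  -- the parametric integrand and its derivative
  set F : ℝ → Ω → ℝ := fun t ω => Real.exp (t * X ω) * H ω with hF
  set F' : ℝ → Ω → ℝ := fun t ω => X ω * Real.exp (t * X ω) * H ω with hF'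
  have hmeasF : ∀ t, AEStronglyMeasurable (F t) μ := fun t =>
    (((measurable_const.mul hX).exp).mul hH).aestronglyMeasurable
  have hmeasF' : ∀ t, AEStronglyMeasurable (F' t) μ := fun t =>
    ((hX.mul ((measurable_const.mul hX).exp)).mul hH).aestronglyMeasurable
  have hF0 : Integrable (F 0) μ := by
    refine Integrable.of_bound (hmeasF 0) CH (ae_of_all _ fun ω => ?_)
    simp only [hF, zero_mul, Real.exp_zero, one_mul, Real.norm_eq_abs]
    exact hHb ω
  have hbound : ∀ᵐ ω ∂μ, ∀ t ∈ Metric.ball (0 : ℝ) 1, ‖F' t ω‖ ≤ CX * Real.exp CX * CH := by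
    refine ae_of_all _ fun ω t ht => ?_
    have hCX : 0 ≤ CX := (abs_nonneg _).trans (hXb ω)
    rw [Metric.mem_ball, dist_zero_right, Real.norm_eq_abs] at ht
    simp only [hF', Real.norm_eq_abs, abs_mul, Real.abs_exp]
    have h1 : Real.exp (t * X ω) ≤ Real.exp CX := by
      rw [Real.exp_le_exp]
      calc t * X ω ≤ |t * X ω| := le_abs_self _
        _ = |t| * |X ω| := abs_mul _ _
        _ ≤ 1 * CX := mul_le_mul ht.le (hXb ω) (abs_nonneg _) zero_le_one
        _ = CX := one_mul _
    calc |X ω| * Real.exp (t * X ω) * |H ω| ≤ CX * Real.exp CX * CH :=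
        mul_le_mul (mul_le_mul (hXb ω) h1 (Real.exp_pos _).le hCX) (hHb ω) (abs_nonneg _) (by positivity)
      _ = CX * Real.exp CX * CH := rfl
  have hdiff : ∀ᵐ ω ∂μ, ∀ t ∈ Metric.ball (0 : ℝ) 1, HasDerivAt (F · ω) (F' t ω) t := by
    refine ae_of_all _ fun ω t _ => ?_
    simp only [hF, hF']
    have h := ((hasDerivAt_id t).mul_const (X ω)).exp.mul_const (H ω)
    simpa [mul_comm] using h
  have h := (hasDerivAt_integral_of_dominated_loc_of_deriv_le (Metric.ball_mem_nhds (0 : ℝ) zero_lt_one)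
    (Eventually.of_forall hmeasF) hF0 (hmeasF' 0) hbound (integrable_const _) hdiff).2
  simpa [hF, hF'] using h

omit [IsProbabilityMeasure μ] in
/-- **The tilted mean as a quotient**: `∫ H d(μ.tilted (tX)) = (∫ e^{tX} H dμ)/(∫ e^{tX} dμ)`. [cite: Wilson1974, §III (one-site Wilson action: Gibbs-tilted product Haar measure; bookkeeping)] -/
theorem integral_tilted_mul_eq_div (t : ℝ) :
    ∫ ω, H ω ∂(μ.tilted fun ω => t * X ω) =
      (∫ ω, Real.exp (t * X ω) * H ω ∂μ) / ∫ ω, Real.exp (t * X ω) ∂μ := by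
  rw [integral_tilted]
  simp only [smul_eq_mul]
  rw [div_eq_inv_mul, ← integral_const_mul]
  refine integral_congr_ae (ae_of_all _ fun ω => ?_)
  simp only
  ring

/-- ★ **The first cumulant of a Gibbs tilt**: for bounded measurable `X, H` on a probability space,
`d/dt|₀ ∫ H d(μ.tilted (t·X)) = ∫ H X dπ − (∫ H dπ)(∫ X dπ)`. [cite: Wilson1974, §III (one-site Wilson action: Gibbs-tilted product Haar measure; bookkeeping)] -/
theorem hasDerivAt_integral_tilted_zero (hX : Measurable X) (hH : Measurable H) (hXb : ∀ ω, |X ω| ≤ CX)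
    (hHb : ∀ ω, |H ω| ≤ CH) :
    HasDerivAt (fun t : ℝ => ∫ ω, H ω ∂(μ.tilted fun ω => t * X ω))
      ((∫ ω, H ω * X ω ∂μ) - (∫ ω, H ω ∂μ) * (∫ ω, X ω ∂μ)) 0 := by
  have hN := hasDerivAt_integral_exp_mul_mul (μ := μ) hX hH hXb hHb
  have h1b : ∀ ω, |(fun _ : Ω => (1 : ℝ)) ω| ≤ 1 := fun ω => by simp
  have hZ := hasDerivAt_integral_exp_mul_mul (μ := μ) hX measurable_const hXb h1b
  simp only [mul_one] at hZ
  have hZ0 : (∫ ω, Real.exp (0 * X ω) ∂μ) = 1 := by simp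
  have hN0 : (∫ ω, Real.exp (0 * X ω) * H ω ∂μ) = ∫ ω, H ω ∂μ := by simp
  have hq := hN.div hZ (by rw [hZ0]; exact one_ne_zero)
  rw [hZ0, hN0] at hq
  have hfun : (fun t : ℝ => ∫ ω, H ω ∂(μ.tilted fun ω => t * X ω)) =
      fun t => (∫ ω, Real.exp (t * X ω) * H ω ∂μ) / ∫ ω, Real.exp (t * X ω) ∂μ := by
    funext t; exact integral_tilted_mul_eq_div t
  rw [hfun]
  refine hq.congr_deriv ?_
  simp only [one_pow, div_one, mul_one]
  rw [show (∫ ω, X ω * H ω ∂μ) = ∫ ω, H ω * X ω ∂μ from integral_congr_ae (ae_of_all _ fun ω => mul_comm _ _)]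

end Tilt

end Literature.MathematicalPhysics.QuantumFieldTheory.ToronCumulant

end Part5

/-!
## Part 6 — port of `Summits/QuantumFields/YangMills/Theorems/ToronCumulantSignOneSiteCovDerivative.lean` (8 declarations kept)

# Route `ToronCumulantSign` — the crux `OneSiteCovDerivative` (stmt-QuantumFields-27531), PROVED

★★ For every `N ≥ 2`, on the one-site (`L = 1`, Eguchi–Kawai) torus `(ℤ/1)⁴`, the complementary-plane covariance
`β ↦ Cov_β(Re tr U_(0;01), Re tr U_(0;23))` under the `SU(N)` Wilson measure is differentiable at `β = 0` with derivative
`(4/N²)·κ_N`, `κ_N = ∫∫ (|tr X|² − 1)(|tr Y|² − 1) Re tr(XYX⁻¹Y⁻¹) dX dY` (the literal double Haar integral of crux 2).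

Proof.  The Wilson measure is product Haar tilted by `−β S_W` (`wilsonMeasure_eq_tilted_pi`); the first cumulant of a Gibbs tilt
(helper `hasDerivAt_integral_tilted_zero`) gives `d/dβ|₀ Cov_β(P,Q) = Cov(PQ,X) − Cov(P,X)E Q − E P·Cov(Q,X)` with `X = −S_W =
Σ_p (Re tr U_p − N)` over the SIX plaquettes of the one-site torus, whose holonomies are commutators `U_i U_j U_i⁻¹ U_j⁻¹`
(`plaquetteHolonomy_oneSite`).  The two in-plane plaquettes contribute `0` (independence of the planes); each of the four mixed
plaquettes contributes `κ_N/N²`, by the product-Haar bookkeeping of helpers II–IV (only the Schur integral `∫ Re tr(XYX⁻¹Y⁻¹) dY =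
|tr X|²/N` enters).  HONEST LABEL: with crux 2 (`CommutatorSkewMoment`, p680606) this closes the barrier-ledger line
`ToronCumulantSign` (Griffiths II fails for `SU(N)` plaquette energies); nothing about any LADDER-YM rung or the Yang–Mills mass gap.

References: S. Chatterjee, arXiv:1803.01950 §2–3; K. Wilson, Phys. Rev. D 10 (1974) 2445 [Wilson1974]; B. Collins, P. Śniady,
CMP 264 (2006) [CollinsSniady2006].

(Verbatim declaration-level port — the declarations listed in the Part header count — of the Summits-side module; route
bookkeeping of the source docstring, if any, is historical; `local notation3` shorthands of the source are expanded in place.)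
-/

section Part6

open _root_.MeasureTheory _root_.ProbabilityTheory
open Literature.MathematicalPhysics.QuantumLattice Literature.MathematicalPhysics.QuantumFieldTheory
open Literature.Barriers.QuantumFields

namespace Literature.MathematicalPhysics.QuantumFieldTheory.ToronCumulant

/-! ### A generic covariance expansion -/

/-- `Cov(H, −Σ_p (c − G_p)) = Σ_p Cov(H, G_p)` (constants drop out of a covariance). [cite: Wilson1974, §III (one-site Wilson action: Gibbs-tilted product Haar measure; bookkeeping)] -/
theorem cov_neg_sum_const_sub {Ω : Type*} [MeasurableSpace Ω] {μ : Measure Ω} [IsProbabilityMeasure μ] {ι' : Type*}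
    [Fintype ι'] (H : Ω → ℝ) (G : ι' → Ω → ℝ) (c : ℝ) (hH : Integrable H μ) (hG : ∀ p, Integrable (G p) μ)
    (hHG : ∀ p, Integrable (fun ω => H ω * G p ω) μ) :
    (∫ ω, H ω * (-(∑ p, (c - G p ω))) ∂μ) - (∫ ω, H ω ∂μ) * (∫ ω, (-(∑ p, (c - G p ω))) ∂μ) =
      ∑ p, ((∫ ω, H ω * G p ω ∂μ) - (∫ ω, H ω ∂μ) * (∫ ω, G p ω ∂μ)) := by
  have e1 : ∀ ω, H ω * (-(∑ p, (c - G p ω))) = ∑ p, (H ω * G p ω - c * H ω) := by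
    intro ω
    rw [neg_eq_neg_one_mul, Finset.mul_sum, Finset.mul_sum]
    exact Finset.sum_congr rfl fun p _ => by ring
  have e2 : ∀ ω, (-(∑ p, (c - G p ω))) = ∑ p, (G p ω - c) := by
    intro ω
    rw [neg_eq_neg_one_mul, Finset.mul_sum]
    exact Finset.sum_congr rfl fun p _ => by ring
  simp_rw [e1, e2]
  have i1 : ∀ p, Integrable (fun ω => H ω * G p ω - c * H ω) μ := fun p => (hHG p).sub (hH.const_mul c)
  have i2 : ∀ p, Integrable (fun ω => G p ω - c) μ := fun p => (hG p).sub (integrable_const c)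
  rw [integral_finsetSum _ (fun p _ => i1 p), integral_finsetSum _ (fun p _ => i2 p)]
  simp_rw [integral_sub (hHG _) (hH.const_mul c), integral_sub (hG _) (integrable_const c), integral_const_mul,
    integral_const, probReal_univ, one_smul]
  rw [Finset.mul_sum, ← Finset.sum_sub_distrib]
  exact Finset.sum_congr rfl fun p _ => by ring

/-- **The six plaquettes of the one-site torus `(ℤ/1)⁴`.** [cite: Wilson1974, §III (one-site Wilson action: Gibbs-tilted product Haar measure; bookkeeping)] -/
theorem sum_plaquette_oneSite (f : Plaquette 4 1 → ℝ) :
    ∑ p, f p = f ((0 : Site 4 1), ⟨((0 : Fin 4), (1 : Fin 4)), by decide⟩) + f (0, ⟨(0, 2), by decide⟩) +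
      f (0, ⟨(0, 3), by decide⟩) + f (0, ⟨(1, 2), by decide⟩) + f (0, ⟨(1, 3), by decide⟩) + f (0, ⟨(2, 3), by decide⟩) := by
  rw [Fintype.sum_prod_type, Fintype.sum_unique]
  have hx : (default : Site 4 1) = 0 := Subsingleton.elim _ _
  rw [hx]
  have huniv : (Finset.univ : Finset {q : Fin 4 × Fin 4 // q.1 < q.2}) =
      {⟨(0, 1), by decide⟩, ⟨(0, 2), by decide⟩, ⟨(0, 3), by decide⟩, ⟨(1, 2), by decide⟩, ⟨(1, 3), by decide⟩,
        ⟨(2, 3), by decide⟩} := by decide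
  rw [huniv]
  repeat rw [Finset.sum_insert (by decide)]
  rw [Finset.sum_singleton]
  ring

section Value

variable {n : ℕ}

/-- Distinctness of the four links.
[cite: Wilson1974, §III (one-site Wilson action: Gibbs-tilted product Haar measure; bookkeeping)] -/
theorem edge_ne {i j : Fin 4} (h : i ≠ j) : (((((0 : Site 4 1), (i : Fin 4)) : Edge 4 1))) ≠ (((((0 : Site 4 1), (j : Fin 4)) : Edge 4 1))) := fun h' => h (congrArg Prod.snd h')

/-- Integrability of continuous observables of the one-site links. [cite: Wilson1974, §III (one-site Wilson action: Gibbs-tilted product Haar measure; bookkeeping)] -/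
theorem integrable_links {f : GaugeConfig 4 1 (Matrix.specialUnitaryGroup (Fin (2 + n)) ℂ) → ℝ} (hf : Continuous f) : Integrable f (Measure.pi (fun _ : Edge 4 1 => haarProbability (Matrix.specialUnitaryGroup (Fin (2 + n)) ℂ))) :=
  hf.integrable_of_hasCompactSupport (HasCompactSupport.of_compactSpace _)

/-- Continuity of a plaquette energy `U ↦ R(U_a, U_b)`. [cite: Wilson1974, §III (one-site Wilson action: Gibbs-tilted product Haar measure; bookkeeping)] -/
theorem continuous_linkR (a b : Edge 4 1) : Continuous fun U : GaugeConfig 4 1 (Matrix.specialUnitaryGroup (Fin (2 + n)) ℂ) => (((((U a) * (U b) * (U a)⁻¹ * (U b)⁻¹ : (Matrix.specialUnitaryGroup (Fin (2 + n)) ℂ)) : Matrix (Fin (2 + n)) (Fin (2 + n)) ℂ).trace.re : ℝ)) :=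
  continuous_R_comp (continuous_apply a) (continuous_apply b)

/-- ★★ **The first `β`-cumulant of the one-site complementary-plane covariance, evaluated**: with `P = R(U₀,U₁)`, `Q = R(U₂,U₃)`
and the tilt `X = −Σ_p (N − R(U_{p₁}, U_{p₂}))` over the six one-site plaquettes,
`Cov(PQ,X) − Cov(P,X)·E Q − E P·Cov(Q,X) = (4/N²)·κ_N`. [cite: Wilson1974, §III (one-site Wilson action: Gibbs-tilted product Haar measure; bookkeeping)] -/
theorem cumulant_value :
    ((∫ U, (((((U (((((0 : Site 4 1), (0 : Fin 4)) : Edge 4 1)))) * (U (((((0 : Site 4 1), (1 : Fin 4)) : Edge 4 1)))) * (U (((((0 : Site 4 1), (0 : Fin 4)) : Edge 4 1))))⁻¹ * (U (((((0 : Site 4 1), (1 : Fin 4)) : Edge 4 1))))⁻¹ : (Matrix.specialUnitaryGroup (Fin (2 + n)) ℂ)) : Matrix (Fin (2 + n)) (Fin (2 + n)) ℂ).trace.re : ℝ)) * (((((U (((((0 : Site 4 1), (2 : Fin 4)) : Edge 4 1)))) * (U (((((0 : Site 4 1), (3 : Fin 4)) : Edge 4 1)))) * (U (((((0 : Site 4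 1), (2 : Fin 4)) : Edge 4 1))))⁻¹ * (U (((((0 : Site 4 1), (3 : Fin 4)) : Edge 4 1))))⁻¹ : (Matrix.specialUnitaryGroup (Fin (2 + n)) ℂ)) : Matrix (Fin (2 + n)) (Fin (2 + n)) ℂ).trace.re : ℝ)) *
        (-(∑ p : Plaquette 4 1, (((2 + n : ℕ) : ℝ) - (((((U (p.1, p.2.1.1)) * (U (p.1, p.2.1.2)) * (U (p.1, p.2.1.1))⁻¹ * (U (p.1, p.2.1.2))⁻¹ : (Matrix.specialUnitaryGroup (Fin (2 + n)) ℂ)) : Matrix (Fin (2 + n)) (Fin (2 + n)) ℂ).trace.re : ℝ))))) ∂(Measure.pi (fun _ : Edge 4 1 => haarProbability (Matrix.specialUnitaryGroup (Fin (2 + n)) ℂ)))) -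
      (∫ U, (((((U (((((0 : Site 4 1), (0 : Fin 4)) : Edge 4 1)))) * (U (((((0 : Site 4 1), (1 : Fin 4)) : Edge 4 1)))) * (U (((((0 : Site 4 1), (0 : Fin 4)) : Edge 4 1))))⁻¹ * (U (((((0 : Site 4 1), (1 : Fin 4)) : Edge 4 1))))⁻¹ : (Matrix.specialUnitaryGroup (Fin (2 + n)) ℂ)) : Matrix (Fin (2 + n)) (Fin (2 + n)) ℂ).trace.re : ℝ)) * (((((U (((((0 : Site 4 1), (2 : Fin 4)) : Edge 4 1)))) * (U (((((0 : Site 4 1), (3 : Fin 4)) : Edge 4 1)))) * (U (((((0 : Site 4 1), (2 : Fin 4)) : Edge 4 1))))⁻¹ * (U (((((0 : Site 4 1), (3 : Fin 4)) : Edge 4 1))))⁻¹ : (Matrix.specialUnitaryGroup (Fin (2 + n)) ℂ)) : Matrix (Fin (2 + n)) (Fin (2 + n)) ℂ).trace.re : ℝ)) ∂(Measure.pi (fun _ : Edge 4 1 => haarProbability (Matrix.specialUnitaryGroup (Fin (2 + n)) ℂ)))) *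
        (∫ U, (-(∑ p : Plaquette 4 1, (((2 + n : ℕ) : ℝ) - (((((U (p.1, p.2.1.1)) * (U (p.1, p.2.1.2)) * (U (p.1, p.2.1.1))⁻¹ * (U (p.1, p.2.1.2))⁻¹ : (Matrix.specialUnitaryGroup (Fin (2 + n)) ℂ)) : Matrix (Fin (2 + n)) (Fin (2 + n)) ℂ).trace.re : ℝ))))) ∂(Measure.pi (fun _ : Edge 4 1 => haarProbability (Matrix.specialUnitaryGroup (Fin (2 + n)) ℂ))))) -
    (((∫ U, (((((U (((((0 : Site 4 1), (0 : Fin 4)) : Edge 4 1)))) * (U (((((0 : Site 4 1), (1 : Fin 4)) : Edge 4 1)))) * (U (((((0 : Site 4 1), (0 : Fin 4)) : Edge 4 1))))⁻¹ * (U (((((0 : Site 4 1), (1 : Fin 4)) : Edge 4 1))))⁻¹ : (Matrix.specialUnitaryGroup (Fin (2 + n)) ℂ)) : Matrix (Fin (2 + n)) (Fin (2 + n)) ℂ).trace.re : ℝ)) *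
        (-(∑ p : Plaquette 4 1, (((2 + n : ℕ) : ℝ) - (((((U (p.1, p.2.1.1)) * (U (p.1, p.2.1.2)) * (U (p.1, p.2.1.1))⁻¹ * (U (p.1, p.2.1.2))⁻¹ : (Matrix.specialUnitaryGroup (Fin (2 + n)) ℂ)) : Matrix (Fin (2 + n)) (Fin (2 + n)) ℂ).trace.re : ℝ))))) ∂(Measure.pi (fun _ : Edge 4 1 => haarProbability (Matrix.specialUnitaryGroup (Fin (2 + n)) ℂ)))) -
      (∫ U, (((((U (((((0 : Site 4 1), (0 : Fin 4)) : Edge 4 1)))) * (U (((((0 : Site 4 1), (1 : Fin 4)) : Edge 4 1)))) * (U (((((0 : Site 4 1), (0 : Fin 4)) : Edge 4 1))))⁻¹ * (U (((((0 : Site 4 1), (1 : Fin 4)) : Edge 4 1))))⁻¹ : (Matrix.specialUnitaryGroup (Fin (2 + n)) ℂ)) : Matrix (Fin (2 + n)) (Fin (2 + n)) ℂ).trace.re : ℝ)) ∂(Measure.pi (fun _ : Edge 4 1 => haarProbability (Matrix.specialUnitaryGroup (Fin (2 + n)) ℂ)))) *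
        (∫ U, (-(∑ p : Plaquette 4 1, (((2 + n : ℕ) : ℝ) - (((((U (p.1, p.2.1.1)) * (U (p.1, p.2.1.2)) * (U (p.1, p.2.1.1))⁻¹ * (U (p.1, p.2.1.2))⁻¹ : (Matrix.specialUnitaryGroup (Fin (2 + n)) ℂ)) : Matrix (Fin (2 + n)) (Fin (2 + n)) ℂ).trace.re : ℝ))))) ∂(Measure.pi (fun _ : Edge 4 1 => haarProbability (Matrix.specialUnitaryGroup (Fin (2 + n)) ℂ))))) *
      (∫ U, (((((U (((((0 : Site 4 1), (2 : Fin 4)) : Edge 4 1)))) * (U (((((0 : Site 4 1), (3 : Fin 4)) : Edge 4 1)))) * (U (((((0 : Site 4 1), (2 : Fin 4)) : Edge 4 1))))⁻¹ * (U (((((0 : Site 4 1), (3 : Fin 4)) : Edge 4 1))))⁻¹ : (Matrix.specialUnitaryGroup (Fin (2 + n)) ℂ)) : Matrix (Fin (2 + n)) (Fin (2 + n)) ℂ).trace.re : ℝ)) ∂(Measure.pi (fun _ : Edge 4 1 => haarProbability (Matrix.specialUnitaryGroup (Fin (2 + n)) ℂ)))) +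
    (∫ U, (((((U (((((0 : Site 4 1), (0 : Fin 4)) : Edge 4 1)))) * (U (((((0 : Site 4 1), (1 : Fin 4)) : Edge 4 1)))) * (U (((((0 : Site 4 1), (0 : Fin 4)) : Edge 4 1))))⁻¹ * (U (((((0 : Site 4 1), (1 : Fin 4)) : Edge 4 1))))⁻¹ : (Matrix.specialUnitaryGroup (Fin (2 + n)) ℂ)) : Matrix (Fin (2 + n)) (Fin (2 + n)) ℂ).trace.re : ℝ)) ∂(Measure.pi (fun _ : Edge 4 1 => haarProbability (Matrix.specialUnitaryGroup (Fin (2 + n)) ℂ)))) *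
      ((∫ U, (((((U (((((0 : Site 4 1), (2 : Fin 4)) : Edge 4 1)))) * (U (((((0 : Site 4 1), (3 : Fin 4)) : Edge 4 1)))) * (U (((((0 : Site 4 1), (2 : Fin 4)) : Edge 4 1))))⁻¹ * (U (((((0 : Site 4 1), (3 : Fin 4)) : Edge 4 1))))⁻¹ : (Matrix.specialUnitaryGroup (Fin (2 + n)) ℂ)) : Matrix (Fin (2 + n)) (Fin (2 + n)) ℂ).trace.re : ℝ)) *
        (-(∑ p : Plaquette 4 1, (((2 + n : ℕ) : ℝ) - (((((U (p.1, p.2.1.1)) * (U (p.1, p.2.1.2)) * (U (p.1, p.2.1.1))⁻¹ * (U (p.1, p.2.1.2))⁻¹ : (Matrix.specialUnitaryGroup (Fin (2 + n)) ℂ)) : Matrix (Fin (2 + n)) (Fin (2 + n)) ℂ).trace.re : ℝ))))) ∂(Measure.pi (fun _ : Edge 4 1 => haarProbability (Matrix.specialUnitaryGroup (Fin (2 + n)) ℂ)))) -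
      (∫ U, (((((U (((((0 : Site 4 1), (2 : Fin 4)) : Edge 4 1)))) * (U (((((0 : Site 4 1), (3 : Fin 4)) : Edge 4 1)))) * (U (((((0 : Site 4 1), (2 : Fin 4)) : Edge 4 1))))⁻¹ * (U (((((0 : Site 4 1), (3 : Fin 4)) : Edge 4 1))))⁻¹ : (Matrix.specialUnitaryGroup (Fin (2 + n)) ℂ)) : Matrix (Fin (2 + n)) (Fin (2 + n)) ℂ).trace.re : ℝ)) ∂(Measure.pi (fun _ : Edge 4 1 => haarProbability (Matrix.specialUnitaryGroup (Fin (2 + n)) ℂ)))) *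
        (∫ U, (-(∑ p : Plaquette 4 1, (((2 + n : ℕ) : ℝ) - (((((U (p.1, p.2.1.1)) * (U (p.1, p.2.1.2)) * (U (p.1, p.2.1.1))⁻¹ * (U (p.1, p.2.1.2))⁻¹ : (Matrix.specialUnitaryGroup (Fin (2 + n)) ℂ)) : Matrix (Fin (2 + n)) (Fin (2 + n)) ℂ).trace.re : ℝ))))) ∂(Measure.pi (fun _ : Edge 4 1 => haarProbability (Matrix.specialUnitaryGroup (Fin (2 + n)) ℂ)))))) =
    4 / ((2 + n : ℕ) : ℝ) ^ 2 * ∫ X, ∫ Y, (((Complex.normSq (Matrix.trace ((X : (Matrix.specialUnitaryGroup (Fin (2 + n)) ℂ)) : Matrix (Fin (2 + n)) (Fin (2 + n)) ℂ)) : ℝ)) - 1) * (((Complex.normSq (Matrix.trace ((Y : (Matrix.specialUnitaryGroup (Fin (2 + n)) ℂ)) : Matrix (Fin (2 + n)) (Fin (2 + n)) ℂ)) : ℝ)) - 1) * ((((X * Y * X⁻¹ * Y⁻¹ : (Matrix.specialUnitaryGroup (Fin (2 + n)) ℂ)) : Matrix (Fin (2 + n)) (Fin (2 + n)) ℂ).trace.re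 : ℝ)) ∂(haarProbability (Matrix.specialUnitaryGroup (Fin (2 + n)) ℂ)) ∂(haarProbability (Matrix.specialUnitaryGroup (Fin (2 + n)) ℂ)) := by
  haveI := secondCountableTopology_su' (n := n)
  -- integrability of all the products of link energies
  have hcR := continuous_linkR (n := n)
  have iG : ∀ p : Plaquette 4 1, Integrable (fun U : GaugeConfig 4 1 (Matrix.specialUnitaryGroup (Fin (2 + n)) ℂ) => (((((U (p.1, p.2.1.1)) * (U (p.1, p.2.1.2)) * (U (p.1, p.2.1.1))⁻¹ * (U (p.1, p.2.1.2))⁻¹ : (Matrix.specialUnitaryGroup (Fin (2 + n)) ℂ)) : Matrix (Fin (2 + n)) (Fin (2 + n)) ℂ).trace.re : ℝ))) (Measure.pi (fun _ : Edge 4 1 => haarProbability (Matrix.specialUnitaryGroup (Fin (2 + n)) ℂ))) :=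
    fun p => integrable_links (hcR _ _)
  have iP : Integrable (fun U : GaugeConfig 4 1 (Matrix.specialUnitaryGroup (Fin (2 + n)) ℂ) => (((((U (((((0 : Site 4 1), (0 : Fin 4)) : Edge 4 1)))) * (U (((((0 : Site 4 1), (1 : Fin 4)) : Edge 4 1)))) * (U (((((0 : Site 4 1), (0 : Fin 4)) : Edge 4 1))))⁻¹ * (U (((((0 : Site 4 1), (1 : Fin 4)) : Edge 4 1))))⁻¹ : (Matrix.specialUnitaryGroup (Fin (2 + n)) ℂ)) : Matrix (Fin (2 + n)) (Fin (2 + n)) ℂ).trace.re : ℝ))) (Measure.pi (fun _ : Edge 4 1 => haarProbability (Matrix.specialUnitaryGroup (Fin (2 + n)) ℂ))) := integrable_links (hcR _ _)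
  have iQ : Integrable (fun U : GaugeConfig 4 1 (Matrix.specialUnitaryGroup (Fin (2 + n)) ℂ) => (((((U (((((0 : Site 4 1), (2 : Fin 4)) : Edge 4 1)))) * (U (((((0 : Site 4 1), (3 : Fin 4)) : Edge 4 1)))) * (U (((((0 : Site 4 1), (2 : Fin 4)) : Edge 4 1))))⁻¹ * (U (((((0 : Site 4 1), (3 : Fin 4)) : Edge 4 1))))⁻¹ : (Matrix.specialUnitaryGroup (Fin (2 + n)) ℂ)) : Matrix (Fin (2 + n)) (Fin (2 + n)) ℂ).trace.re : ℝ))) (Measure.pi (fun _ : Edge 4 1 => haarProbability (Matrix.specialUnitaryGroup (Fin (2 + n)) ℂ))) := integrable_links (hcR _ _)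
  have iPQ : Integrable (fun U : GaugeConfig 4 1 (Matrix.specialUnitaryGroup (Fin (2 + n)) ℂ) => (((((U (((((0 : Site 4 1), (0 : Fin 4)) : Edge 4 1)))) * (U (((((0 : Site 4 1), (1 : Fin 4)) : Edge 4 1)))) * (U (((((0 : Site 4 1), (0 : Fin 4)) : Edge 4 1))))⁻¹ * (U (((((0 : Site 4 1), (1 : Fin 4)) : Edge 4 1))))⁻¹ : (Matrix.specialUnitaryGroup (Fin (2 + n)) ℂ)) : Matrix (Fin (2 + n)) (Fin (2 + n)) ℂ).trace.re : ℝ)) * (((((U (((((0 : Site 4 1), (2 : Fin 4)) : Edge 4 1)))) * (U (((((0 : Site 4 1), (3 : Fin 4)) : Edge 4 1)))) * (U (((((0 : Site 4 1), (2 : Fin 4)) : Edge 4 1))))⁻¹ * (U (((((0 : Site 4 1), (3 : Fin 4)) : Edge 4 1))))⁻¹ : (Matrix.specialUnitaryGroup (Fin (2 + n)) ℂ)) : Matrix (Fin (2 + n)) (Fin (2 + n)) ℂ).trace.re : ℝ))) (Measure.pi (fun _ : Edge 4 1 => haarProbability (Matrix.specialUnitaryGroup (Fin (2 + n)) ℂ)))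 :=
    integrable_links ((hcR _ _).mul (hcR _ _))
  have iPQG : ∀ p : Plaquette 4 1, Integrable (fun U : GaugeConfig 4 1 (Matrix.specialUnitaryGroup (Fin (2 + n)) ℂ) =>
      (((((U (((((0 : Site 4 1), (0 : Fin 4)) : Edge 4 1)))) * (U (((((0 : Site 4 1), (1 : Fin 4)) : Edge 4 1)))) * (U (((((0 : Site 4 1), (0 : Fin 4)) : Edge 4 1))))⁻¹ * (U (((((0 : Site 4 1), (1 : Fin 4)) : Edge 4 1))))⁻¹ : (Matrix.specialUnitaryGroup (Fin (2 + n)) ℂ)) : Matrix (Fin (2 + n)) (Fin (2 + n)) ℂ).trace.re : ℝ)) * (((((U (((((0 : Site 4 1), (2 : Fin 4)) : Edge 4 1)))) * (U (((((0 : Site 4 1), (3 : Fin 4)) : Edge 4 1)))) * (U (((((0 : Site 4 1), (2 : Fin 4)) : Edge 4 1))))⁻¹ * (U (((((0 : Site 4 1), (3 : Fin 4)) : Edge 4 1))))⁻¹ : (Matrix.specialUnitaryGroup (Fin (2 + n)) ℂ)) : Matrix (Fin (2 + n)) (Fin (2 + n)) ℂ).trace.re : ℝ)) * (((((U (p.1,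 p.2.1.1)) * (U (p.1, p.2.1.2)) * (U (p.1, p.2.1.1))⁻¹ * (U (p.1, p.2.1.2))⁻¹ : (Matrix.specialUnitaryGroup (Fin (2 + n)) ℂ)) : Matrix (Fin (2 + n)) (Fin (2 + n)) ℂ).trace.re : ℝ))) (Measure.pi (fun _ : Edge 4 1 => haarProbability (Matrix.specialUnitaryGroup (Fin (2 + n)) ℂ))) :=
    fun p => integrable_links (((hcR _ _).mul (hcR _ _)).mul (hcR _ _))
  have iPG : ∀ p : Plaquette 4 1, Integrable (fun U : GaugeConfig 4 1 (Matrix.specialUnitaryGroup (Fin (2 + n)) ℂ) =>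
      (((((U (((((0 : Site 4 1), (0 : Fin 4)) : Edge 4 1)))) * (U (((((0 : Site 4 1), (1 : Fin 4)) : Edge 4 1)))) * (U (((((0 : Site 4 1), (0 : Fin 4)) : Edge 4 1))))⁻¹ * (U (((((0 : Site 4 1), (1 : Fin 4)) : Edge 4 1))))⁻¹ : (Matrix.specialUnitaryGroup (Fin (2 + n)) ℂ)) : Matrix (Fin (2 + n)) (Fin (2 + n)) ℂ).trace.re : ℝ)) * (((((U (p.1, p.2.1.1)) * (U (p.1, p.2.1.2)) * (U (p.1, p.2.1.1))⁻¹ * (U (p.1, p.2.1.2))⁻¹ : (Matrix.specialUnitaryGroup (Fin (2 + n)) ℂ)) : Matrix (Fin (2 + n)) (Fin (2 + n)) ℂ).trace.re : ℝ))) (Measure.pi (fun _ : Edge 4 1 => haarProbability (Matrix.specialUnitaryGroup (Fin (2 + n)) ℂ))) :=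
    fun p => integrable_links ((hcR _ _).mul (hcR _ _))
  have iQG : ∀ p : Plaquette 4 1, Integrable (fun U : GaugeConfig 4 1 (Matrix.specialUnitaryGroup (Fin (2 + n)) ℂ) =>
      (((((U (((((0 : Site 4 1), (2 : Fin 4)) : Edge 4 1)))) * (U (((((0 : Site 4 1), (3 : Fin 4)) : Edge 4 1)))) * (U (((((0 : Site 4 1), (2 : Fin 4)) : Edge 4 1))))⁻¹ * (U (((((0 : Site 4 1), (3 : Fin 4)) : Edge 4 1))))⁻¹ : (Matrix.specialUnitaryGroup (Fin (2 + n)) ℂ)) : Matrix (Fin (2 + n)) (Fin (2 + n)) ℂ).trace.re : ℝ)) * (((((U (p.1, p.2.1.1)) * (U (p.1, p.2.1.2)) * (U (p.1, p.2.1.1))⁻¹ * (U (p.1, p.2.1.2))⁻¹ : (Matrix.specialUnitaryGroup (Fin (2 + n)) ℂ)) : Matrix (Fin (2 + n)) (Fin (2 + n)) ℂ).trace.re : ℝ))) (Measure.pi (fun _ : Edge 4 1 => haarProbability (Matrix.specialUnitaryGroup (Fin (2 + n)) ℂ))) :=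
    fun p => integrable_links ((hcR _ _).mul (hcR _ _))
  rw [cov_neg_sum_const_sub _ _ _ iPQ iG iPQG, cov_neg_sum_const_sub _ _ _ iP iG iPG, cov_neg_sum_const_sub _ _ _ iQ iG iQG]
  rw [Finset.sum_mul, Finset.mul_sum, ← Finset.sum_add_distrib, ← Finset.sum_sub_distrib]
  rw [sum_plaquette_oneSite]
  dsimp only
  -- reader facts
  have hAR : ∀ x : (Matrix.specialUnitaryGroup (Fin (2 + n)) ℂ), ∫ x', (fun X Y : (Matrix.specialUnitaryGroup (Fin (2 + n)) ℂ) => ((((X * Y * X⁻¹ * Y⁻¹ : (Matrix.specialUnitaryGroup (Fin (2 + n)) ℂ)) : Matrix (Fin (2 + n)) (Fin (2 + n)) ℂ).trace.re : ℝ))) x x' ∂(haarProbability (Matrix.specialUnitaryGroup (Fin (2 + n)) ℂ)) = ((Complex.normSq (Matrix.trace ((x : (Matrix.specialUnitaryGroup (Fin (2 + n)) ℂ)) : Matrix (Fin (2 + n)) (Fin (2 + n)) ℂ)) : ℝ)) / (2 + n : ℝ) := fun x => integral_R_right x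
  have hAT : ∀ x : (Matrix.specialUnitaryGroup (Fin (2 + n)) ℂ), ∫ x', (fun X Y : (Matrix.specialUnitaryGroup (Fin (2 + n)) ℂ) => ((((Y * X * Y⁻¹ * X⁻¹ : (Matrix.specialUnitaryGroup (Fin (2 + n)) ℂ)) : Matrix (Fin (2 + n)) (Fin (2 + n)) ℂ).trace.re : ℝ))) x x' ∂(haarProbability (Matrix.specialUnitaryGroup (Fin (2 + n)) ℂ)) = ((Complex.normSq (Matrix.trace ((x : (Matrix.specialUnitaryGroup (Fin (2 + n)) ℂ)) : Matrix (Fin (2 + n)) (Fin (2 + n)) ℂ)) : ℝ)) / (2 + n : ℝ) := fun x => integral_R_left x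
  have hcA := continuous_uncurry_R (n := n)
  have hcT := continuous_uncurry_Rt (n := n)
  have h01 : (((((0 : Site 4 1), (0 : Fin 4)) : Edge 4 1))) ≠ (((((0 : Site 4 1), (1 : Fin 4)) : Edge 4 1))) := edge_ne (by decide)
  have h02 : (((((0 : Site 4 1), (0 : Fin 4)) : Edge 4 1))) ≠ (((((0 : Site 4 1), (2 : Fin 4)) : Edge 4 1))) := edge_ne (by decide)
  have h03 : (((((0 : Site 4 1), (0 : Fin 4)) : Edge 4 1))) ≠ (((((0 : Site 4 1), (3 : Fin 4)) : Edge 4 1))) := edge_ne (by decide)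
  have h12 : (((((0 : Site 4 1), (1 : Fin 4)) : Edge 4 1))) ≠ (((((0 : Site 4 1), (2 : Fin 4)) : Edge 4 1))) := edge_ne (by decide)
  have h13 : (((((0 : Site 4 1), (1 : Fin 4)) : Edge 4 1))) ≠ (((((0 : Site 4 1), (3 : Fin 4)) : Edge 4 1))) := edge_ne (by decide)
  have h23 : (((((0 : Site 4 1), (2 : Fin 4)) : Edge 4 1))) ≠ (((((0 : Site 4 1), (3 : Fin 4)) : Edge 4 1))) := edge_ne (by decide)
  -- the shared expectations
  have eP : ∫ U, (((((U (((((0 : Site 4 1), (0 : Fin 4)) : Edge 4 1)))) * (U (((((0 : Site 4 1), (1 : Fin 4)) : Edge 4 1)))) * (U (((((0 : Site 4 1), (0 : Fin 4)) : Edge 4 1))))⁻¹ * (U (((((0 : Site 4 1), (1 : Fin 4)) : Edge 4 1))))⁻¹ : (Matrix.specialUnitaryGroup (Fin (2 + n)) ℂ)) : Matrix (Fin (2 + n)) (Fin (2 + n)) ℂ).trace.re : ℝ)) ∂(Measure.pi (fun _ : Edge 4 1 => haarProbability (Matrix.specialUnitaryGroup (Fin (2 + n)) ℂ))) = 1 /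 (2 + n : ℝ) := by
    have h := integral_link_P (ι := Edge 4 1) hcA hAR h01; simpa only using h
  have eQ : ∫ U, (((((U (((((0 : Site 4 1), (2 : Fin 4)) : Edge 4 1)))) * (U (((((0 : Site 4 1), (3 : Fin 4)) : Edge 4 1)))) * (U (((((0 : Site 4 1), (2 : Fin 4)) : Edge 4 1))))⁻¹ * (U (((((0 : Site 4 1), (3 : Fin 4)) : Edge 4 1))))⁻¹ : (Matrix.specialUnitaryGroup (Fin (2 + n)) ℂ)) : Matrix (Fin (2 + n)) (Fin (2 + n)) ℂ).trace.re : ℝ)) ∂(Measure.pi (fun _ : Edge 4 1 => haarProbability (Matrix.specialUnitaryGroup (Fin (2 + n)) ℂ))) = 1 / (2 + n : ℝ) := by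
    have h := integral_link_P (ι := Edge 4 1) hcA hAR h23; simpa only using h
  have ePQ : ∫ U, (((((U (((((0 : Site 4 1), (0 : Fin 4)) : Edge 4 1)))) * (U (((((0 : Site 4 1), (1 : Fin 4)) : Edge 4 1)))) * (U (((((0 : Site 4 1), (0 : Fin 4)) : Edge 4 1))))⁻¹ * (U (((((0 : Site 4 1), (1 : Fin 4)) : Edge 4 1))))⁻¹ : (Matrix.specialUnitaryGroup (Fin (2 + n)) ℂ)) : Matrix (Fin (2 + n)) (Fin (2 + n)) ℂ).trace.re : ℝ)) * (((((U (((((0 : Site 4 1), (2 : Fin 4)) : Edge 4 1)))) * (U (((((0 : Site 4 1), (3 : Fin 4)) : Edge 4 1)))) * (U (((((0 : Site 4 1), (2 : Fin 4)) : Edge 4 1))))⁻¹ * (U (((((0 : Site 4 1), (3 : Fin 4)) : Edge 4 1))))⁻¹ : (Matrix.specialUnitaryGroup (Fin (2 + n)) ℂ)) : Matrix (Fin (2 + n)) (Fin (2 + n)) ℂ).trace.re : ℝ)) ∂(Measure.pi (fun _ : Edge 4 1 => haarProbability (Matrix.specialUnitaryGroup (Fin (2 + n)) ℂ))) = (1 /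 (2 + n : ℝ)) ^ 2 := by
    have h := integral_link_PQ (ι := Edge 4 1) hcA hcA hAR hAR h01 h23 h02 h03 h12 h13; simpa only using h
  have eQP : ∫ U, (((((U (((((0 : Site 4 1), (2 : Fin 4)) : Edge 4 1)))) * (U (((((0 : Site 4 1), (3 : Fin 4)) : Edge 4 1)))) * (U (((((0 : Site 4 1), (2 : Fin 4)) : Edge 4 1))))⁻¹ * (U (((((0 : Site 4 1), (3 : Fin 4)) : Edge 4 1))))⁻¹ : (Matrix.specialUnitaryGroup (Fin (2 + n)) ℂ)) : Matrix (Fin (2 + n)) (Fin (2 + n)) ℂ).trace.re : ℝ)) * (((((U (((((0 : Site 4 1), (0 : Fin 4)) : Edge 4 1)))) * (U (((((0 : Site 4 1), (1 : Fin 4)) : Edge 4 1)))) * (U (((((0 : Site 4 1), (0 : Fin 4)) : Edge 4 1))))⁻¹ * (U (((((0 : Site 4 1), (1 : Fin 4)) : Edge 4 1))))⁻¹ : (Matrix.specialUnitaryGroup (Fin (2 + n)) ℂ)) : Matrix (Fin (2 + n)) (Fin (2 + n)) ℂ).trace.re : ℝ)) ∂(Measure.pi (fun _ : Edge 4 1 =>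 haarProbability (Matrix.specialUnitaryGroup (Fin (2 + n)) ℂ))) = (1 / (2 + n : ℝ)) ^ 2 := by
    rw [← ePQ]; exact integral_congr_ae (ae_of_all _ fun U => mul_comm _ _)
  -- plane (0,1)
  have a1 : ∫ U, (((((U (((((0 : Site 4 1), (0 : Fin 4)) : Edge 4 1)))) * (U (((((0 : Site 4 1), (1 : Fin 4)) : Edge 4 1)))) * (U (((((0 : Site 4 1), (0 : Fin 4)) : Edge 4 1))))⁻¹ * (U (((((0 : Site 4 1), (1 : Fin 4)) : Edge 4 1))))⁻¹ : (Matrix.specialUnitaryGroup (Fin (2 + n)) ℂ)) : Matrix (Fin (2 + n)) (Fin (2 + n)) ℂ).trace.re : ℝ)) * (((((U (((((0 : Site 4 1), (2 : Fin 4)) : Edge 4 1)))) * (U (((((0 : Site 4 1), (3 : Fin 4)) : Edge 4 1)))) * (U (((((0 : Site 4 1), (2 : Fin 4)) : Edge 4 1))))⁻¹ * (U (((((0 : Site 4 1), (3 : Fin 4)) : Edge 4 1))))⁻¹ : (Matrix.specialUnitaryGroup (Fin (2 + n)) ℂ)) : Matrix (Fin (2 + n)) (Fin (2 + n)) ℂ).trace.re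 : ℝ)) * (((((U (((((0 : Site 4 1), (0 : Fin 4)) : Edge 4 1)))) * (U (((((0 : Site 4 1), (1 : Fin 4)) : Edge 4 1)))) * (U (((((0 : Site 4 1), (0 : Fin 4)) : Edge 4 1))))⁻¹ * (U (((((0 : Site 4 1), (1 : Fin 4)) : Edge 4 1))))⁻¹ : (Matrix.specialUnitaryGroup (Fin (2 + n)) ℂ)) : Matrix (Fin (2 + n)) (Fin (2 + n)) ℂ).trace.re : ℝ)) ∂(Measure.pi (fun _ : Edge 4 1 => haarProbability (Matrix.specialUnitaryGroup (Fin (2 + n)) ℂ))) =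
      (1 / (2 + n : ℝ)) * ∫ x, ∫ x', ((((x * x' * x⁻¹ * x'⁻¹ : (Matrix.specialUnitaryGroup (Fin (2 + n)) ℂ)) : Matrix (Fin (2 + n)) (Fin (2 + n)) ℂ).trace.re : ℝ)) * ((((x * x' * x⁻¹ * x'⁻¹ : (Matrix.specialUnitaryGroup (Fin (2 + n)) ℂ)) : Matrix (Fin (2 + n)) (Fin (2 + n)) ℂ).trace.re : ℝ)) ∂(haarProbability (Matrix.specialUnitaryGroup (Fin (2 + n)) ℂ)) ∂(haarProbability (Matrix.specialUnitaryGroup (Fin (2 + n)) ℂ)) := by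
    have h := integral_link_PQP (ι := Edge 4 1) hcA hcA hAR h01 h23 h02 h03 h12 h13; simpa only using h
  have a2 : ∫ U, (((((U (((((0 : Site 4 1), (0 : Fin 4)) : Edge 4 1)))) * (U (((((0 : Site 4 1), (1 : Fin 4)) : Edge 4 1)))) * (U (((((0 : Site 4 1), (0 : Fin 4)) : Edge 4 1))))⁻¹ * (U (((((0 : Site 4 1), (1 : Fin 4)) : Edge 4 1))))⁻¹ : (Matrix.specialUnitaryGroup (Fin (2 + n)) ℂ)) : Matrix (Fin (2 + n)) (Fin (2 + n)) ℂ).trace.re : ℝ)) * (((((U (((((0 : Site 4 1), (0 : Fin 4)) : Edge 4 1)))) * (U (((((0 : Site 4 1), (1 : Fin 4)) : Edge 4 1)))) * (U (((((0 : Site 4 1), (0 : Fin 4)) : Edge 4 1))))⁻¹ * (U (((((0 : Site 4 1), (1 : Fin 4)) : Edge 4 1))))⁻¹ : (Matrix.specialUnitaryGroup (Fin (2 + n)) ℂ)) : Matrix (Fin (2 + n)) (Fin (2 + n)) ℂ).trace.re : ℝ)) ∂(Measure.pi (fun _ : Edge 4 1 => haarProbability (Matrix.specialUnitaryGroup (Fin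 (2 + n)) ℂ))) = ∫ x, ∫ x', ((((x * x' * x⁻¹ * x'⁻¹ : (Matrix.specialUnitaryGroup (Fin (2 + n)) ℂ)) : Matrix (Fin (2 + n)) (Fin (2 + n)) ℂ).trace.re : ℝ)) * ((((x * x' * x⁻¹ * x'⁻¹ : (Matrix.specialUnitaryGroup (Fin (2 + n)) ℂ)) : Matrix (Fin (2 + n)) (Fin (2 + n)) ℂ).trace.re : ℝ)) ∂(haarProbability (Matrix.specialUnitaryGroup (Fin (2 + n)) ℂ)) ∂(haarProbability (Matrix.specialUnitaryGroup (Fin (2 + n)) ℂ)) := by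
    have h := integral_link_PP (ι := Edge 4 1) hcA h01; simpa only using h
  -- plane (2,3)
  have b1 : ∫ U, (((((U (((((0 : Site 4 1), (0 : Fin 4)) : Edge 4 1)))) * (U (((((0 : Site 4 1), (1 : Fin 4)) : Edge 4 1)))) * (U (((((0 : Site 4 1), (0 : Fin 4)) : Edge 4 1))))⁻¹ * (U (((((0 : Site 4 1), (1 : Fin 4)) : Edge 4 1))))⁻¹ : (Matrix.specialUnitaryGroup (Fin (2 + n)) ℂ)) : Matrix (Fin (2 + n)) (Fin (2 + n)) ℂ).trace.re : ℝ)) * (((((U (((((0 : Site 4 1), (2 : Fin 4)) : Edge 4 1)))) * (U (((((0 : Site 4 1), (3 : Fin 4)) : Edge 4 1)))) * (U (((((0 : Site 4 1), (2 : Fin 4)) : Edge 4 1))))⁻¹ * (U (((((0 : Site 4 1), (3 : Fin 4)) : Edge 4 1))))⁻¹ : (Matrix.specialUnitaryGroup (Fin (2 + n)) ℂ)) : Matrix (Fin (2 + n)) (Fin (2 + n)) ℂ).trace.re : ℝ)) * (((((U (((((0 : Site 4 1), (2 : Fin 4)) : Edge 4 1)))) * (U (((((0 : Site 4 1), (3 :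 Fin 4)) : Edge 4 1)))) * (U (((((0 : Site 4 1), (2 : Fin 4)) : Edge 4 1))))⁻¹ * (U (((((0 : Site 4 1), (3 : Fin 4)) : Edge 4 1))))⁻¹ : (Matrix.specialUnitaryGroup (Fin (2 + n)) ℂ)) : Matrix (Fin (2 + n)) (Fin (2 + n)) ℂ).trace.re : ℝ)) ∂(Measure.pi (fun _ : Edge 4 1 => haarProbability (Matrix.specialUnitaryGroup (Fin (2 + n)) ℂ))) =
      (1 / (2 + n : ℝ)) * ∫ y, ∫ y', ((((y * y' * y⁻¹ * y'⁻¹ : (Matrix.specialUnitaryGroup (Fin (2 + n)) ℂ)) : Matrix (Fin (2 + n)) (Fin (2 + n)) ℂ).trace.re : ℝ)) * ((((y * y' * y⁻¹ * y'⁻¹ : (Matrix.specialUnitaryGroup (Fin (2 + n)) ℂ)) : Matrix (Fin (2 + n)) (Fin (2 + n)) ℂ).trace.re : ℝ)) ∂(haarProbability (Matrix.specialUnitaryGroup (Fin (2 + n)) ℂ)) ∂(haarProbability (Matrix.specialUnitaryGroup (Fin (2 + n)) ℂ)) := by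
    have h := integral_link_PQQ (ι := Edge 4 1) hcA hcA hAR h01 h23 h02 h03 h12 h13; simpa only using h
  have b2 : ∫ U, (((((U (((((0 : Site 4 1), (2 : Fin 4)) : Edge 4 1)))) * (U (((((0 : Site 4 1), (3 : Fin 4)) : Edge 4 1)))) * (U (((((0 : Site 4 1), (2 : Fin 4)) : Edge 4 1))))⁻¹ * (U (((((0 : Site 4 1), (3 : Fin 4)) : Edge 4 1))))⁻¹ : (Matrix.specialUnitaryGroup (Fin (2 + n)) ℂ)) : Matrix (Fin (2 + n)) (Fin (2 + n)) ℂ).trace.re : ℝ)) * (((((U (((((0 : Site 4 1), (2 : Fin 4)) : Edge 4 1)))) * (U (((((0 : Site 4 1), (3 : Fin 4)) : Edge 4 1)))) * (U (((((0 : Site 4 1), (2 : Fin 4)) : Edge 4 1))))⁻¹ * (U (((((0 : Site 4 1), (3 : Fin 4)) : Edge 4 1))))⁻¹ : (Matrix.specialUnitaryGroup (Fin (2 + n)) ℂ)) : Matrix (Fin (2 + n)) (Fin (2 + n)) ℂ).trace.re : ℝ)) ∂(Measure.pi (fun _ : Edge 4 1 => haarProbability (Matrix.specialUnitaryGroup (Fin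 (2 + n)) ℂ))) = ∫ y, ∫ y', ((((y * y' * y⁻¹ * y'⁻¹ : (Matrix.specialUnitaryGroup (Fin (2 + n)) ℂ)) : Matrix (Fin (2 + n)) (Fin (2 + n)) ℂ).trace.re : ℝ)) * ((((y * y' * y⁻¹ * y'⁻¹ : (Matrix.specialUnitaryGroup (Fin (2 + n)) ℂ)) : Matrix (Fin (2 + n)) (Fin (2 + n)) ℂ).trace.re : ℝ)) ∂(haarProbability (Matrix.specialUnitaryGroup (Fin (2 + n)) ℂ)) ∂(haarProbability (Matrix.specialUnitaryGroup (Fin (2 + n)) ℂ)) := by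
    have h := integral_link_PP (ι := Edge 4 1) hcA h23; simpa only using h
  -- plane (0,2): links (a,b,c,d) = (0,1,2,3), readers (R, R)
  have c1 : ∫ U, (((((U (((((0 : Site 4 1), (0 : Fin 4)) : Edge 4 1)))) * (U (((((0 : Site 4 1), (1 : Fin 4)) : Edge 4 1)))) * (U (((((0 : Site 4 1), (0 : Fin 4)) : Edge 4 1))))⁻¹ * (U (((((0 : Site 4 1), (1 : Fin 4)) : Edge 4 1))))⁻¹ : (Matrix.specialUnitaryGroup (Fin (2 + n)) ℂ)) : Matrix (Fin (2 + n)) (Fin (2 + n)) ℂ).trace.re : ℝ)) * (((((U (((((0 : Site 4 1), (2 : Fin 4)) : Edge 4 1)))) * (U (((((0 : Site 4 1), (3 : Fin 4)) : Edge 4 1)))) * (U (((((0 : Site 4 1), (2 : Fin 4)) : Edge 4 1))))⁻¹ * (U (((((0 : Site 4 1), (3 : Fin 4)) : Edge 4 1))))⁻¹ : (Matrix.specialUnitaryGroup (Fin (2 + n)) ℂ)) : Matrix (Fin (2 + n)) (Fin (2 + n)) ℂ).trace.re : ℝ)) * (((((U (((((0 : Site 4 1), (0 : Fin 4)) : Edge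 4 1)))) * (U (((((0 : Site 4 1), (2 : Fin 4)) : Edge 4 1)))) * (U (((((0 : Site 4 1), (0 : Fin 4)) : Edge 4 1))))⁻¹ * (U (((((0 : Site 4 1), (2 : Fin 4)) : Edge 4 1))))⁻¹ : (Matrix.specialUnitaryGroup (Fin (2 + n)) ℂ)) : Matrix (Fin (2 + n)) (Fin (2 + n)) ℂ).trace.re : ℝ)) ∂(Measure.pi (fun _ : Edge 4 1 => haarProbability (Matrix.specialUnitaryGroup (Fin (2 + n)) ℂ))) =
      (1 / (2 + n : ℝ)) ^ 2 * ∫ x, ∫ y, ((Complex.normSq (Matrix.trace ((x : (Matrix.specialUnitaryGroup (Fin (2 + n)) ℂ)) : Matrix (Fin (2 + n)) (Fin (2 + n)) ℂ)) : ℝ)) * ((Complex.normSq (Matrix.trace ((y : (Matrix.specialUnitaryGroup (Fin (2 + n)) ℂ)) : Matrix (Fin (2 + n)) (Fin (2 + n)) ℂ)) : ℝ)) * ((((x * y * x⁻¹ * y⁻¹ : (Matrix.specialUnitaryGroup (Fin (2 + n)) ℂ)) : Matrix (Fin (2 + n)) (Fin (2 + n)) ℂ).trace.re : ℝ)) ∂(haarProbability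 (Matrix.specialUnitaryGroup (Fin (2 + n)) ℂ)) ∂(haarProbability (Matrix.specialUnitaryGroup (Fin (2 + n)) ℂ)) := by
    have h := integral_link_PQR (ι := Edge 4 1) hcA hcA hAR hAR h01 h23 h02 h03 h12 h13; simpa only using h
  have c2 : ∫ U, (((((U (((((0 : Site 4 1), (0 : Fin 4)) : Edge 4 1)))) * (U (((((0 : Site 4 1), (1 : Fin 4)) : Edge 4 1)))) * (U (((((0 : Site 4 1), (0 : Fin 4)) : Edge 4 1))))⁻¹ * (U (((((0 : Site 4 1), (1 : Fin 4)) : Edge 4 1))))⁻¹ : (Matrix.specialUnitaryGroup (Fin (2 + n)) ℂ)) : Matrix (Fin (2 + n)) (Fin (2 + n)) ℂ).trace.re : ℝ)) * (((((U (((((0 : Site 4 1), (0 : Fin 4)) : Edge 4 1)))) * (U (((((0 : Site 4 1), (2 : Fin 4)) : Edge 4 1)))) * (U (((((0 : Site 4 1), (0 : Fin 4)) : Edge 4 1))))⁻¹ * (U (((((0 : Site 4 1), (2 : Fin 4)) : Edge 4 1))))⁻¹ : (Matrix.specialUnitaryGroup (Fin (2 + n)) ℂ)) : Matrix (Fin (2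 + n)) (Fin (2 + n)) ℂ).trace.re : ℝ)) ∂(Measure.pi (fun _ : Edge 4 1 => haarProbability (Matrix.specialUnitaryGroup (Fin (2 + n)) ℂ))) = (1 / (2 + n : ℝ)) * ∫ x, ∫ y, ((Complex.normSq (Matrix.trace ((x : (Matrix.specialUnitaryGroup (Fin (2 + n)) ℂ)) : Matrix (Fin (2 + n)) (Fin (2 + n)) ℂ)) : ℝ)) * ((((x * y * x⁻¹ * y⁻¹ : (Matrix.specialUnitaryGroup (Fin (2 + n)) ℂ)) : Matrix (Fin (2 + n)) (Fin (2 + n)) ℂ).trace.re : ℝ)) ∂(haarProbability (Matrix.specialUnitaryGroup (Fin (2 + n)) ℂ)) ∂(haarProbability (Matrix.specialUnitaryGroup (Fin (2 + n)) ℂ)) := by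
    have h := integral_link_PR (ι := Edge 4 1) hcA hAR h01 h23 h02 h03 h12 h13; simpa only using h
  have c3 : ∫ U, (((((U (((((0 : Site 4 1), (2 : Fin 4)) : Edge 4 1)))) * (U (((((0 : Site 4 1), (3 : Fin 4)) : Edge 4 1)))) * (U (((((0 : Site 4 1), (2 : Fin 4)) : Edge 4 1))))⁻¹ * (U (((((0 : Site 4 1), (3 : Fin 4)) : Edge 4 1))))⁻¹ : (Matrix.specialUnitaryGroup (Fin (2 + n)) ℂ)) : Matrix (Fin (2 + n)) (Fin (2 + n)) ℂ).trace.re : ℝ)) * (((((U (((((0 : Site 4 1), (0 : Fin 4)) : Edge 4 1)))) * (U (((((0 : Site 4 1), (2 : Fin 4)) : Edge 4 1)))) * (U (((((0 : Site 4 1), (0 : Fin 4)) : Edge 4 1))))⁻¹ * (U (((((0 : Site 4 1), (2 : Fin 4)) : Edge 4 1))))⁻¹ : (Matrix.specialUnitaryGroup (Fin (2 + n)) ℂ)) : Matrix (Fin (2 + n)) (Fin (2 + n)) ℂ).trace.re : ℝ)) ∂(Measure.pi (fun _ : Edge 4 1 => haarProbability (Matrix.specialUnitaryGroup (Fin (2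 + n)) ℂ))) = (1 / (2 + n : ℝ)) * ∫ x, ∫ y, ((Complex.normSq (Matrix.trace ((y : (Matrix.specialUnitaryGroup (Fin (2 + n)) ℂ)) : Matrix (Fin (2 + n)) (Fin (2 + n)) ℂ)) : ℝ)) * ((((x * y * x⁻¹ * y⁻¹ : (Matrix.specialUnitaryGroup (Fin (2 + n)) ℂ)) : Matrix (Fin (2 + n)) (Fin (2 + n)) ℂ).trace.re : ℝ)) ∂(haarProbability (Matrix.specialUnitaryGroup (Fin (2 + n)) ℂ)) ∂(haarProbability (Matrix.specialUnitaryGroup (Fin (2 + n)) ℂ)) := by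
    have h := integral_link_QR (ι := Edge 4 1) hcA hAR h01 h23 h02 h03 h12 h13; simpa only using h
  have c4 : ∫ U, (((((U (((((0 : Site 4 1), (0 : Fin 4)) : Edge 4 1)))) * (U (((((0 : Site 4 1), (2 : Fin 4)) : Edge 4 1)))) * (U (((((0 : Site 4 1), (0 : Fin 4)) : Edge 4 1))))⁻¹ * (U (((((0 : Site 4 1), (2 : Fin 4)) : Edge 4 1))))⁻¹ : (Matrix.specialUnitaryGroup (Fin (2 + n)) ℂ)) : Matrix (Fin (2 + n)) (Fin (2 + n)) ℂ).trace.re : ℝ)) ∂(Measure.pi (fun _ : Edge 4 1 => haarProbability (Matrix.specialUnitaryGroup (Fin (2 + n)) ℂ))) = ∫ x, ∫ y, ((((x * y * x⁻¹ * y⁻¹ : (Matrix.specialUnitaryGroup (Fin (2 + n)) ℂ)) : Matrix (Fin (2 + n)) (Fin (2 + n)) ℂ).trace.re : ℝ)) ∂(haarProbability (Matrix.specialUnitaryGroup (Fin (2 + n)) ℂ)) ∂(haarProbability (Matrix.specialUnitaryGroup (Fin (2 + n)) ℂ)) := integral_link_R (ι := Edge 4 1) h02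
  -- plane (0,3): links (0,1,3,2), readers (R, Rᵀ)
  have d1 : ∫ U, (((((U (((((0 : Site 4 1), (0 : Fin 4)) : Edge 4 1)))) * (U (((((0 : Site 4 1), (1 : Fin 4)) : Edge 4 1)))) * (U (((((0 : Site 4 1), (0 : Fin 4)) : Edge 4 1))))⁻¹ * (U (((((0 : Site 4 1), (1 : Fin 4)) : Edge 4 1))))⁻¹ : (Matrix.specialUnitaryGroup (Fin (2 + n)) ℂ)) : Matrix (Fin (2 + n)) (Fin (2 + n)) ℂ).trace.re : ℝ)) * (((((U (((((0 : Site 4 1), (2 : Fin 4)) : Edge 4 1)))) * (U (((((0 : Site 4 1), (3 : Fin 4)) : Edge 4 1)))) * (U (((((0 : Site 4 1), (2 : Fin 4)) : Edge 4 1))))⁻¹ * (U (((((0 : Site 4 1), (3 : Fin 4)) : Edge 4 1))))⁻¹ : (Matrix.specialUnitaryGroup (Fin (2 + n)) ℂ)) : Matrix (Fin (2 + n)) (Fin (2 + n)) ℂ).trace.re : ℝ)) * (((((U (((((0 : Site 4 1), (0 : Fin 4)) : Edge 4 1)))) * (U (((((0 : Site 4 1), (3 : Fin 4)) : Edge 4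 1)))) * (U (((((0 : Site 4 1), (0 : Fin 4)) : Edge 4 1))))⁻¹ * (U (((((0 : Site 4 1), (3 : Fin 4)) : Edge 4 1))))⁻¹ : (Matrix.specialUnitaryGroup (Fin (2 + n)) ℂ)) : Matrix (Fin (2 + n)) (Fin (2 + n)) ℂ).trace.re : ℝ)) ∂(Measure.pi (fun _ : Edge 4 1 => haarProbability (Matrix.specialUnitaryGroup (Fin (2 + n)) ℂ))) =
      (1 / (2 + n : ℝ)) ^ 2 * ∫ x, ∫ y, ((Complex.normSq (Matrix.trace ((x : (Matrix.specialUnitaryGroup (Fin (2 + n)) ℂ)) : Matrix (Fin (2 + n)) (Fin (2 + n)) ℂ)) : ℝ)) * ((Complex.normSq (Matrix.trace ((y : (Matrix.specialUnitaryGroup (Fin (2 + n)) ℂ)) : Matrix (Fin (2 + n)) (Fin (2 + n)) ℂ)) : ℝ)) * ((((x * y * x⁻¹ * y⁻¹ : (Matrix.specialUnitaryGroup (Fin (2 + n)) ℂ)) : Matrix (Fin (2 + n)) (Fin (2 + n)) ℂ).trace.re : ℝ)) ∂(haarProbability (Matrix.specialUnitaryGroup (Fin (2 + n)) ℂ)) ∂(haarProbability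 (Matrix.specialUnitaryGroup (Fin (2 + n)) ℂ)) := by
    have h := integral_link_PQR (ι := Edge 4 1) hcA hcT hAR hAT h01 h23.symm h03 h02 h13 h12; simpa only using h
  have d2 : ∫ U, (((((U (((((0 : Site 4 1), (0 : Fin 4)) : Edge 4 1)))) * (U (((((0 : Site 4 1), (1 : Fin 4)) : Edge 4 1)))) * (U (((((0 : Site 4 1), (0 : Fin 4)) : Edge 4 1))))⁻¹ * (U (((((0 : Site 4 1), (1 : Fin 4)) : Edge 4 1))))⁻¹ : (Matrix.specialUnitaryGroup (Fin (2 + n)) ℂ)) : Matrix (Fin (2 + n)) (Fin (2 + n)) ℂ).trace.re : ℝ)) * (((((U (((((0 : Site 4 1), (0 : Fin 4)) : Edge 4 1)))) * (U (((((0 : Site 4 1), (3 : Fin 4)) : Edge 4 1)))) * (U (((((0 : Site 4 1), (0 : Fin 4)) : Edge 4 1))))⁻¹ * (U (((((0 : Site 4 1), (3 : Fin 4)) : Edge 4 1))))⁻¹ : (Matrix.specialUnitaryGroup (Fin (2 + n)) ℂ)) : Matrix (Fin (2 + n)) (Fin (2 + n)) ℂ).trace.re : ℝ)) ∂(Measure.pi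 (fun _ : Edge 4 1 => haarProbability (Matrix.specialUnitaryGroup (Fin (2 + n)) ℂ))) = (1 / (2 + n : ℝ)) * ∫ x, ∫ y, ((Complex.normSq (Matrix.trace ((x : (Matrix.specialUnitaryGroup (Fin (2 + n)) ℂ)) : Matrix (Fin (2 + n)) (Fin (2 + n)) ℂ)) : ℝ)) * ((((x * y * x⁻¹ * y⁻¹ : (Matrix.specialUnitaryGroup (Fin (2 + n)) ℂ)) : Matrix (Fin (2 + n)) (Fin (2 + n)) ℂ).trace.re : ℝ)) ∂(haarProbability (Matrix.specialUnitaryGroup (Fin (2 + n)) ℂ)) ∂(haarProbability (Matrix.specialUnitaryGroup (Fin (2 + n)) ℂ)) := by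
    have h := integral_link_PR (ι := Edge 4 1) hcA hAR h01 h23.symm h03 h02 h13 h12; simpa only using h
  have d3 : ∫ U, (((((U (((((0 : Site 4 1), (2 : Fin 4)) : Edge 4 1)))) * (U (((((0 : Site 4 1), (3 : Fin 4)) : Edge 4 1)))) * (U (((((0 : Site 4 1), (2 : Fin 4)) : Edge 4 1))))⁻¹ * (U (((((0 : Site 4 1), (3 : Fin 4)) : Edge 4 1))))⁻¹ : (Matrix.specialUnitaryGroup (Fin (2 + n)) ℂ)) : Matrix (Fin (2 + n)) (Fin (2 + n)) ℂ).trace.re : ℝ)) * (((((U (((((0 : Site 4 1), (0 : Fin 4)) : Edge 4 1)))) * (U (((((0 : Site 4 1), (3 : Fin 4)) : Edge 4 1)))) * (U (((((0 : Site 4 1), (0 : Fin 4)) : Edge 4 1))))⁻¹ * (U (((((0 : Site 4 1), (3 : Fin 4)) : Edge 4 1))))⁻¹ : (Matrix.specialUnitaryGroup (Fin (2 + n)) ℂ)) : Matrix (Fin (2 + n)) (Fin (2 + n)) ℂ).trace.re : ℝ)) ∂(Measure.pi (fun _ : Edge 4 1 => haarProbability (Matrix.specialUnitaryGroup (Fin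 (2 + n)) ℂ))) = (1 / (2 + n : ℝ)) * ∫ x, ∫ y, ((Complex.normSq (Matrix.trace ((y : (Matrix.specialUnitaryGroup (Fin (2 + n)) ℂ)) : Matrix (Fin (2 + n)) (Fin (2 + n)) ℂ)) : ℝ)) * ((((x * y * x⁻¹ * y⁻¹ : (Matrix.specialUnitaryGroup (Fin (2 + n)) ℂ)) : Matrix (Fin (2 + n)) (Fin (2 + n)) ℂ).trace.re : ℝ)) ∂(haarProbability (Matrix.specialUnitaryGroup (Fin (2 + n)) ℂ)) ∂(haarProbability (Matrix.specialUnitaryGroup (Fin (2 + n)) ℂ)) := by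
    have h := integral_link_QR (ι := Edge 4 1) (B := fun X Y : (Matrix.specialUnitaryGroup (Fin (2 + n)) ℂ) => ((((Y * X * Y⁻¹ * X⁻¹ : (Matrix.specialUnitaryGroup (Fin (2 + n)) ℂ)) : Matrix (Fin (2 + n)) (Fin (2 + n)) ℂ).trace.re : ℝ))) hcT hAT h01 h23.symm h03 h02 h13 h12
    simpa only using h
  have d4 : ∫ U, (((((U (((((0 : Site 4 1), (0 : Fin 4)) : Edge 4 1)))) * (U (((((0 : Site 4 1), (3 : Fin 4)) : Edge 4 1)))) * (U (((((0 : Site 4 1), (0 : Fin 4)) : Edge 4 1))))⁻¹ * (U (((((0 : Site 4 1), (3 : Fin 4)) : Edge 4 1))))⁻¹ : (Matrix.specialUnitaryGroup (Fin (2 + n)) ℂ)) : Matrix (Fin (2 + n)) (Fin (2 + n)) ℂ).trace.re : ℝ)) ∂(Measure.pi (fun _ : Edge 4 1 => haarProbability (Matrix.specialUnitaryGroup (Fin (2 + n)) ℂ))) = ∫ x, ∫ y, ((((x * y * x⁻¹ * y⁻¹ : (Matrix.specialUnitaryGroup (Fin (2 + n)) ℂ)) : Matrix (Fin (2 + n))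 (Fin (2 + n)) ℂ).trace.re : ℝ)) ∂(haarProbability (Matrix.specialUnitaryGroup (Fin (2 + n)) ℂ)) ∂(haarProbability (Matrix.specialUnitaryGroup (Fin (2 + n)) ℂ)) := integral_link_R (ι := Edge 4 1) h03
  -- plane (1,2): links (1,0,2,3), readers (Rᵀ, R)
  have f1 : ∫ U, (((((U (((((0 : Site 4 1), (0 : Fin 4)) : Edge 4 1)))) * (U (((((0 : Site 4 1), (1 : Fin 4)) : Edge 4 1)))) * (U (((((0 : Site 4 1), (0 : Fin 4)) : Edge 4 1))))⁻¹ * (U (((((0 : Site 4 1), (1 : Fin 4)) : Edge 4 1))))⁻¹ : (Matrix.specialUnitaryGroup (Fin (2 + n)) ℂ)) : Matrix (Fin (2 + n)) (Fin (2 + n)) ℂ).trace.re : ℝ)) * (((((U (((((0 : Site 4 1), (2 : Fin 4)) : Edge 4 1)))) * (U (((((0 : Site 4 1), (3 : Fin 4)) : Edge 4 1)))) * (U (((((0 : Site 4 1), (2 : Fin 4)) : Edge 4 1))))⁻¹ * (U (((((0 : Site 4 1), (3 : Fin 4)) : Edge 4 1))))⁻¹ : (Matrix.specialUnitaryGroup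 (Fin (2 + n)) ℂ)) : Matrix (Fin (2 + n)) (Fin (2 + n)) ℂ).trace.re : ℝ)) * (((((U (((((0 : Site 4 1), (1 : Fin 4)) : Edge 4 1)))) * (U (((((0 : Site 4 1), (2 : Fin 4)) : Edge 4 1)))) * (U (((((0 : Site 4 1), (1 : Fin 4)) : Edge 4 1))))⁻¹ * (U (((((0 : Site 4 1), (2 : Fin 4)) : Edge 4 1))))⁻¹ : (Matrix.specialUnitaryGroup (Fin (2 + n)) ℂ)) : Matrix (Fin (2 + n)) (Fin (2 + n)) ℂ).trace.re : ℝ)) ∂(Measure.pi (fun _ : Edge 4 1 => haarProbability (Matrix.specialUnitaryGroup (Fin (2 + n)) ℂ))) =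
      (1 / (2 + n : ℝ)) ^ 2 * ∫ x, ∫ y, ((Complex.normSq (Matrix.trace ((x : (Matrix.specialUnitaryGroup (Fin (2 + n)) ℂ)) : Matrix (Fin (2 + n)) (Fin (2 + n)) ℂ)) : ℝ)) * ((Complex.normSq (Matrix.trace ((y : (Matrix.specialUnitaryGroup (Fin (2 + n)) ℂ)) : Matrix (Fin (2 + n)) (Fin (2 + n)) ℂ)) : ℝ)) * ((((x * y * x⁻¹ * y⁻¹ : (Matrix.specialUnitaryGroup (Fin (2 + n)) ℂ)) : Matrix (Fin (2 + n)) (Fin (2 + n)) ℂ).trace.re : ℝ)) ∂(haarProbability (Matrix.specialUnitaryGroup (Fin (2 + n)) ℂ)) ∂(haarProbability (Matrix.specialUnitaryGroup (Fin (2 + n)) ℂ)) := by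
    have h := integral_link_PQR (ι := Edge 4 1) (A := fun X Y : (Matrix.specialUnitaryGroup (Fin (2 + n)) ℂ) => ((((Y * X * Y⁻¹ * X⁻¹ : (Matrix.specialUnitaryGroup (Fin (2 + n)) ℂ)) : Matrix (Fin (2 + n)) (Fin (2 + n)) ℂ).trace.re : ℝ))) hcT hcA hAT hAR h01.symm h23 h12 h13 h02
      h03
    simpa only using h
  have f2 : ∫ U, (((((U (((((0 : Site 4 1), (0 : Fin 4)) : Edge 4 1)))) * (U (((((0 : Site 4 1), (1 : Fin 4)) : Edge 4 1)))) * (U (((((0 : Site 4 1), (0 : Fin 4)) : Edge 4 1))))⁻¹ * (U (((((0 : Site 4 1), (1 : Fin 4)) : Edge 4 1))))⁻¹ : (Matrix.specialUnitaryGroup (Fin (2 + n)) ℂ)) : Matrix (Fin (2 + n)) (Fin (2 + n)) ℂ).trace.re : ℝ)) * (((((U (((((0 : Site 4 1), (1 : Fin 4)) : Edge 4 1)))) * (U (((((0 : Site 4 1), (2 : Fin 4)) : Edge 4 1)))) * (U (((((0 : Site 4 1), (1 : Fin 4)) : Edge 4 1))))⁻¹ * (U (((((0 : Site 4 1), (2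 : Fin 4)) : Edge 4 1))))⁻¹ : (Matrix.specialUnitaryGroup (Fin (2 + n)) ℂ)) : Matrix (Fin (2 + n)) (Fin (2 + n)) ℂ).trace.re : ℝ)) ∂(Measure.pi (fun _ : Edge 4 1 => haarProbability (Matrix.specialUnitaryGroup (Fin (2 + n)) ℂ))) = (1 / (2 + n : ℝ)) * ∫ x, ∫ y, ((Complex.normSq (Matrix.trace ((x : (Matrix.specialUnitaryGroup (Fin (2 + n)) ℂ)) : Matrix (Fin (2 + n)) (Fin (2 + n)) ℂ)) : ℝ)) * ((((x * y * x⁻¹ * y⁻¹ : (Matrix.specialUnitaryGroup (Fin (2 + n)) ℂ)) : Matrix (Fin (2 + n)) (Fin (2 + n)) ℂ).trace.re : ℝ)) ∂(haarProbability (Matrix.specialUnitaryGroup (Fin (2 + n)) ℂ)) ∂(haarProbability (Matrix.specialUnitaryGroup (Fin (2 + n)) ℂ)) := by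
    have h := integral_link_PR (ι := Edge 4 1) (A := fun X Y : (Matrix.specialUnitaryGroup (Fin (2 + n)) ℂ) => ((((Y * X * Y⁻¹ * X⁻¹ : (Matrix.specialUnitaryGroup (Fin (2 + n)) ℂ)) : Matrix (Fin (2 + n)) (Fin (2 + n)) ℂ).trace.re : ℝ))) hcT hAT h01.symm h23 h12 h13 h02 h03
    simpa only using h
  have f3 : ∫ U, (((((U (((((0 : Site 4 1), (2 : Fin 4)) : Edge 4 1)))) * (U (((((0 : Site 4 1), (3 : Fin 4)) : Edge 4 1)))) * (U (((((0 : Site 4 1), (2 : Fin 4)) : Edge 4 1))))⁻¹ * (U (((((0 : Site 4 1), (3 : Fin 4)) : Edge 4 1))))⁻¹ : (Matrix.specialUnitaryGroup (Fin (2 + n)) ℂ)) : Matrix (Fin (2 + n)) (Fin (2 + n)) ℂ).trace.re : ℝ)) * (((((U (((((0 : Site 4 1), (1 : Fin 4)) : Edge 4 1)))) * (U (((((0 : Site 4 1), (2 : Fin 4)) : Edge 4 1)))) * (U (((((0 : Site 4 1), (1 : Fin 4)) : Edge 4 1))))⁻¹ * (U (((((0 : Site 4 1), (2 : Fin 4))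 : Edge 4 1))))⁻¹ : (Matrix.specialUnitaryGroup (Fin (2 + n)) ℂ)) : Matrix (Fin (2 + n)) (Fin (2 + n)) ℂ).trace.re : ℝ)) ∂(Measure.pi (fun _ : Edge 4 1 => haarProbability (Matrix.specialUnitaryGroup (Fin (2 + n)) ℂ))) = (1 / (2 + n : ℝ)) * ∫ x, ∫ y, ((Complex.normSq (Matrix.trace ((y : (Matrix.specialUnitaryGroup (Fin (2 + n)) ℂ)) : Matrix (Fin (2 + n)) (Fin (2 + n)) ℂ)) : ℝ)) * ((((x * y * x⁻¹ * y⁻¹ : (Matrix.specialUnitaryGroup (Fin (2 + n)) ℂ)) : Matrix (Fin (2 + n)) (Fin (2 + n)) ℂ).trace.re : ℝ)) ∂(haarProbability (Matrix.specialUnitaryGroup (Fin (2 + n)) ℂ)) ∂(haarProbability (Matrix.specialUnitaryGroup (Fin (2 + n)) ℂ)) := by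
    have h := integral_link_QR (ι := Edge 4 1) hcA hAR h01.symm h23 h12 h13 h02 h03; simpa only using h
  have f4 : ∫ U, (((((U (((((0 : Site 4 1), (1 : Fin 4)) : Edge 4 1)))) * (U (((((0 : Site 4 1), (2 : Fin 4)) : Edge 4 1)))) * (U (((((0 : Site 4 1), (1 : Fin 4)) : Edge 4 1))))⁻¹ * (U (((((0 : Site 4 1), (2 : Fin 4)) : Edge 4 1))))⁻¹ : (Matrix.specialUnitaryGroup (Fin (2 + n)) ℂ)) : Matrix (Fin (2 + n)) (Fin (2 + n)) ℂ).trace.re : ℝ)) ∂(Measure.pi (fun _ : Edge 4 1 => haarProbability (Matrix.specialUnitaryGroup (Fin (2 + n)) ℂ))) = ∫ x, ∫ y, ((((x * y * x⁻¹ * y⁻¹ : (Matrix.specialUnitaryGroup (Fin (2 + n)) ℂ)) : Matrix (Fin (2 + n)) (Fin (2 + n)) ℂ).trace.re : ℝ)) ∂(haarProbability (Matrix.specialUnitaryGroup (Fin (2 + n)) ℂ)) ∂(haarProbability (Matrix.specialUnitaryGroup (Fin (2 + n)) ℂ)) := integral_link_R (ι := Edge 4 1) h12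
  -- plane (1,3): links (1,0,3,2), readers (Rᵀ, Rᵀ)
  have g1 : ∫ U, (((((U (((((0 : Site 4 1), (0 : Fin 4)) : Edge 4 1)))) * (U (((((0 : Site 4 1), (1 : Fin 4)) : Edge 4 1)))) * (U (((((0 : Site 4 1), (0 : Fin 4)) : Edge 4 1))))⁻¹ * (U (((((0 : Site 4 1), (1 : Fin 4)) : Edge 4 1))))⁻¹ : (Matrix.specialUnitaryGroup (Fin (2 + n)) ℂ)) : Matrix (Fin (2 + n)) (Fin (2 + n)) ℂ).trace.re : ℝ)) * (((((U (((((0 : Site 4 1), (2 : Fin 4)) : Edge 4 1)))) * (U (((((0 : Site 4 1), (3 : Fin 4)) : Edge 4 1)))) * (U (((((0 : Site 4 1), (2 : Fin 4)) : Edge 4 1))))⁻¹ * (U (((((0 : Site 4 1), (3 : Fin 4)) : Edge 4 1))))⁻¹ : (Matrix.specialUnitaryGroup (Fin (2 + n)) ℂ)) : Matrix (Fin (2 + n)) (Fin (2 + n)) ℂ).trace.re : ℝ)) * (((((U (((((0 : Site 4 1), (1 : Fin 4)) : Edge 4 1)))) * (U (((((0 : Site 4 1), (3 : Fin 4)) :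 Edge 4 1)))) * (U (((((0 : Site 4 1), (1 : Fin 4)) : Edge 4 1))))⁻¹ * (U (((((0 : Site 4 1), (3 : Fin 4)) : Edge 4 1))))⁻¹ : (Matrix.specialUnitaryGroup (Fin (2 + n)) ℂ)) : Matrix (Fin (2 + n)) (Fin (2 + n)) ℂ).trace.re : ℝ)) ∂(Measure.pi (fun _ : Edge 4 1 => haarProbability (Matrix.specialUnitaryGroup (Fin (2 + n)) ℂ))) =
      (1 / (2 + n : ℝ)) ^ 2 * ∫ x, ∫ y, ((Complex.normSq (Matrix.trace ((x : (Matrix.specialUnitaryGroup (Fin (2 + n)) ℂ)) : Matrix (Fin (2 + n)) (Fin (2 + n)) ℂ)) : ℝ)) * ((Complex.normSq (Matrix.trace ((y : (Matrix.specialUnitaryGroup (Fin (2 + n)) ℂ)) : Matrix (Fin (2 + n)) (Fin (2 + n)) ℂ)) : ℝ)) * ((((x * y * x⁻¹ * y⁻¹ : (Matrix.specialUnitaryGroup (Fin (2 + n)) ℂ)) : Matrix (Fin (2 + n)) (Fin (2 + n)) ℂ).trace.re : ℝ)) ∂(haarProbability (Matrix.specialUnitaryGroup (Fin (2 + n)) ℂ))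 ∂(haarProbability (Matrix.specialUnitaryGroup (Fin (2 + n)) ℂ)) := by
    have h := integral_link_PQR (ι := Edge 4 1) (A := fun X Y : (Matrix.specialUnitaryGroup (Fin (2 + n)) ℂ) => ((((Y * X * Y⁻¹ * X⁻¹ : (Matrix.specialUnitaryGroup (Fin (2 + n)) ℂ)) : Matrix (Fin (2 + n)) (Fin (2 + n)) ℂ).trace.re : ℝ))) (B := fun X Y : (Matrix.specialUnitaryGroup (Fin (2 + n)) ℂ) => ((((Y * X * Y⁻¹ * X⁻¹ : (Matrix.specialUnitaryGroup (Fin (2 + n)) ℂ)) : Matrix (Fin (2 + n)) (Fin (2 + n)) ℂ).trace.re : ℝ))) hcT hcT hAT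
      hAT h01.symm h23.symm h13 h12 h03 h02
    simpa only using h
  have g2 : ∫ U, (((((U (((((0 : Site 4 1), (0 : Fin 4)) : Edge 4 1)))) * (U (((((0 : Site 4 1), (1 : Fin 4)) : Edge 4 1)))) * (U (((((0 : Site 4 1), (0 : Fin 4)) : Edge 4 1))))⁻¹ * (U (((((0 : Site 4 1), (1 : Fin 4)) : Edge 4 1))))⁻¹ : (Matrix.specialUnitaryGroup (Fin (2 + n)) ℂ)) : Matrix (Fin (2 + n)) (Fin (2 + n)) ℂ).trace.re : ℝ)) * (((((U (((((0 : Site 4 1), (1 : Fin 4)) : Edge 4 1)))) * (U (((((0 : Site 4 1), (3 : Fin 4)) : Edge 4 1)))) * (U (((((0 : Site 4 1), (1 : Fin 4)) : Edge 4 1))))⁻¹ * (U (((((0 : Site 4 1), (3 : Fin 4)) : Edge 4 1))))⁻¹ : (Matrix.specialUnitaryGroup (Fin (2 + n)) ℂ)) : Matrix (Fin (2 + n)) (Fin (2 + n)) ℂ).trace.re : ℝ)) ∂(Measure.pi (fun _ : Edge 4 1 => haarProbability (Matrix.specialUnitaryGroup (Fin (2 + n)) ℂ))) = (1 / (2 +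 n : ℝ)) * ∫ x, ∫ y, ((Complex.normSq (Matrix.trace ((x : (Matrix.specialUnitaryGroup (Fin (2 + n)) ℂ)) : Matrix (Fin (2 + n)) (Fin (2 + n)) ℂ)) : ℝ)) * ((((x * y * x⁻¹ * y⁻¹ : (Matrix.specialUnitaryGroup (Fin (2 + n)) ℂ)) : Matrix (Fin (2 + n)) (Fin (2 + n)) ℂ).trace.re : ℝ)) ∂(haarProbability (Matrix.specialUnitaryGroup (Fin (2 + n)) ℂ)) ∂(haarProbability (Matrix.specialUnitaryGroup (Fin (2 + n)) ℂ)) := by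
    have h := integral_link_PR (ι := Edge 4 1) (A := fun X Y : (Matrix.specialUnitaryGroup (Fin (2 + n)) ℂ) => ((((Y * X * Y⁻¹ * X⁻¹ : (Matrix.specialUnitaryGroup (Fin (2 + n)) ℂ)) : Matrix (Fin (2 + n)) (Fin (2 + n)) ℂ).trace.re : ℝ))) hcT hAT h01.symm h23.symm h13 h12 h03 h02
    simpa only using h
  have g3 : ∫ U, (((((U (((((0 : Site 4 1), (2 : Fin 4)) : Edge 4 1)))) * (U (((((0 : Site 4 1), (3 : Fin 4)) : Edge 4 1)))) * (U (((((0 : Site 4 1), (2 : Fin 4)) : Edge 4 1))))⁻¹ * (U (((((0 : Site 4 1), (3 : Fin 4)) : Edge 4 1))))⁻¹ : (Matrix.specialUnitaryGroup (Fin (2 + n)) ℂ)) : Matrix (Fin (2 + n)) (Fin (2 + n)) ℂ).trace.re : ℝ)) * (((((U (((((0 : Site 4 1), (1 : Fin 4)) : Edge 4 1)))) * (U (((((0 : Site 4 1), (3 : Fin 4)) : Edge 4 1)))) * (U (((((0 : Site 4 1), (1 : Fin 4)) : Edge 4 1))))⁻¹ * (U (((((0 : Site 4 1), (3 : Fin 4))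 : Edge 4 1))))⁻¹ : (Matrix.specialUnitaryGroup (Fin (2 + n)) ℂ)) : Matrix (Fin (2 + n)) (Fin (2 + n)) ℂ).trace.re : ℝ)) ∂(Measure.pi (fun _ : Edge 4 1 => haarProbability (Matrix.specialUnitaryGroup (Fin (2 + n)) ℂ))) = (1 / (2 + n : ℝ)) * ∫ x, ∫ y, ((Complex.normSq (Matrix.trace ((y : (Matrix.specialUnitaryGroup (Fin (2 + n)) ℂ)) : Matrix (Fin (2 + n)) (Fin (2 + n)) ℂ)) : ℝ)) * ((((x * y * x⁻¹ * y⁻¹ : (Matrix.specialUnitaryGroup (Fin (2 + n)) ℂ)) : Matrix (Fin (2 + n)) (Fin (2 + n)) ℂ).trace.re : ℝ)) ∂(haarProbability (Matrix.specialUnitaryGroup (Fin (2 + n)) ℂ)) ∂(haarProbability (Matrix.specialUnitaryGroup (Fin (2 + n)) ℂ)) := by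
    have h := integral_link_QR (ι := Edge 4 1) (B := fun X Y : (Matrix.specialUnitaryGroup (Fin (2 + n)) ℂ) => ((((Y * X * Y⁻¹ * X⁻¹ : (Matrix.specialUnitaryGroup (Fin (2 + n)) ℂ)) : Matrix (Fin (2 + n)) (Fin (2 + n)) ℂ).trace.re : ℝ))) hcT hAT h01.symm h23.symm h13 h12 h03 h02
    simpa only using h
  have g4 : ∫ U, (((((U (((((0 : Site 4 1), (1 : Fin 4)) : Edge 4 1)))) * (U (((((0 : Site 4 1), (3 : Fin 4)) : Edge 4 1)))) * (U (((((0 : Site 4 1), (1 : Fin 4)) : Edge 4 1))))⁻¹ * (U (((((0 : Site 4 1), (3 : Fin 4)) : Edge 4 1))))⁻¹ : (Matrix.specialUnitaryGroup (Fin (2 + n)) ℂ)) : Matrix (Fin (2 + n)) (Fin (2 + n)) ℂ).trace.re : ℝ)) ∂(Measure.pi (fun _ : Edge 4 1 => haarProbability (Matrix.specialUnitaryGroup (Fin (2 + n)) ℂ))) = ∫ x, ∫ y, ((((x * y * x⁻¹ * y⁻¹ : (Matrix.specialUnitaryGroup (Fin (2 + n)) ℂ)) : Matrix (Fin (2 +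 n)) (Fin (2 + n)) ℂ).trace.re : ℝ)) ∂(haarProbability (Matrix.specialUnitaryGroup (Fin (2 + n)) ℂ)) ∂(haarProbability (Matrix.specialUnitaryGroup (Fin (2 + n)) ℂ)) := integral_link_R (ι := Edge 4 1) h13
  simp only [a1, a2, eQP, b1, b2, c1, c2, c3, c4, d1, d2, d3, d4, f1, f2, f3, f4, g1, g2, g3, g4, eP, eQ, ePQ, kappa_expand]
  have hN : (2 + (n : ℝ)) ≠ 0 := by positivity
  push_cast
  field_simp
  ring

/-- ★★ **The one-site complementary-plane covariance of `SU(2+n)` is differentiable at `β = 0` with derivative `(4/N²)·κ_N`.**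
[cite: Wilson1974, §III (one-site Wilson action: Gibbs-tilted product Haar measure; bookkeeping)] -/
theorem hasDerivAt_complementaryPlaneCov_oneSite :
    HasDerivAt (fun β : ℝ => complementaryPlaneCov (2 + n) 1 β)
      (4 / ((2 + n : ℕ) : ℝ) ^ 2 * ∫ X, ∫ Y, (((Complex.normSq (Matrix.trace ((X : (Matrix.specialUnitaryGroup (Fin (2 + n)) ℂ)) : Matrix (Fin (2 + n)) (Fin (2 + n)) ℂ)) : ℝ)) - 1) * (((Complex.normSq (Matrix.trace ((Y : (Matrix.specialUnitaryGroup (Fin (2 + n)) ℂ)) : Matrix (Fin (2 + n)) (Fin (2 + n)) ℂ)) : ℝ)) - 1) * ((((X * Y * X⁻¹ * Y⁻¹ : (Matrix.specialUnitaryGroup (Fin (2 + n)) ℂ)) : Matrix (Fin (2 + n)) (Fin (2 + n)) ℂ).trace.re : ℝ)) ∂(haarProbability (Matrix.specialUnitaryGroup (Fin (2 + n)) ℂ)) ∂(haarProbability (Matrix.specialUnitaryGroup (Fin (2 + n)) ℂ))) 0 := by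
  haveI : SecondCountableTopology (Matrix.specialUnitaryGroup (Fin (2 + n)) ℂ) := secondCountableTopology_su' (n := n)
  have hρc : Continuous (fundamentalRep (Fin (2 + n))) := continuous_fundamentalRep (Fin (2 + n))
  -- the three observables, as opaque functions with defining equations
  obtain ⟨Pf, hPf⟩ : ∃ Pf : GaugeConfig 4 1 (Matrix.specialUnitaryGroup (Fin (2 + n)) ℂ) → ℝ, Pf = fun U => (((((U (((((0 : Site 4 1), (0 : Fin 4)) : Edge 4 1)))) * (U (((((0 : Site 4 1), (1 : Fin 4)) : Edge 4 1)))) * (U (((((0 : Site 4 1), (0 : Fin 4)) : Edge 4 1))))⁻¹ * (U (((((0 : Site 4 1), (1 : Fin 4)) : Edge 4 1))))⁻¹ : (Matrix.specialUnitaryGroup (Fin (2 + n)) ℂ)) : Matrix (Fin (2 + n)) (Fin (2 + n)) ℂ).trace.re : ℝ)) := ⟨_, rfl⟩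
  obtain ⟨Qf, hQf⟩ : ∃ Qf : GaugeConfig 4 1 (Matrix.specialUnitaryGroup (Fin (2 + n)) ℂ) → ℝ, Qf = fun U => (((((U (((((0 : Site 4 1), (2 : Fin 4)) : Edge 4 1)))) * (U (((((0 : Site 4 1), (3 : Fin 4)) : Edge 4 1)))) * (U (((((0 : Site 4 1), (2 : Fin 4)) : Edge 4 1))))⁻¹ * (U (((((0 : Site 4 1), (3 : Fin 4)) : Edge 4 1))))⁻¹ : (Matrix.specialUnitaryGroup (Fin (2 + n)) ℂ)) : Matrix (Fin (2 + n)) (Fin (2 + n)) ℂ).trace.re : ℝ)) := ⟨_, rfl⟩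
  obtain ⟨Xf, hXf⟩ : ∃ Xf : GaugeConfig 4 1 (Matrix.specialUnitaryGroup (Fin (2 + n)) ℂ) → ℝ,
      Xf = fun U => -(∑ p : Plaquette 4 1, (((2 + n : ℕ) : ℝ) - (((((U (p.1, p.2.1.1)) * (U (p.1, p.2.1.2)) * (U (p.1, p.2.1.1))⁻¹ * (U (p.1, p.2.1.2))⁻¹ : (Matrix.specialUnitaryGroup (Fin (2 + n)) ℂ)) : Matrix (Fin (2 + n)) (Fin (2 + n)) ℂ).trace.re : ℝ)))) := ⟨_, rfl⟩
  have hP : suPlaquetteReTrace (2 + n) 1 (originPlaquette 1 0 1 (by decide)) = Pf := by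
    rw [hPf]; funext U; rw [suPlaquetteReTrace_apply]; simp only [originPlaquette]; rw [plaquetteHolonomy_oneSite]
  have hQ : suPlaquetteReTrace (2 + n) 1 (originPlaquette 1 2 3 (by decide)) = Qf := by
    rw [hQf]; funext U; rw [suPlaquetteReTrace_apply]; simp only [originPlaquette]; rw [plaquetteHolonomy_oneSite]
  have hXw : ∀ U : GaugeConfig 4 1 (Matrix.specialUnitaryGroup (Fin (2 + n)) ℂ), -wilsonAction (fundamentalRep (Fin (2 + n))) U = Xf U := by
    intro U
    rw [hXf]
    unfold wilsonAction
    simp only [fundamentalRep_apply, plaquetteHolonomy_oneSite]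
  have hXfun : (fun U : GaugeConfig 4 1 (Matrix.specialUnitaryGroup (Fin (2 + n)) ℂ) => -wilsonAction (fundamentalRep (Fin (2 + n))) U) = Xf := funext hXw
  -- the Wilson measure of the one-site torus is product Haar tilted by `β · Xf`
  have hμ : ∀ β : ℝ, suWilsonMeasure (2 + n) 1 β = ((Measure.pi (fun _ : Edge 4 1 => haarProbability (Matrix.specialUnitaryGroup (Fin (2 + n)) ℂ)))).tilted (fun U => β * Xf U) := by
    intro β
    unfold suWilsonMeasure
    rw [wilsonMeasure_eq_tilted_pi _ hρc β]
    congr 1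
    funext U
    rw [← hXw U]
    ring
  -- bounds and measurability
  obtain ⟨BP, -, hBP⟩ := exists_bound_trace_re_nonneg (fundamentalRep (Fin (2 + n))) hρc
  obtain ⟨BX, hBX⟩ := exists_abs_wilsonAction_le (d := 4) (L := 1) (fundamentalRep (Fin (2 + n))) hρc
  have hXm : Measurable Xf := by
    rw [← hXfun]; exact (measurable_wilsonAction _ hρc).neg
  have hXb : ∀ U, |Xf U| ≤ BX := fun U => by rw [← hXw U, abs_neg]; exact hBX U
  have hPm : Measurable Pf := by rw [hPf]; exact (continuous_linkR _ _).measurable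
  have hQm : Measurable Qf := by rw [hQf]; exact (continuous_linkR _ _).measurable
  have hBP' : ∀ g : (Matrix.specialUnitaryGroup (Fin (2 + n)) ℂ), |((g : Matrix (Fin (2 + n)) (Fin (2 + n)) ℂ).trace).re| ≤ BP := fun g => by
    simpa only [fundamentalRep_apply] using hBP g
  have hPb : ∀ U, |Pf U| ≤ BP := fun U => by rw [hPf]; exact hBP' _
  have hQb : ∀ U, |Qf U| ≤ BP := fun U => by rw [hQf]; exact hBP' _
  have hPQm : Measurable (fun U => Pf U * Qf U) := hPm.mul hQm
  have hPQb : ∀ U, |(fun U => Pf U * Qf U) U| ≤ BP * BP := fun U => by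
    simp only [abs_mul]
    exact mul_le_mul (hPb U) (hQb U) (abs_nonneg _) ((abs_nonneg _).trans (hPb U))
  -- the first cumulants of the three tilted means
  have hA := hasDerivAt_integral_tilted_zero (μ := (Measure.pi (fun _ : Edge 4 1 => haarProbability (Matrix.specialUnitaryGroup (Fin (2 + n)) ℂ)))) hXm hPQm hXb hPQb
  have hB := hasDerivAt_integral_tilted_zero (μ := (Measure.pi (fun _ : Edge 4 1 => haarProbability (Matrix.specialUnitaryGroup (Fin (2 + n)) ℂ)))) hXm hPm hXb hPb
  have hC := hasDerivAt_integral_tilted_zero (μ := (Measure.pi (fun _ : Edge 4 1 => haarProbability (Matrix.specialUnitaryGroup (Fin (2 + n)) ℂ)))) hXm hQm hXb hQb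
  have hD := hA.sub (hB.mul hC)
  have h0 : ((Measure.pi (fun _ : Edge 4 1 => haarProbability (Matrix.specialUnitaryGroup (Fin (2 + n)) ℂ)))).tilted (fun U => (0 : ℝ) * Xf U) = (Measure.pi (fun _ : Edge 4 1 => haarProbability (Matrix.specialUnitaryGroup (Fin (2 + n)) ℂ))) := by simp
  simp only [h0] at hD
  -- the covariance as a function of `β`
  have hfun : (fun β : ℝ => complementaryPlaneCov (2 + n) 1 β) = fun β =>
      (∫ U, Pf U * Qf U ∂((Measure.pi (fun _ : Edge 4 1 => haarProbability (Matrix.specialUnitaryGroup (Fin (2 + n)) ℂ)))).tilted (fun U => β * Xf U)) -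
        (∫ U, Pf U ∂((Measure.pi (fun _ : Edge 4 1 => haarProbability (Matrix.specialUnitaryGroup (Fin (2 + n)) ℂ)))).tilted (fun U => β * Xf U)) * (∫ U, Qf U ∂((Measure.pi (fun _ : Edge 4 1 => haarProbability (Matrix.specialUnitaryGroup (Fin (2 + n)) ℂ)))).tilted (fun U => β * Xf U)) := by
    funext β
    unfold complementaryPlaneCov
    rw [covariance_suPlaquetteReTrace_eq, hμ β, hP, hQ]
  rw [hfun]
  refine hD.congr_deriv ?_
  subst hPf hQf hXf
  beta_reduce
  exact cumulant_value

end Value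

/-- ★★ **Crux `OneSiteCovDerivative` of route `ToronCumulantSign`** (stmt-QuantumFields-27531): for every `N ≥ 2` the one-site
complementary-plane covariance is differentiable at `β = 0` with derivative `(4/N²)·κ_N`.
[cite: Wilson1974, §III (one-site Wilson action: Gibbs-tilted product Haar measure; bookkeeping)] -/
theorem oneSiteCovDerivative_proof :
    ∀ N : ℕ, 2 ≤ N → HasDerivAt (fun β : ℝ => Literature.Barriers.QuantumFields.complementaryPlaneCov N 1 β) (4 / (N : ℝ) ^ 2 * ∫ X, ∫ Y, (Complex.normSq (X : Matrix (Fin N) (Fin N) ℂ).trace - 1) * (Complex.normSq (Y : Matrix (Fin N) (Fin N) ℂ).trace - 1) * ((X * Y * X⁻¹ * Y⁻¹ : Matrix.specialUnitaryGroup (Fin N) ℂ) : Matrix (Fin N) (Fin N) ℂ).trace.re ∂Literature.MathematicalPhysics.QuantumFieldTheory.haarProbability (Matrix.specialUnitaryGroup (Fin N) ℂ) ∂Literature.MathematicalPhysics.QuantumFieldTheory.haarProbability (Matrix.specialUnitaryGroup (Fin N) ℂ)) 0 := by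
  intro N hN
  obtain ⟨n, rfl⟩ := Nat.exists_eq_add_of_le hN
  exact hasDerivAt_complementaryPlaneCov_oneSite (n := n)

end Literature.MathematicalPhysics.QuantumFieldTheory.ToronCumulant

end Part6

/-!
## Part 7 — port of `Summits/QuantumFields/YangMills/Theorems/ToronCumulantSignOneSiteCovAtZero.lean` (3 declarations kept)

# Route `ToronCumulantSign` — the support `OneSiteCovAtZero` (stmt-QuantumFields-27532), PROVED

At `β = 0` the one-site (`L = 1`, Eguchi–Kawai) `SU(N)` Wilson measure is the product Haar probability measure on the four
links (`wilsonMeasure_zero`); the plaquette energy `Re tr U_(0;01)` is a (measurable) function of the links `0, 1` and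
`Re tr U_(0;23)` of the links `2, 3` (`plaquetteHolonomy_oneSite`: `U_(x;ij) = U_i U_j U_i⁻¹ U_j⁻¹`), so the two are independent
(`iIndepFun_pi` + `iIndepFun.indepFun_finset` + `IndepFun.comp`) and their covariance vanishes:
`complementaryPlaneCov N 1 0 = 0` for every `N ≥ 2` (indeed for every `N`).  No auxiliary definition is introduced.

HONEST LABEL: this is the trivial support of the line; the two cruxes (`CommutatorSkewMoment`, `OneSiteCovDerivative` — the Haar
moment computations) are OPEN and the barrier fact `ToronPlaneAnticorrelation` is NOT discharged here.  Nothing about the Yang–Mills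
mass gap.

References: J. Ginibre, CMP 16 (1970) 310–328 [Ginibre1970]; S. Chatterjee, arXiv:1803.01950 (§2, the lattice set-up).

(Verbatim declaration-level port — the declarations listed in the Part header count — of the Summits-side module; route
bookkeeping of the source docstring, if any, is historical; `local notation3` shorthands of the source are expanded in place.)
-/

section Part7

open _root_.MeasureTheory _root_.ProbabilityTheory
open Literature.MathematicalPhysics.QuantumFieldTheory Literature.MathematicalPhysics.QuantumLattice
open Literature.Barriers.QuantumFields

namespace Literature.MathematicalPhysics.QuantumFieldTheory.ToronCumulant

/-- The link-pair energy `v ↦ Re tr (v_a v_b v_a⁻¹ v_b⁻¹)` on a finset of one-site links is continuous, hence measurable. [cite: Wilson1974, §III (one-site Wilson action: Gibbs-tilted product Haar measure; bookkeeping)] -/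
theorem measurable_pairEnergy (N : ℕ) (S : Finset (Edge 4 1)) (a b : S) :
    Measurable (fun v : (e : S) → Matrix.specialUnitaryGroup (Fin N) ℂ =>
      (((v a * v b * (v a)⁻¹ * (v b)⁻¹ : Matrix.specialUnitaryGroup (Fin N) ℂ) : Matrix (Fin N) (Fin N) ℂ).trace).re) := by
  haveI := secondCountableTopology_su N
  have hc : Continuous (fun v : (e : S) → Matrix.specialUnitaryGroup (Fin N) ℂ =>
      (((v a * v b * (v a)⁻¹ * (v b)⁻¹ : Matrix.specialUnitaryGroup (Fin N) ℂ) : Matrix (Fin N) (Fin N) ℂ).trace).re) := by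
    have ha : Continuous fun v : (e : S) → Matrix.specialUnitaryGroup (Fin N) ℂ => v a := continuous_apply a
    have hb : Continuous fun v : (e : S) → Matrix.specialUnitaryGroup (Fin N) ℂ => v b := continuous_apply b
    have hprod : Continuous fun v : (e : S) → Matrix.specialUnitaryGroup (Fin N) ℂ => v a * v b * (v a)⁻¹ * (v b)⁻¹ :=
      ((ha.mul hb).mul ha.inv).mul hb.inv
    exact Complex.continuous_re.comp ((continuous_id.matrix_trace).comp (continuous_subtype_val.comp hprod))
  exact hc.measurable

/-- On the one-site torus, the plaquette energy through the origin in the plane `(i,j)` is the link-pair energy read on any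
finset of links containing `(0,i)` and `(0,j)`. [cite: Wilson1974, §III (one-site Wilson action: Gibbs-tilted product Haar measure; bookkeeping)] -/
theorem suPlaquetteReTrace_oneSite_eq (N : ℕ) (i j : Fin 4) (h : i < j) (S : Finset (Edge 4 1))
    (hi : ((0 : Site 4 1), i) ∈ S) (hj : ((0 : Site 4 1), j) ∈ S) :
    suPlaquetteReTrace N 1 (originPlaquette 1 i j h) =
      (fun v : (e : S) → Matrix.specialUnitaryGroup (Fin N) ℂ =>
        (((v ⟨_, hi⟩ * v ⟨_, hj⟩ * (v ⟨_, hi⟩)⁻¹ * (v ⟨_, hj⟩)⁻¹ : Matrix.specialUnitaryGroup (Fin N) ℂ) :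
          Matrix (Fin N) (Fin N) ℂ).trace).re) ∘
      fun (U : GaugeConfig 4 1 (Matrix.specialUnitaryGroup (Fin N) ℂ)) (e : S) => U e := by
  funext U
  rw [suPlaquetteReTrace_apply]
  simp only [originPlaquette, Function.comp_apply]
  rw [plaquetteHolonomy_oneSite]

/-- **Support `OneSiteCovAtZero` of route `ToronCumulantSign`** (stmt-QuantumFields-27532): at `β = 0` the complementary-plane
one-site covariance vanishes, by independence of disjoint link pairs under the product Haar measure.
[cite: Wilson1974, §III (one-site Wilson action: Gibbs-tilted product Haar measure; bookkeeping)] -/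
theorem oneSiteCovAtZero_proof :
    ∀ N : ℕ, 2 ≤ N → Literature.Barriers.QuantumFields.complementaryPlaneCov N 1 0 = 0 := by
  intro N _hN
  haveI := secondCountableTopology_su N
  haveI : IsProbabilityMeasure (haarProbability (Matrix.specialUnitaryGroup (Fin N) ℂ)) :=
    ⟨by simpa [haarProbability] using Measure.haarMeasure_self (G := Matrix.specialUnitaryGroup (Fin N) ℂ) (K₀ := ⊤)⟩
  unfold complementaryPlaneCov
  rw [covariance_suPlaquetteReTrace_eq]
  -- at `β = 0` the Wilson measure is product Haar
  have hμ : suWilsonMeasure N 1 0 =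
      Measure.pi (fun _ : Edge 4 1 => haarProbability (Matrix.specialUnitaryGroup (Fin N) ℂ)) := by
    unfold suWilsonMeasure
    exact wilsonMeasure_zero _
  rw [hμ]
  -- the coordinates are independent under the product measure
  have hind : iIndepFun (fun (e : Edge 4 1) (U : GaugeConfig 4 1 (Matrix.specialUnitaryGroup (Fin N) ℂ)) => U e)
      (Measure.pi (fun _ : Edge 4 1 => haarProbability (Matrix.specialUnitaryGroup (Fin N) ℂ))) :=
    iIndepFun_pi (X := fun (_ : Edge 4 1) (g : Matrix.specialUnitaryGroup (Fin N) ℂ) => g) (fun _ => aemeasurable_id)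
  -- the two disjoint link pairs
  let S : Finset (Edge 4 1) := {((0 : Site 4 1), (0 : Fin 4)), ((0 : Site 4 1), (1 : Fin 4))}
  let T : Finset (Edge 4 1) := {((0 : Site 4 1), (2 : Fin 4)), ((0 : Site 4 1), (3 : Fin 4))}
  have hST : Disjoint S T := by decide
  have hS0 : ((0 : Site 4 1), (0 : Fin 4)) ∈ S := by simp [S]
  have hS1 : ((0 : Site 4 1), (1 : Fin 4)) ∈ S := by simp [S]
  have hT2 : ((0 : Site 4 1), (2 : Fin 4)) ∈ T := by simp [T]
  have hT3 : ((0 : Site 4 1), (3 : Fin 4)) ∈ T := by simp [T]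
  have hindST := hind.indepFun_finset S T hST (fun e => measurable_pi_apply e)
  have hfg := hindST.comp (measurable_pairEnergy N S ⟨_, hS0⟩ ⟨_, hS1⟩) (measurable_pairEnergy N T ⟨_, hT2⟩ ⟨_, hT3⟩)
  rw [suPlaquetteReTrace_oneSite_eq N 0 1 (by decide) S hS0 hS1, suPlaquetteReTrace_oneSite_eq N 2 3 (by decide) T hT2 hT3]
  -- integrability (bounded continuous on a probability space) and the product formula
  have hmeas : ∀ (R : Finset (Edge 4 1)) (a b : R), AEStronglyMeasurable
      ((fun v : (e : R) → Matrix.specialUnitaryGroup (Fin N) ℂ =>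
        (((v a * v b * (v a)⁻¹ * (v b)⁻¹ : Matrix.specialUnitaryGroup (Fin N) ℂ) : Matrix (Fin N) (Fin N) ℂ).trace).re) ∘
        fun (U : GaugeConfig 4 1 (Matrix.specialUnitaryGroup (Fin N) ℂ)) (e : R) => U e)
      (Measure.pi (fun _ : Edge 4 1 => haarProbability (Matrix.specialUnitaryGroup (Fin N) ℂ))) := fun R a b =>
    ((measurable_pairEnergy N R a b).comp (measurable_pi_lambda _ fun e => measurable_pi_apply (e : Edge 4 1))).aestronglyMeasurable
  have key := hfg.integral_fun_mul_eq_mul_integral (hmeas S _ _) (hmeas T _ _)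
  simp only [Function.comp_apply] at key ⊢
  rw [key]
  ring

end Literature.MathematicalPhysics.QuantumFieldTheory.ToronCumulant

end Part7

/-! ## Part 8 — the EXACT discharge `ToronPlaneAnticorrelation_holds` -/

namespace Literature.Barriers.QuantumFields

open Literature.MathematicalPhysics.QuantumFieldTheory Literature.MathematicalPhysics.QuantumFieldTheory.ToronCumulant

/-- ★★★ **The barrier fact `ToronPlaneAnticorrelation` HOLDS**: for every `N ≥ 2` some `SU(N)` Wilson torus has a negatively correlated
complementary-plane plaquette pair (one-site witness `L = 1`, first `β`-cumulant `−4/(N³(N²−1))`).  EXACT-name discharge: the route's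
deciding argument (`f(0) = 0` by `oneSiteCovAtZero_proof`, `f′(0) = (4/N²)·κ_N` by `oneSiteCovDerivative_proof`, `κ_N = −1/(N(N²−1))` by
`commutatorSkewMoment_proof`, hence `f(β) < 0` for some small `β > 0`) fed into `toronPlaneAnticorrelation_of_oneSite` of the barrier
file.  Literature-side twin of the Summits-side `Summit.QuantumFields.YangMills.Theorems.ToronCumulantSign.toronPlaneAnticorrelation_holds`
(there via `Theses.ToronCumulantSign.closes`).  A BARRIER-LEDGER result; nothing about the mass gap.
[cite: CollinsSniady2006, Cor. 2.4 (degree-two unitary Weingarten formula behind witness (W1))] [cite: Wilson1974, §III] -/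
theorem ToronPlaneAnticorrelation_holds : ToronPlaneAnticorrelation := by
  have h₁ := ToronCumulant.commutatorSkewMoment_proof
  have h₂ := ToronCumulant.oneSiteCovDerivative_proof
  have h₀ := ToronCumulant.oneSiteCovAtZero_proof
  refine Literature.Barriers.QuantumFields.toronPlaneAnticorrelation_of_oneSite (fun N hN => ?_)
  have hd := h₂ N hN
  rw [h₁ N hN] at hd
  have hN' : (2 : ℝ) ≤ N := by exact_mod_cast hN
  have hpos : (0 : ℝ) < (N : ℝ) * ((N : ℝ) ^ 2 - 1) := by nlinarith
  have hc : 4 / (N : ℝ) ^ 2 * (-1 / ((N : ℝ) * ((N : ℝ) ^ 2 - 1))) < 0 :=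
    mul_neg_of_pos_of_neg (by positivity) (div_neg_of_neg_of_pos (by norm_num) hpos)
  -- real analysis: f 0 = 0, HasDerivAt f c 0, c < 0 ⇒ ∃ β > 0, f β < 0
  have ht := hd.tendsto_slope_zero_right
  have hev : ∀ᶠ t in nhdsWithin (0 : ℝ) (Set.Ioi 0),
      t⁻¹ • (Literature.Barriers.QuantumFields.complementaryPlaneCov N 1 (0 + t) -
        Literature.Barriers.QuantumFields.complementaryPlaneCov N 1 0) < 0 :=
    ht.eventually (Iio_mem_nhds hc)
  have hself : ∀ᶠ t in nhdsWithin (0 : ℝ) (Set.Ioi 0), t ∈ Set.Ioi (0 : ℝ) := self_mem_nhdsWithin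
  obtain ⟨t, hlt, ht0⟩ := (hev.and hself).exists
  refine ⟨t, ht0, ?_⟩
  rw [zero_add, h₀ N hN, sub_zero, smul_eq_mul] at hlt
  have hti : 0 < t⁻¹ := inv_pos.mpr ht0
  by_contra hft
  exact absurd hlt (not_lt.mpr (mul_nonneg hti.le (not_lt.mp hft)))

/-- **The barrier, unconditionally**: for every `N ≥ 2` there is an arena `(ℤ/L)⁴, β > 0` on which no product-closed local association
criterion admits all the `SU(N)` Wilson plaquette terms (`ToronPlaneAnticorrelation.exists_not_forall_admits` with its hypothesis
discharged). [cite: Ginibre1970, Prop. 5 and Remark 5 (factorization property of the criteria class)] -/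
theorem ToronPlaneAnticorrelation.exists_arena_not_forall_admits {N : ℕ} (hN : 2 ≤ N) :
    ∃ (L : ℕ) (_ : NeZero L) (β : ℝ), 0 < β ∧
      ∀ K : LocalAssociationCriterion 4 L (Matrix.specialUnitaryGroup (Fin N) ℂ)
          (Literature.MathematicalPhysics.QuantumLattice.fundamentalRep (Fin N)),
        ¬ ∀ r : Literature.MathematicalPhysics.QuantumFieldTheory.Plaquette 4 L,
          K.Admits (plaquetteTerm (Literature.MathematicalPhysics.QuantumLattice.fundamentalRep (Fin N)) β r) :=
  ToronPlaneAnticorrelation_holds.exists_not_forall_admits hN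

end Literature.Barriers.QuantumFields

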